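import Summits.BirchSwinnertonDyer.BirchSwinnertonDyer.Theses.ByReductionTypeAtTwo
import Summits.BirchSwinnertonDyer.BirchSwinnertonDyer.Theorems.ByReductionTypeAtTwoRankOneAtTwoOneDoorLawDefs
import Summits.BirchSwinnertonDyer.BirchSwinnertonDyer.Theorems.ByReductionTypeAtTwoRankOneAtTwoOneDoorLawCDefs
import Summits.BirchSwinnertonDyer.BirchSwinnertonDyer.Theorems.ByReductionTypeAtTwoRankOneAtTwoBigImageOddLocalOneDoorFullC
import Summits.BirchSwinnertonDyer.BirchSwinnertonDyer.Theorems.ByReductionTypeAtTwoRankOneAtTwoBigImageOddLocalOneDoorAnalyticAssemblyC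
import Summits.BirchSwinnertonDyer.BirchSwinnertonDyer.Theorems.ByReductionTypeAtTwoRankOneAtTwoBigImageOddLocalOneDoorAnalyticGlue
import Summits.BirchSwinnertonDyer.BirchSwinnertonDyer.Theorems.ByReductionTypeAtTwoRankOneAtTwoBigImageOddLocalOneDoorValue
import Summits.BirchSwinnertonDyer.BirchSwinnertonDyer.Theorems.ByReductionTypeAtTwoRankOneAtTwoBigImageOddLocalOneDoorTamagawa
import Summits.BirchSwinnertonDyer.BirchSwinnertonDyer.Theorems.ByReductionTypeAtTwoRankOneAtTwoBigImageOddLocalOneDoorKolyvaginExactBridgeSupply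
import Summits.BirchSwinnertonDyer.BirchSwinnertonDyer.Theorems.CMKolyvaginAtInertTwoCMExactDescentAtTwoGeneral
import Summits.BirchSwinnertonDyer.BirchSwinnertonDyer.Theorems.GenusKolyvaginAtTwoCyclicTorsionOfNegDisc
import Literature.NumberTheory.EllipticCurves.TwoAdicImageNonSurjectiveFamiliesProofs
import Literature.NumberTheory.EllipticCurves.LocalTorsionMultiplicativeProofs
import Literature.NumberTheory.EllipticCurves.NonsplitProofs
import Literature.NumberTheory.EllipticCurves.NeronComponentIndexSplitProofs
import Literature.NumberTheory.Automorphic.ShimuraCurveRibetTakahashiComponentPackage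
import Summits.BirchSwinnertonDyer.Rank1Residual.X11b.BDPRouteRTDegreeTelescope
import HarnessLib
import Summits.BirchSwinnertonDyer.BirchSwinnertonDyer.Theorems.GenusKolyvaginAtTwoEquivariantChebotarevAtTwoStepB
import Summits.BirchSwinnertonDyer.BirchSwinnertonDyer.Theorems.ClassRecordThreeShimuraKolyvaginImageInputs
import Literature.NumberTheory.EllipticCurves.NonEisensteinPrimeOfSurjective

/-!
# Engine quarry (g6) for the line `refined_kolyvagin_tamagawa_shift_at_two`

Crux `RankOneAtTwoOffBigImageOddLocal` (item `stmt-BirchSwinnertonDyer-23716`, route `ByReductionTypeAtTwo`),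
skeleton `Lines/refined_kolyvagin_tamagawa_shift_at_two.lean` (seven registered-to-be `stub_*`, untouched by g6),
card `Lines/refined_kolyvagin_tamagawa_shift_at_two.md` (§ LEAD QUICKSTART / ENGINE-PORT MAP point here).

**Status.** Every declaration in this file is PROVED (0 `sorry`). Nothing here proves the crux, `BSDp W 2`, BSD or the
summit; no `stub_*` of the skeleton is discharged by this file alone. `Cruxes/` files are not importable: the lead
COPIES what it needs into its `Theorems/…` engine port (`ledger propose … --supports stmt-BirchSwinnertonDyer-23716`).

**What it supplies** (kernel-closable item #3 of PEN-PICK-23716-r1 ADD-4: the `FrobNontrivialModTwo` / regular-supply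
ENGINE PORT, i.e. replacing `c₀` by a regular element `h₀` in the tree engine
`Theorems.GenusExact.exists_kolyvaginPrime_gt_two_of_galoisElement`):

* §A  LEVEL-1 DICTIONARY (filter ↔ Galois).  `sign_permGal_eq_one_iff`: for `W` globally minimal, `ℓ ∤ 2Δ_min` and ANY
  arithmetic Frobenius `σ` at `𝔓 ∣ ℓ`, `sign(σ|E[2]) = +1 ↔ IsSquare (Δ_min mod ℓ)` — so the skeleton's filter
  `RegularAtTwo W ℓ` (`regularAtTwo_iff`) says exactly "`Frob_ℓ` is a transposition on `E[2]`".  Corollaries: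
  `exists_smul_twoTorsion_ne_of_not_isSquare` (FILTER ⟹ the hypothesis `∃ v : E[2], h • v ≠ v` of R1
  `CyclicTorsionOfRegularElement`, for EVERY Frobenius above `ℓ`), `frobNontrivialModTwo_of_not_isSquare` (FILTER ⟹ the
  body of card #7's `FrobNontrivialModTwo W ℓ`), `not_isSquare_of_transposition` (ENGINE output "`σ` moves a point of
  `E[2]` and fixes a nonzero one" ⟹ FILTER).  Ingredient: `smul_eq_neg_of_isArithFrobAt`, the non-split companion of the
  tree's `DeuringLadic.smul_eq_self_of_isArithFrobAt` (`d` non-square mod `p` ⟹ `Frob √d = -√d`), applied to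
  `(64 δ)² = 256 Δ_min` (`delta64_sq`, from `TwoAdicImageSurjectivityModTwoProofs.algebraMap_Δ`).
* §B  PARITY CHARACTERS OF `GL₂(ℤ/2^{M+1})` (regular supply at `Δ > 0`, step E1a of the card's ENGINE-PORT MAP).
  `charGL_eq`: a homomorphism `ψ : GL₂(ℤ/2^{M+1}) → A` (abelian) with `ψ(u)² = 1`, `u = [[1,1],[0,1]]`, satisfies on
  `SL₂`:  `ψ(s) = ψ(u)` if `s` is ODD mod `2` (`OddModTwo s`: `s̄ ∈ S₃ = SL₂(𝔽₂)` a transposition) and `ψ(s) = 1`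
  otherwise — i.e. `ψ|SL₂ ∈ {1, sgn ∘ red₂}` (LDU factorisation `ldu` + the relations `ψ(l) = ψ(u)`, `ψ(diag) = 1`
  forced by conjugation with `J = [[0,1],[1,0]]` and `diag(a,1)`).  `charGL_eq_one`, `charGL_eq_of_det_eq`: if
  `ψ(u) = 1` then `ψ` factors through `det`; `charGL_mul_inv_eq`: the general transport formula.  USE (card E1c): with
  `ψ = (ρ_{E,2^{M+1}} × res_K)`-graph character `Gal → GL₂ × Gal(K/ℚ) → …` (§C), either `ψ(u) = 1` — then every
  `g ∈ GL₂(ℤ/2^{M+1})` with `det g = -1` in the image has a lift restricting to `τ ≠ 1` on `K`, in particular a REGULAR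
  involution class `[[1,1],[0,-1]]` (odd mod 2, det `-1`) when `ρ` is surjective mod `2^{M+1}` — or `ψ|SL₂ = sgn∘red₂`,
  which together with `det ρ = χ_cyc` (`det_galoisRepTate_eq_cyclotomicCharacter_holds`) and
  `isSquare_Δ_iff_forall_smul_delta` pins `K ∈ {ℚ(√-Δ), ℚ(√-2Δ)}`… — exactly the two `¬ IsSquare` binders of the crux's
  regular cells (the refuted-misstated `EquivariantChebotarevAtTwo`, negatives `stmt-…-24881`, is honoured, not re-asked).
* §D  COSET ABSORPTION (`exists_add_mem_smul_ne_zero`, `exists_smul_add_map_ne_zero`): the one-line move of step E2.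
* §C  GOURSAT FOR A `C₂` FACTOR.  `graph_dichotomy_of_fst_surjective`: a subgroup `H ≤ G × C` surjecting onto `G` either
  contains `(1, c)` with `c ≠ 1` or is the graph of a homomorphism `ψ : G → C` — the dichotomy feeding §B.

* §E  THE (3.3) PORT, `c₀ ↦` ANY ELEMENT INVERTING `μ` (step E0, PROVED here): `pow_dvd_add_one_of_frob_smul_eq_of_inverts`
  (`p^M ∣ ℓ + 1`) and `pow_dvd_frobeniusTraceAt_of_frob_smul_eq_of_inverts` (`p^M ∣ a_ℓ`) for a Frobenius acting on `E[p^M]` as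
  an element `c₀` that inverts `μ_{p^M}` (and, for the trace, squares to `1` ON `E[p^M]` — `h₀² ≠ 1` in `Γ_ℚ` is allowed), plus
  the converse Weil-pairing algebra `smul_eq_inv_of_det_repr_eq_neg_one`: determinant `-1` in a basis of `E[p^{n+1}]` ⟹
  inverts `μ_{p^{n+1}}` — which is how the lead obtains the inverting hypothesis for the regular `h₀` of E1.

  Also `smul_eq_self_of_smul_basis_eq_self`: an element fixing a basis of `E[p^{n+1}]` fixes `μ_{p^{n+1}}` (propagates the
  inverting hypothesis from `h₀` to `h₀ · res n`, `n ∈ Γ_{K(E[2^M])}`).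
* §F  STEPS C–H FOR A REGULAR ELEMENT (step E3, PROVED here): `exists_kolyvaginPrime_gt_two_of_galoisElement_regular` — the
  tree engine `GenusExact.exists_kolyvaginPrime_gt_two_of_galoisElement` (which carries `hc₀ : IsComplexConjugation … c₀` AND
  `ρ ∈ Γ_{K(E[2^M])}`, so that its Kolyvagin primes have `Frob_ℓ ∼ c₀` on `E[2^M]` — useless at `Δ > 0` where `c₀ = 1` on
  `E[2]`) re-proved for an ARBITRARY `ρ ∈ Γ_K` with `h₀ := c₀ · res ρ` satisfying `h₀² = 1` on `E(ℚ̄)[2^M]` and `h₀ • ζ = ζ⁻¹`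
  on `μ_{2^M}`: for every bound `b` a prime `ℓ > b`, `ℓ ∤ 2 N d_K`, `(ℓ)` inert in `K`, a Frobenius above `ℓ` acting on
  `E[2^M]` AS `h₀` and on `K` as `c₀`, `2^M ∣ ℓ + 1`, `2^M ∣ a_ℓ`, and `ord c_{i,λ} = 2^{N_i}` exactly.  Same Čebotarev
  (`hC : Automorphic.chebotarev_artinRep`, a tree theorem) in the open set `c₀ · res(ρ𝒩)`; the two changed steps are
  `Frob_λ ∈ Γ_{K(E[2^M])}` (from `h₀² = 1` via `RatClosure.torsionEquiv`) and (3.3) (from §E).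

* §G  REGULAR-LIFT DICHOTOMY (step E1c at GROUP level, PROVED here): `regular_lift_dichotomy` — for `φ : G ↠ GL₂(ℤ/2^{M+1})`,
  `χ : G → A` with `A = {1, τ}` and `χ g₀ = τ`: EITHER every `R` with `det R = det φ(g₀)` lifts to `g` with `φ g = R`, `χ g = τ`
  (`exists_regular_lift`: the regular involution `regR = [[1,1],[0,-1]]`, `det_regR = -1`, `regR² = 1`, `oddModTwoGL_regR`) OR
  `τ ≠ 1` and `χ = sgn(red₂ φ) · ε(det φ)` for a character `ε` of `(ℤ/2^{M+1})ˣ` (`charGL_eq_general`: EVERY `ψ` with `ψ(u)² = 1`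
  is `sgn^a · (ε ∘ det)`, `ε = ψ ∘ diagHom`), with `eps_det_eq_of_not_odd`: `ε(det φ g₀) = τ` if `φ g₀` is even mod 2 (`Δ > 0`).

* §H  STEP B FOR A REGULAR ELEMENT (step E2, PROVED here; needs the extra import `…Theorems.GenusKolyvaginAtTwoEquivariantChebotarevAtTwoStepB`
  for `GenusExact.exists_h1Eval_eq_of_indep_of_res` / `h1Eval_conjGalCMH_of_tauStable` / `zsmul_pow_sub_order`):
  `exists_orders_regular` (module algebra: targets `x` with `κ_i + A x_{π i} + x_i` of EXACT order `2^{N_i}`, for an additive involution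
  `A`, constants `κ` with `A κ_{π i} = κ_i`, a point `P` with `P + A P` of order `2^M` and `ker(A-1) = im(A+1)` on `T[2^e]` — the tree's
  `exists_orders_of_tauStable` is `κ = 0`, `A = τ`), `exists_h1Eval_conj_mul_order_regular` (McCallum's (2) / Gross 9.3 for `ρ = ρ₀ · n`,
  `n ∈ Γ_{K(E[n])}`, `ρ₀ ∈ Γ_K` FIXED with `k₀ := ρ₀^τ ρ₀ ∈ Γ_{K(E[n])}`: `[c_i, (ρ m)^τ (ρ m)] = [c_i, k₀] + ρ₀⁻¹τ[c_{π i}, n] + [c_i, n]`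
  has exact order `2^{N_i}` for all `m ∈ 𝒩`), and the ℚ-side packaging `exists_galoisElement_regular_rat` (input: `h₀ = c₀ · res ρ₀` with
  `h₀² = 1` on `E(ℚ̄)[2^M]`, a point `P` with `P + h₀P` of order `2^M`, `ker(h₀-1) = im(h₀+1)` on `E[2^e]`; output: `ρ` with the SAME action
  `c₀ · res ρ = h₀` on `E(ℚ̄)[2^M]` and exactly the hypothesis `hρ` of §F) — so E2 + E3 are now BOTH proved: the lead's remaining port is
  E1c-arithmetic (produce `ρ₀`, `P` from §G + R1/LKL) and `hμ` (`h₀` inverts `μ_{2^M}`, §E `smul_eq_inv_of_det_repr_eq_neg_one`).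

* §I  REGULAR SUPPLY BY RAMIFIED INERTIA (step E1c′, PROVED here — supersedes E1c-arithmetic for every Heegner field `K` with an odd
  ramified prime, i.e. `d_K ∉ {-4, -8}`): `exists_smul_torsion_eq_self_and_not_mem_range` (a good place `v ∤ n` of `E/ℚ` under which `K` has a
  unique prime of residue degree `1` — `v` RAMIFIED in `K` — yields `g ∈ Γ_ℚ` acting TRIVIALLY on `E(ℚ̄)[n]` and NON-trivially on `K`: inertia,
  `smul_geomTorsion_eq_of_mem_inertia` + `exists_mem_inertia_not_mem_range`; i.e. `(1, τ) ∈ G` in §C, so the exceptional branch of §G never occurs),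
  `exists_smul_eq_addAut_and_not_mem_range` (+ surjectivity of `ρ_{E,n}` onto `Aut(E[n])` = the crux's full-image binder: EVERY `A ∈ Aut(E(ℚ̄)[n])` is the
  action of some `h₀ ∉ Γ_K`), `exists_eq_mul_absGaloisRestrict` (index two: `h₀ = c₀ · res ρ₀`), `exists_mul_absGaloisRestrict_smul_eq_addAut` (assembled for
  `K` imaginary quadratic and `c₀` complex conjugation: `∃ ρ₀ : Γ_K, ∀ P, (c₀ * res ρ₀) • P = A P` — the input `ρ₀` of §H with `A` the regular involution;
  `K : Type` as in the skeleton's stubs).  Heegner fields are unramified at the primes of `N` (they split), so any odd prime `q ∣ d_K` is a good place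
  with `q ∤ 2N`; only `K ∈ {ℚ(i), ℚ(√-2)}` lack one, and those two are avoided in the CHOICE of `K` (or handled by §G).
* §I′ THE SAME IN THE SKELETON'S VOCABULARY (v7, PROVED; second import `…Theorems.ClassRecordThreeShimuraKolyvaginImageDisjoint` = the tree's
  kernel proof of Gross 1991 §9 «`K` and `ℚ(E[n])` are disjoint»: `ShimuraKolyvaginImageDisjoint.exists_absGaloisRestrict_smul_eq`, `ρ̄_{E,n}(res Γ_K) =
  ρ̄_{E,n}(Γ_ℚ)` for `[K:ℚ] = 2`, `q ∣ d_K`, `q ∤ n N_E`): `exists_mul_absGaloisRestrict_smul_eq_addAut_of_dvd_discr` (`[K:ℚ] = 2`, a prime `q ∣ d_K`, `q ∤ N_E`,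
  `q ∤ n`, `ρ̄_{E,n}` surjective ⇒ `∀ c₀ A, ∃ ρ₀ : Γ_K, ∀ P, (c₀ * res ρ₀) • P = A P` — NO hypothesis on `c₀`) and
  **`exists_mul_absGaloisRestrict_smul_eq_addAut_of_doorAdmissible (hK : IsImaginaryQuadratic K) (hD : DoorAdmissible W (discr K))
  (hsurj : W.HasSurjectiveModNGaloisRep ((2 ^ k : ℕ) : ℤ)) (c₀) (A : AddAut (geomTorsion W ((2 ^ k : ℕ) : ℤ))) : ∃ ρ₀ : Γ_K, ∀ P, (c₀ * res ρ₀) • P = A P`**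
  — hypotheses = the skeleton's stub binders VERBATIM (`DoorAdmissible` ⇒ `d_K ≡ 1 (mod 8)` odd and good reduction at every `q ∣ d_K`; Minkowski supplies
  `q`).  So the regular supply E1c/E1c′ is CLOSED for the skeleton: no field is excluded, no character classification, no place data to supply.

* §J  THE REGULAR INVOLUTION AND THE COMPLETE SUPPLY (v8, PROVED): `reg b` / `regAut b` = `[[1,1],[0,-1]]` in a `ZMod q`-basis `b` of a rank-2 free module
  (`reg_reg` involution, `det_reg` = `-1` in §E's format, `exists_eq_add_reg_of_reg_eq` = R1/LKL LOSSLESS `ker(reg-1) = im(reg+1)` on every `c`-torsion,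
  `basis_one_add_reg` + `zsmul_basis_ne_zero` + `two_pow_ne_zero_zmod` = the point `P = b₁` with `2^n (P + reg P) ≠ 0`), `nonempty_basis_geomTorsion` (a `ZMod m`-basis
  of `E(ℚ̄)[m]` for the tree's `AddSubgroup.torsionBy.zmodModule`, from `nonempty_geomTorsion_addEquiv_prod`, AEC III.6.4(b)), and the capstone
  **`exists_regular_galoisElement_of_doorAdmissible (hK : IsImaginaryQuadratic K) (hD : DoorAdmissible W (discr K)) (n) (hsurj : W.HasSurjectiveModNGaloisRep (2^(n+1))) (c₀) :
  ∃ ρ₀ P, hsq ∧ hP1 ∧ hker ∧ hμ`** for `h₀ = c₀ · res ρ₀` on `E[2^{n+1}]` (`M = n+1`): EXACTLY the inputs `hsq`/`hP1`/`hker` of §H `exists_galoisElement_regular_rat` and — in the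
  transferable form `∀ σ, (∀ X, σ • X = h₀ • X) → σ inverts μ_{2^{n+1}}` — the input `hμ` of §F for the final `c₀ · res ρ`.  With §J the E-port needs NO further arithmetic:
  the lead's kernel-closable #3 is the plumbing §J → §H → §F (+ the tree's `hS`/`hC`/Čebotarev tokens already in §F's binders).

* §K  THE ENGINE PORT END-TO-END (v9, PROVED): **`exists_regular_kolyvaginPrime_of_doorAdmissible`** — from the skeleton's binders (`hK : IsImaginaryQuadratic K`,
  `hD : DoorAdmissible W d_K`, `hsurj : W.HasSurjectiveModNGaloisRep (2^(n+1))`, `hc₀` complex conjugation, `hc : c ≠ 1`, the tree's image tokens `hS`/`hC` on `E(K̄)[2]`,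
  τ-stable class data `cs π e Nv` as in the tree's Step B, `hCheb : Automorphic.chebotarev_artinRep`) to `∃ ρ : Γ_K` with `h = c₀ · res ρ` an involution on `E[2^{n+1}]`
  inverting `μ_{2^{n+1}}`, LOSSLESS (`ker(h-1) = im(h+1)` at every level, a point with `2^n (P + hP) ≠ 0`), and for every `b` a Kolyvagin prime `ℓ > b`, `ℓ ∤ 2 N d_K`,
  inert in `K`, `Frob ∼ h` on `E[2^{n+1}]` and `∼ c₀` on `K`, `2^{n+1} ∣ ℓ + 1`, `2^{n+1} ∣ a_ℓ`, `ord c_{i,λ} = 2^{Nv i}` exactly — the composite §J → §H → §F,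
  i.e. the pen's kernel-closable #3 (regular supply + Step B + Steps C–H) PROVED in this quarry; what the lead ports is only the `FrobEqFrobInfty`-token
  renaming downstream (E4) and the skeleton plumbing.

* §L  THE IMAGE TOKENS AT `2` (v10, PROVED) and the BIG-IMAGE-STUB variants: the coordinate swap `swp`/`swpAut`, **`exists_eq_smul_of_comm_reg_swp`** (the commutant of
  `{[[1,1],[0,-1]], [[0,1],[1,0]]}` in `End((ℤ/q)²)` is the scalars), **`exists_eq_zsmul_of_supply`** (a `Γ_K`-equivariant endomorphism of `E(K̄)[m]` is an integer,
  given the regular supply — the tree's `exists_eq_zsmul_baseChange_of_irr` excludes `p = 2`), **`imageTokens_two (hK2) (hq) (hqd) (hqN) (hq2) (hρ2 : ρ̄_{E,2} onto) : hS ∧ hC`**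
  (simplicity via the tree's `hasIrreducibleModPGaloisRep_of_hasSurjectiveModNGaloisRep` + `ShimuraKolyvaginImageInputs.hasIrreducibleModPGaloisRep_baseChange`),
  `exists_ramifiedPrime_of_doorAdmissible` / `_of_heegner`, `imageTokens_two_of_doorAdmissible` / `_of_heegner`.  §I′/§J/§K now come in THREE forms each: `_of_supply`
  (generic: every `A ∈ Aut E[2^{n+1}]` is some `c₀ · res ρ₀`), `_of_doorAdmissible` (door-law stubs: `DoorAdmissible W d_K`) and `_of_heegner` (big-image stubs S3/S4/S5:
  `Odd d_K`, `SatisfiesHeegnerHypothesis N_E K` — their binders verbatim); the two specialised forms of §K take `hρ2 : W.HasSurjectiveModNGaloisRep 2` INSTEAD of the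
  tokens `hS`/`hC`, so that **the engine port's hypotheses are exactly: stub binders + `hc₀`/`hc` + τ-stable class data + `hCheb`.**
* §J+ (v13, PROVED) ANTI-LOSSLESS `exists_eq_sub_reg_of_reg_eq_neg` (`Ĥ⁻¹(⟨reg⟩, T[c]) = 0`; with R1/LKL `exists_eq_add_reg_of_reg_eq` = `Ĥ⁰ = 0`: the regular involution is
  cohomologically trivial on every `T[2^e]`, vs `Ĥ⁰ ≅ Ĥ⁻¹ ≅ (ℤ/2)²` for `diag(1,-1)` — card (E4-γ3)).
* §M  (v11, PROVED) the regular primes in the STUB VOCABULARY: `zhang_isKolyvaginPrime_two_of_regular` (`Zhang2014.IsKolyvaginPrime N W K 2 ℓ ∧ n+1 ≤ M(ℓ) ∧ (n+1 : ℕ∞) ≤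
  levelIndex W 2 ℓ`), `le_levelIndex_two_of_forall` (square-free products), and **`exists_regular_zhangKolyvaginPrimes_of_heegner`** = §K `_of_heegner` with `∃ ρ, … ∧ ∀ b, ∃ ℓ > b,
  Zhang2014.IsKolyvaginPrime N W K 2 ℓ ∧ (n+1 : ℕ∞) ≤ levelIndex W 2 ℓ ∧ Frob-clause ∧ exact local orders` (v11 also moves `∀ b` INSIDE `∃ ρ` in all §K forms: one `h` serves
  infinitely many `ℓ`).
  + `exists_regular_zhangKolyvaginPrimes_of_heegner_primesOnly` (v12): the SELF-CONTAINED class-free supply — hypotheses `hCheb` + stub binders ONLY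
  (`c₀`, `c` produced by `exists_isComplexConjugation` / `#Aut(K/ℚ) = 2`).
* §N  (v12, PROVED; lives in the SEPARATE self-contained workfile `RefinedKolyvaginEngineG6LocalN.lean` — this file is at the 200 kB workfile cap)
  LOCAL TRIVIALITY AT REGULAR KOLYVAGIN PRIMES (E4-β): `exists_isArithFrobAt_mem_torsionFixing_regular` (a Frobenius `F ∈ Γ_K` at any
  `𝔔 ∣ λ` FIXING `E(K̄)[m]`, `res F = h² = 1`), `absGaloisRestrict_smul_geomTorsion_eq_regular` (all of `Γ_{K_λ}` fixes `E(K̄)[m]`: good reduction, `λ ∤ m`),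
  `hasGoodReductionAt_of_not_dvd_conductorNorm` / `hasGoodReductionAt_baseChange_of_rat` (dictionary), and the packaged
  **`absGaloisRestrict_smul_geomTorsion_eq_of_regularKolyvaginPrime`** whose hypotheses are exactly the clauses of §K's `_of_heegner` output (`N := N_E`).
  These are the regular replacements of `exists_isArithFrobAt_mem_torsionFixing` / `absGaloisRestrict_smul_geomTorsion_eq_of_kolyvaginPrime(_pow)`,
  the entry point of every Euler-system local computation at `λ` (`H¹(K_λ, E[m]) = Hom(Γ_{K_λ}, E[m])`).

Steps E1c-ARITHMETIC (instantiate §G with `G = Γ_ℚ`, `φ = ρ_{E,2^{M+1}}` in a basis, `χ = res_K`, `g₀ = c₀`; close the exceptional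
branch by `sgn ∘ red₂ ∘ ρ̄ = χ_{ℚ(√Δ)}` (§A / `isSquare_Δ_iff_forall_smul_delta`) and `ε ∘ χ_cyc ∈ {1, χ₋₄, χ₈, χ₋₈}` against the
crux-side exclusions `K ∉ {ℚ(√-Δ), ℚ(√-2Δ)}`; then `ρ₀ ∈ Γ_K` with `c₀ · res ρ₀ = h₀`) and E2 (Step B with `ρ = ρ₀ n`: `[c_i, conj(ρm)·ρm] = [c_i, k₀] + (1 + ν_i ρ(h₀)⁻¹)[c_i, n]`,
`k₀ := conj(ρ₀)ρ₀ ∈ Γ_{K(E[2^M])}`; the constant is absorbed by §D and `(1 ± ρ(h₀)) E[2^M]` contains exact-order-`2^M` points —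
LOSSLESS, R1/LKL in the lead's `…RegularFilterAlgebra`) are the LEAD's port; then §F closes Steps C–H.  See the card.

Refs: [GrossLMS1991] §3 (3.1)–(3.3); [McCallumLMS1991] §3; [SilvermanAEC2009] III.§1 (`disc = 16Δ`), VII–VIII;
Dokchitser–Dokchitser, *Surjectivity mod 2* (2012) (tree `DokchitserDokchitser2012.*`); Serre, *Propriétés galoisiennes*
(1972) §5.3 (parity character `GL₂(ℤ/2) ≅ S₃ → {±1}`).
-/

set_option autoImplicit false

noncomputable section

namespace Summit.BirchSwinnertonDyer.BirchSwinnertonDyer.Cruxes.RankOneAtTwoOffBigImageOddLocal.RefinedKolyvaginTamagawaShiftAtTwo.EngineG6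

/-! ## §A  Level-1 dictionary: `RegularAtTwo` (Legendre symbol of `Δ_min`) ↔ Frobenius parity on `E[2]` -/

section DictionaryA

open WeierstrassCurve NumberField IsDedekindDomain Field
open Literature.NumberTheory.GaloisRepresentations Literature.NumberTheory.EllipticCurves
open Literature.NumberTheory.EllipticCurves.DokchitserDokchitser2012
open Literature.NumberTheory.EllipticCurves.DeuringLadic

/-- **Companion of the tree's `DeuringLadic.smul_eq_self_of_isArithFrobAt` (non-split case).** `p` odd prime, `p ∤ d`,
`d` a NON-square mod `p`, `s² = d`, `σ` an arithmetic Frobenius at `𝔓 ∣ p`: `σ s = -s`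
(`σ s ≡ s^p = s·d^{(p-1)/2} ≡ -s (mod 𝔓)` by Euler's criterion; `σ s = s` would give `2s ∈ 𝔓`, `4d ∈ 𝔓 ∩ ℤ = pℤ`). [folklore] -/
theorem smul_eq_neg_of_isArithFrobAt {p : ℕ} (hp : p.Prime) (h2 : p ≠ 2) {d : ℤ}
    (hpd : ¬ (p : ℤ) ∣ d) (hsq : ¬ IsSquare ((d : ℤ) : ZMod p)) {s : AlgebraicClosure ℚ}
    (hs : s ^ 2 = (d : AlgebraicClosure ℚ)) {v : HeightOneSpectrum (𝓞 ℚ)}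
    (hv : (Rat.HeightOneSpectrum.primesEquiv v : ℕ) = p) {𝔓 : Ideal (absIntegers (𝓞 ℚ) ℚ)}
    (h𝔓 : 𝔓 ∈ v.primesAbove) {σ : absoluteGaloisGroup ℚ} (hσ : IsArithFrobAt (𝓞 ℚ) σ 𝔓) :
    σ • s = -s := by
  haveI : 𝔓.IsPrime := h𝔓.1
  haveI : Fact p.Prime := ⟨hp⟩
  have hsi : IsIntegral (𝓞 ℚ) s := by
    refine IsIntegral.of_pow two_pos ?_
    rw [hs, show (d : AlgebraicClosure ℚ) = algebraMap (𝓞 ℚ) (AlgebraicClosure ℚ) (d : 𝓞 ℚ) by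
      rw [map_intCast]]
    exact isIntegral_algebraMap
  set x : absIntegers (𝓞 ℚ) ℚ := ⟨s, hsi⟩ with hx
  have hxs : (x : AlgebraicClosure ℚ) = s := rfl
  have hx2 : x ^ 2 = (d : absIntegers (𝓞 ℚ) ℚ) := Subtype.ext (by simp [hxs, hs])
  have hpv : (p : 𝓞 ℚ) ∈ v.asIdeal := (natCast_mem_asIdeal_iff v p).mpr (by rw [hv])
  have hp𝔓 : (p : absIntegers (𝓞 ℚ) ℚ) ∈ 𝔓 := by
    have := hpv
    rw [h𝔓.2.over, Ideal.mem_under, map_natCast] at this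
    exact this
  have hres : v.residueCard = p := residueCard_eq_of_natCast_mem_rat hp hpv
  have hd0 : ((d : ℤ) : ZMod p) ≠ 0 := by
    rwa [Ne, ZMod.intCast_zmod_eq_zero_iff_dvd]
  -- Euler's criterion, non-residue: `p ∣ d ^ (p / 2) + 1`
  have heuler : (p : ℤ) ∣ d ^ (p / 2) + 1 := by
    rw [← ZMod.intCast_zmod_eq_zero_iff_dvd]
    push_cast
    rcases ZMod.pow_div_two_eq_neg_one_or_one p hd0 with h1 | h1
    · exact absurd ((ZMod.euler_criterion p hd0).mpr h1) hsq
    · rw [h1, neg_add_cancel]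
  have hdk : ((d : absIntegers (𝓞 ℚ) ℚ)) ^ (p / 2) + 1 ∈ 𝔓 := by
    obtain ⟨k, hk⟩ := heuler
    have : ((d : absIntegers (𝓞 ℚ) ℚ)) ^ (p / 2) + 1 = (p : absIntegers (𝓞 ℚ) ℚ) * (k : absIntegers (𝓞 ℚ) ℚ) := by
      have h := congrArg (fun z : ℤ => (z : absIntegers (𝓞 ℚ) ℚ)) hk
      push_cast at h
      exact h
    rw [this]
    exact 𝔓.mul_mem_right _ hp𝔓
  have hodd : p = 2 * (p / 2) + 1 := by
    have := hp.eq_two_or_odd'.resolve_left h2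
    obtain ⟨k, hk⟩ := this
    omega
  -- `x ^ p + x ∈ 𝔓`
  have hxp : x ^ p + x ∈ 𝔓 := by
    have : x ^ p + x = x * (((d : absIntegers (𝓞 ℚ) ℚ)) ^ (p / 2) + 1) := by
      conv_lhs => rw [hodd]
      rw [pow_succ, pow_mul, hx2]
      ring
    rw [this]
    exact 𝔓.mul_mem_left _ hdk
  -- hence `σ • x + x ∈ 𝔓`
  have hσx : σ • x + x ∈ 𝔓 := by
    have h := (HeightOneSpectrum.isArithFrobAt_iff_of_mem_primesAbove h𝔓 σ).mp hσ x
    rw [hres] at h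
    have : σ • x + x = (σ • x - x ^ p) + (x ^ p + x) := by ring
    rw [this]
    exact 𝔓.add_mem h hxp
  -- `σ • x = ± x`
  have hσd : σ • (d : absIntegers (𝓞 ℚ) ℚ) = d := by
    rw [← MulSemiringAction.toRingHom_apply, map_intCast]
  have hσx2 : (σ • x) ^ 2 = (d : absIntegers (𝓞 ℚ) ℚ) := by
    rw [← smul_pow', hx2, hσd]
  have hprod : (σ • x + x) * (σ • x - x) = 0 := by
    have : (σ • x + x) * (σ • x - x) = (σ • x) ^ 2 - x ^ 2 := by ring
    rw [this, hσx2, hx2, sub_self]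
  rcases mul_eq_zero.mp hprod with h0 | h0
  · -- `σ • x = -x`
    have h1 : σ • x = -x := eq_neg_of_add_eq_zero_left h0
    have h' := congrArg (fun z : absIntegers (𝓞 ℚ) ℚ => (z : AlgebraicClosure ℚ)) h1
    simpa [hxs, integralClosure.coe_smul] using h'
  · -- `σ • x = x`: then `2x ∈ 𝔓`, `4d ∈ 𝔓 ∩ ℤ = pℤ`, impossible
    exfalso
    have heq : σ • x = x := sub_eq_zero.mp h0
    have h2x : (2 : absIntegers (𝓞 ℚ) ℚ) * x ∈ 𝔓 := by
      have : σ • x + x = (2 : absIntegers (𝓞 ℚ) ℚ) * x := by rw [heq]; ring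
      rw [this] at hσx
      exact hσx
    have h4d : ((4 * d : ℤ) : absIntegers (𝓞 ℚ) ℚ) ∈ 𝔓 := by
      have : ((4 * d : ℤ) : absIntegers (𝓞 ℚ) ℚ) = (2 * x) * (2 * x) := by
        push_cast
        rw [← hx2]
        ring
      rw [this]
      exact 𝔓.mul_mem_left _ h2x
    have h4d' : ((4 * d : ℤ) : 𝓞 ℚ) ∈ v.asIdeal := by
      rw [h𝔓.2.over, Ideal.mem_under, map_intCast]
      exact h4d
    rw [intCast_mem_asIdeal_iff, hv] at h4d'
    have hp' : Prime (p : ℤ) := Nat.prime_iff_prime_int.mp hp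
    rcases hp'.dvd_or_dvd h4d' with h4 | hd
    · have : (p : ℤ) ∣ 2 ^ 2 := by norm_num; exact h4
      have h2' := hp'.dvd_of_dvd_pow this
      have : p ∣ 2 := by exact_mod_cast h2'
      exact h2 ((Nat.prime_dvd_prime_iff_eq hp Nat.prime_two).mp this)
    · exact hpd hd


/-! ### The sign of Frobenius on `E[2]` is the Legendre symbol of the minimal discriminant -/

section SignLegendre

variable (W : WeierstrassCurve ℚ) [W.IsElliptic] [W.IsGloballyMinimal]

theorem two_ne_zero_rat : (2 : ℚ) ≠ 0 := two_ne_zero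

/-- `(64 δ)² = 256 Δ_min` in `ℚ̄` (`Δ = 16 δ²`, tree `algebraMap_Δ`; `Δ = Δ_min` for a globally minimal model). -/
theorem delta64_sq :
    (64 * delta W two_ne_zero_rat) ^ 2 = ((256 * minimalDiscriminantInt W : ℤ) : AlgebraicClosure ℚ) := by
  have hΔ := algebraMap_Δ W two_ne_zero_rat
  rw [← cast_minimalDiscriminantInt W, map_intCast] at hΔ
  push_cast
  linear_combination (-256 : AlgebraicClosure ℚ) * hΔ

omit [W.IsGloballyMinimal] in
/-- `σ (64 δ) = sign(σ|E[2]) · 64 δ` (tree `smul_delta`). -/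
theorem smul_delta64 (σ : absoluteGaloisGroup ℚ) :
    σ • (64 * delta W two_ne_zero_rat) =
      ((Equiv.Perm.sign (permGal W two_ne_zero_rat σ) : ℤ) : AlgebraicClosure ℚ) * (64 * delta W two_ne_zero_rat) := by
  have h64 : σ • (64 : AlgebraicClosure ℚ) = 64 := by
    rw [← MulSemiringAction.toRingHom_apply, map_ofNat]
  rw [smul_mul', smul_delta, h64]
  ring

omit [W.IsGloballyMinimal] in
theorem delta64_ne_zero : (64 * delta W two_ne_zero_rat) ≠ 0 :=
  mul_ne_zero (by norm_num) (delta_ne_zero W two_ne_zero_rat)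

variable {W}

theorem isSquare_256_mul_iff {ℓ : ℕ} (hℓ : ℓ.Prime) (hℓ2 : ℓ ≠ 2) (D : ℤ) :
    IsSquare (((256 * D : ℤ)) : ZMod ℓ) ↔ IsSquare ((D : ℤ) : ZMod ℓ) := by
  haveI : Fact ℓ.Prime := ⟨hℓ⟩
  have h2 : (2 : ZMod ℓ) ≠ 0 := by
    intro h
    have : ((2 : ℤ) : ZMod ℓ) = 0 := by exact_mod_cast h
    rw [ZMod.intCast_zmod_eq_zero_iff_dvd] at this
    have h' : ℓ ∣ 2 := by exact_mod_cast this
    exact hℓ2 ((Nat.prime_dvd_prime_iff_eq hℓ Nat.prime_two).mp h')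
  have h16 : (16 : ZMod ℓ) ≠ 0 := by
    rw [show (16 : ZMod ℓ) = 2 ^ 4 by norm_num]
    exact pow_ne_zero 4 h2
  push_cast
  constructor
  · rintro ⟨t, ht⟩
    refine ⟨t / 16, ?_⟩
    field_simp
    linear_combination ht
  · rintro ⟨t, ht⟩
    exact ⟨16 * t, by rw [ht]; ring⟩

theorem not_dvd_256_mul {ℓ : ℕ} (hℓ : ℓ.Prime) (hℓ2 : ℓ ≠ 2) {D : ℤ} (hD : ¬ (ℓ : ℤ) ∣ D) :
    ¬ (ℓ : ℤ) ∣ 256 * D := by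
  intro h
  have hp' : Prime (ℓ : ℤ) := Nat.prime_iff_prime_int.mp hℓ
  rcases hp'.dvd_or_dvd h with h | h
  · have : (ℓ : ℤ) ∣ 2 ^ 8 := by norm_num; exact h
    have h2' := hp'.dvd_of_dvd_pow this
    have : ℓ ∣ 2 := by exact_mod_cast h2'
    exact hℓ2 ((Nat.prime_dvd_prime_iff_eq hℓ Nat.prime_two).mp this)
  · exact hD h

/-- **Level-1 dictionary (sign = Legendre).** For `W/ℚ` elliptic and globally minimal, `ℓ` an odd prime of good
reduction (`ℓ ∤ Δ_min`), and ANY arithmetic Frobenius `σ` at a prime `𝔓 ∣ ℓ` of `\bar ℤ`: the permutation `σ|E[2]`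
of the three `2`-torsion points is EVEN iff `Δ_min` is a square mod `ℓ`, i.e. `sign(σ|E[2]) = (Δ_min / ℓ)`
(`ℚ(√Δ) ⊂ ℚ(E[2])`, `σ√Δ ≡ √Δ^ℓ`, Euler's criterion). [folklore; Silverman AEC III.§1 (`disc ψ₂ = 16 Δ`),
Dokchitser–Dokchitser 2012 proof of Thm (1)] -/
theorem sign_permGal_eq_one_iff {ℓ : ℕ} (hℓ : ℓ.Prime) (hℓ2 : ℓ ≠ 2)
    (hℓΔ : ¬ (ℓ : ℤ) ∣ minimalDiscriminantInt W) {v : HeightOneSpectrum (𝓞 ℚ)}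
    (hv : (Rat.HeightOneSpectrum.primesEquiv v : ℕ) = ℓ) {𝔓 : Ideal (absIntegers (𝓞 ℚ) ℚ)}
    (h𝔓 : 𝔓 ∈ v.primesAbove) {σ : absoluteGaloisGroup ℚ} (hσ : IsArithFrobAt (𝓞 ℚ) σ 𝔓) :
    Equiv.Perm.sign (permGal W two_ne_zero_rat σ) = 1 ↔
      IsSquare ((minimalDiscriminantInt W : ℤ) : ZMod ℓ) := by
  have h256 := not_dvd_256_mul hℓ hℓ2 hℓΔ
  have hη2 := delta64_sq W
  have hη0 := delta64_ne_zero W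
  have hση := smul_delta64 W σ
  set η := 64 * delta W two_ne_zero_rat with hη
  by_cases hsq : IsSquare ((minimalDiscriminantInt W : ℤ) : ZMod ℓ)
  · have hfix : σ • η = η :=
      smul_eq_self_of_isArithFrobAt hℓ hℓ2 h256 ((isSquare_256_mul_iff hℓ hℓ2 _).mpr hsq) hη2 hv h𝔓 hσ
    refine ⟨fun _ ↦ hsq, fun _ ↦ ?_⟩
    rcases Int.units_eq_one_or (Equiv.Perm.sign (permGal W two_ne_zero_rat σ)) with h1 | h1
    · exact h1
    · exfalso
      rw [hfix, h1] at hση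
      apply hη0
      have : (2 : AlgebraicClosure ℚ) * η = 0 := by
        push_cast at hση
        linear_combination hση
      exact (mul_eq_zero.mp this).resolve_left two_ne_zero
  · have hneg : σ • η = -η :=
      smul_eq_neg_of_isArithFrobAt hℓ hℓ2 h256 (mt (isSquare_256_mul_iff hℓ hℓ2 _).mp hsq) hη2 hv h𝔓 hσ
    refine ⟨fun h1 ↦ ?_, fun h ↦ absurd h hsq⟩
    exfalso
    rw [hneg, h1] at hση
    apply hη0
    have : (2 : AlgebraicClosure ℚ) * η = 0 := by
      push_cast at hση
      linear_combination -hση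
    exact (mul_eq_zero.mp this).resolve_left two_ne_zero

/-- `(ℓ) ∈ v` pins the place: `primesEquiv v = ℓ`. -/
theorem primesEquiv_eq_of_natCast_mem {ℓ : ℕ} (hℓ : ℓ.Prime) {v : HeightOneSpectrum (𝓞 ℚ)}
    (hv : (ℓ : 𝓞 ℚ) ∈ v.asIdeal) : (Rat.HeightOneSpectrum.primesEquiv v : ℕ) = ℓ :=
  (Nat.prime_dvd_prime_iff_eq (Rat.HeightOneSpectrum.primesEquiv v).2 hℓ).mp
    ((natCast_mem_asIdeal_iff v ℓ).mp hv)

/-- Parity facts in `S₃` (kernel `decide`). -/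
theorem perm_three_sign_eq_neg_one_of_move_of_fix :
    ∀ p : Equiv.Perm (Fin 3), (∃ i, p i ≠ i) → (∃ j, p j = j) → Equiv.Perm.sign p = -1 := by
  decide

theorem perm_three_exists_move_of_sign_ne_one :
    ∀ p : Equiv.Perm (Fin 3), Equiv.Perm.sign p ≠ 1 → ∃ i, p i ≠ i := by
  decide

/-- **FILTER ⟹ R1's hypothesis.** If `Δ_min` is a NON-square mod the odd good prime `ℓ` (the skeleton's `RegularAtTwo W ℓ`),
then EVERY arithmetic Frobenius `σ` at every `𝔓 ∣ ℓ` moves some `2`-torsion point (`σ|E[2]` is a transposition) —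
exactly the hypothesis `∃ v : E[2], h • v ≠ v` of R1 `CyclicTorsionOfRegularElement`. -/
theorem exists_smul_twoTorsion_ne_of_not_isSquare {ℓ : ℕ} (hℓ : ℓ.Prime) (hℓ2 : ℓ ≠ 2)
    (hℓΔ : ¬ (ℓ : ℤ) ∣ minimalDiscriminantInt W) (hns : ¬ IsSquare ((minimalDiscriminantInt W : ℤ) : ZMod ℓ))
    {v : HeightOneSpectrum (𝓞 ℚ)} (hv : (ℓ : 𝓞 ℚ) ∈ v.asIdeal) {𝔓 : Ideal (absIntegers (𝓞 ℚ) ℚ)}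
    (h𝔓 : 𝔓 ∈ v.primesAbove) {σ : absoluteGaloisGroup ℚ} (hσ : IsArithFrobAt (𝓞 ℚ) σ 𝔓) :
    ∃ P : W.geomTorsion 2, σ • P ≠ P := by
  have hsign : Equiv.Perm.sign (permGal W two_ne_zero_rat σ) ≠ 1 := fun h1 ↦
    hns ((sign_permGal_eq_one_iff hℓ hℓ2 hℓΔ (primesEquiv_eq_of_natCast_mem hℓ hv) h𝔓 hσ).mp h1)
  obtain ⟨i, hi⟩ := perm_three_exists_move_of_sign_ne_one _ hsign
  refine ⟨T W two_ne_zero_rat i, fun h ↦ hi ?_⟩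
  rw [← T_permGal] at h
  exact T_injective W two_ne_zero_rat h

/-- **FILTER ⟹ card #7's `FrobNontrivialModTwo W ℓ`** (its body verbatim): some Frobenius above `ℓ` moves a `2`-torsion point. -/
theorem frobNontrivialModTwo_of_not_isSquare {ℓ : ℕ} (hℓ : ℓ.Prime) (hℓ2 : ℓ ≠ 2)
    (hℓΔ : ¬ (ℓ : ℤ) ∣ minimalDiscriminantInt W) (hns : ¬ IsSquare ((minimalDiscriminantInt W : ℤ) : ZMod ℓ)) :
    ∃ (v : HeightOneSpectrum (𝓞 ℚ)) (𝔓 : Ideal (absIntegers (𝓞 ℚ) ℚ)) (h : absoluteGaloisGroup ℚ),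
      (ℓ : 𝓞 ℚ) ∈ v.asIdeal ∧ 𝔓 ∈ v.primesAbove ∧ IsArithFrobAt (𝓞 ℚ) h 𝔓 ∧
        ∃ P : W.geomTorsion 2, h • P ≠ P := by
  set v : HeightOneSpectrum (𝓞 ℚ) := (Rat.HeightOneSpectrum.primesEquiv).symm ⟨ℓ, hℓ⟩ with hvdef
  have hv : (ℓ : 𝓞 ℚ) ∈ v.asIdeal := by
    rw [natCast_mem_asIdeal_iff, hvdef, Equiv.apply_symm_apply]
  obtain ⟨𝔓, h𝔓⟩ := HeightOneSpectrum.primesAbove_nonempty v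
  obtain ⟨σ, hσ⟩ := HeightOneSpectrum.exists_isArithFrobAt_of_mem_primesAbove_holds h𝔓
  exact ⟨v, 𝔓, σ, hv, h𝔓, hσ, exists_smul_twoTorsion_ne_of_not_isSquare hℓ hℓ2 hℓΔ hns hv h𝔓 hσ⟩

/-- **ENGINE ⟹ FILTER.** If some arithmetic Frobenius `σ` at `𝔓 ∣ ℓ` acts on `E[2]` as a TRANSPOSITION — it moves a
`2`-torsion point and fixes a nonzero one (e.g. `σ ≡ h₀` on `E[2^M]` for a regular involution `h₀`) — then `Δ_min`
is a non-square mod `ℓ` (`RegularAtTwo W ℓ`). -/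
theorem not_isSquare_of_transposition {ℓ : ℕ} (hℓ : ℓ.Prime) (hℓ2 : ℓ ≠ 2)
    (hℓΔ : ¬ (ℓ : ℤ) ∣ minimalDiscriminantInt W)
    {v : HeightOneSpectrum (𝓞 ℚ)} (hv : (ℓ : 𝓞 ℚ) ∈ v.asIdeal) {𝔓 : Ideal (absIntegers (𝓞 ℚ) ℚ)}
    (h𝔓 : 𝔓 ∈ v.primesAbove) {σ : absoluteGaloisGroup ℚ} (hσ : IsArithFrobAt (𝓞 ℚ) σ 𝔓)
    (hmove : ∃ P : W.geomTorsion 2, σ • P ≠ P) (hfix : ∃ P : W.geomTorsion 2, P ≠ 0 ∧ σ • P = P) :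
    ¬ IsSquare ((minimalDiscriminantInt W : ℤ) : ZMod ℓ) := by
  intro hsq
  have h1 : Equiv.Perm.sign (permGal W two_ne_zero_rat σ) = 1 :=
    (sign_permGal_eq_one_iff hℓ hℓ2 hℓΔ (primesEquiv_eq_of_natCast_mem hℓ hv) h𝔓 hσ).mpr hsq
  obtain ⟨P, hP⟩ := hmove
  obtain ⟨Q, hQ0, hQ⟩ := hfix
  have hP0 : P ≠ 0 := by rintro rfl; exact hP (smul_zero σ)
  obtain ⟨i, rfl⟩ := (eq_zero_or_eq_T W two_ne_zero_rat P).resolve_left hP0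
  obtain ⟨j, rfl⟩ := (eq_zero_or_eq_T W two_ne_zero_rat Q).resolve_left hQ0
  have hi : permGal W two_ne_zero_rat σ i ≠ i := by
    intro h; apply hP; rw [← T_permGal, h]
  have hj : permGal W two_ne_zero_rat σ j = j := by
    apply T_injective W two_ne_zero_rat; rw [T_permGal, hQ]
  have := perm_three_sign_eq_neg_one_of_move_of_fix _ ⟨i, hi⟩ ⟨j, hj⟩
  rw [h1] at this
  exact absurd this (by decide)

/-- The skeleton's filter, VERBATIM (`Lines/refined_kolyvagin_tamagawa_shift_at_two.lean` §0″ `RegularAtTwo`). -/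
def RegularAtTwo (W : WeierstrassCurve ℚ) (ℓ : ℕ) : Prop :=
  ¬ IsSquare (((W.Δ.num * (W.Δ.den : ℤ) : ℤ) : ZMod ℓ))

omit [W.IsElliptic] in
/-- For a globally minimal model the filter reads `¬ IsSquare (Δ_min mod ℓ)`. -/
theorem regularAtTwo_iff (ℓ : ℕ) :
    RegularAtTwo W ℓ ↔ ¬ IsSquare ((minimalDiscriminantInt W : ℤ) : ZMod ℓ) := by
  unfold RegularAtTwo
  rw [← cast_minimalDiscriminantInt W, Rat.num_intCast, Rat.den_intCast]
  simp

end SignLegendre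

end DictionaryA

/-! ## §B  Parity characters of `GL₂(ℤ/2^{M+1})`: `ψ|SL₂ ∈ {1, sgn ∘ red₂}` -/

section ParityB

open Matrix
open scoped MatrixGroups Classical

section API
variable {M : ℕ}

/-- reduction mod 2 -/
def π (M : ℕ) : ZMod (2 ^ (M + 1)) →+* ZMod 2 :=
  ZMod.castHom (dvd_pow_self 2 (Nat.succ_ne_zero M)) (ZMod 2)

theorem π_eq_natCast_val (z : ZMod (2 ^ (M + 1))) : π M z = (z.val : ZMod 2) := by
  haveI : NeZero (2 ^ (M + 1)) := ⟨pow_ne_zero _ two_ne_zero⟩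
  conv_lhs => rw [← ZMod.natCast_zmod_val z]
  rw [map_natCast]

theorem isUnit_iff_π_eq_one (z : ZMod (2 ^ (M + 1))) : IsUnit z ↔ π M z = 1 := by
  haveI : NeZero (2 ^ (M + 1)) := ⟨pow_ne_zero _ two_ne_zero⟩
  rw [π_eq_natCast_val, ZMod.natCast_eq_one_iff_odd]
  conv_lhs => rw [← ZMod.natCast_zmod_val z]
  rw [ZMod.isUnit_iff_coprime, Nat.coprime_pow_right_iff (Nat.succ_pos M), Nat.coprime_two_right]

theorem zmod_two_eq_zero_or_one : ∀ t : ZMod 2, t = 0 ∨ t = 1 := by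
  decide

theorem π_eq_zero_iff_not_isUnit (z : ZMod (2 ^ (M + 1))) : π M z = 0 ↔ ¬ IsUnit z := by
  rw [isUnit_iff_π_eq_one]
  rcases zmod_two_eq_zero_or_one (π M z) with h | h <;> simp [h]

end API

section SL

variable {M : ℕ}

/-- `u = [[1,1],[0,1]]` -/
def uS (M : ℕ) : SL(2, ZMod (2 ^ (M + 1))) := ⟨!![1, 1; 0, 1], by simp [Matrix.det_fin_two_of]⟩
/-- `l = [[1,0],[1,1]]` -/
def lS (M : ℕ) : SL(2, ZMod (2 ^ (M + 1))) := ⟨!![1, 0; 1, 1], by simp [Matrix.det_fin_two_of]⟩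
/-- `D(a, b) = diag(a, b)` for `a b = 1` -/
def dS (a b : ZMod (2 ^ (M + 1))) (hab : a * b = 1) : SL(2, ZMod (2 ^ (M + 1))) :=
  ⟨!![a, 0; 0, b], by simp [Matrix.det_fin_two_of, hab]⟩

@[simp] theorem coe_uS : ((uS M : SL(2, ZMod (2 ^ (M + 1)))) : Matrix (Fin 2) (Fin 2) (ZMod (2 ^ (M + 1)))) = !![1, 1; 0, 1] := rfl
@[simp] theorem coe_lS : ((lS M : SL(2, ZMod (2 ^ (M + 1)))) : Matrix (Fin 2) (Fin 2) (ZMod (2 ^ (M + 1)))) = !![1, 0; 1, 1] := rfl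
@[simp] theorem coe_dS (a b : ZMod (2 ^ (M + 1))) (hab : a * b = 1) :
    ((dS a b hab : SL(2, ZMod (2 ^ (M + 1)))) : Matrix (Fin 2) (Fin 2) (ZMod (2 ^ (M + 1)))) = !![a, 0; 0, b] := rfl

theorem coe_uS_pow (n : ℕ) :
    ((uS M ^ n : SL(2, ZMod (2 ^ (M + 1)))) : Matrix (Fin 2) (Fin 2) (ZMod (2 ^ (M + 1)))) =
      !![1, (n : ZMod (2 ^ (M + 1))); 0, 1] := by
  induction n with
  | zero => simp [Matrix.one_fin_two]
  | succ n ih =>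
    rw [pow_succ (uS M) n, Matrix.SpecialLinearGroup.coe_mul, ih, coe_uS, Matrix.mul_fin_two]
    push_cast
    congr 1 <;> simp [add_comm]

theorem coe_lS_pow (n : ℕ) :
    ((lS M ^ n : SL(2, ZMod (2 ^ (M + 1)))) : Matrix (Fin 2) (Fin 2) (ZMod (2 ^ (M + 1)))) =
      !![1, 0; (n : ZMod (2 ^ (M + 1))), 1] := by
  induction n with
  | zero => simp [Matrix.one_fin_two]
  | succ n ih =>
    rw [pow_succ (lS M) n, Matrix.SpecialLinearGroup.coe_mul, ih, coe_lS, Matrix.mul_fin_two]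
    push_cast
    congr 1 <;> simp [add_comm]

/-- ODD reduction mod 2: `s mod 2` is a transposition of `SL₂(𝔽₂) ≅ S₃` (trace even, not the identity). -/
def OddModTwo (s : SL(2, ZMod (2 ^ (M + 1)))) : Prop :=
  π M (s 0 0 + s 1 1) = 0 ∧ (π M (s 0 1) ≠ 0 ∨ π M (s 1 0) ≠ 0)

/-- LDU: if `s₀₀ b = 1`, then `s = l^{x} · D(s₀₀, b) · u^{y}` with `x = s₁₀ b`, `y = s₀₁ b`. -/
theorem ldu (s : SL(2, ZMod (2 ^ (M + 1)))) (b : ZMod (2 ^ (M + 1))) (hab : s 0 0 * b = 1) :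
    s = lS M ^ (s 1 0 * b).val * dS (s 0 0) b hab * uS M ^ (s 0 1 * b).val := by
  haveI : NeZero (2 ^ (M + 1)) := ⟨pow_ne_zero _ two_ne_zero⟩
  have hdet : s 0 0 * s 1 1 - s 0 1 * s 1 0 = 1 := by
    have := s.2; rw [Matrix.det_fin_two] at this; exact this
  apply Matrix.SpecialLinearGroup.ext
  have hR : ((lS M ^ (s 1 0 * b).val * dS (s 0 0) b hab * uS M ^ (s 0 1 * b).val :
      SL(2, ZMod (2 ^ (M + 1)))) : Matrix (Fin 2) (Fin 2) (ZMod (2 ^ (M + 1)))) =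
      !![s 0 0, s 0 0 * (s 0 1 * b); s 1 0 * b * s 0 0, s 1 0 * b * s 0 0 * (s 0 1 * b) + b] := by
    rw [Matrix.SpecialLinearGroup.coe_mul, Matrix.SpecialLinearGroup.coe_mul, coe_lS_pow, coe_uS_pow, coe_dS,
      ZMod.natCast_zmod_val, ZMod.natCast_zmod_val, Matrix.mul_fin_two, Matrix.mul_fin_two]
    congr 1 <;> simp
  intro i j
  rw [hR]
  fin_cases i <;> fin_cases j
  · simp
  · simp; linear_combination (-(s 0 1)) * hab
  · simp; linear_combination (-(s 1 0)) * hab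
  · simp; linear_combination b * hdet - (s 1 1 + s 0 1 * s 1 0 * b) * hab


/-! ### parity bookkeeping in `ZMod 2` (finite checks) -/

theorem zmod2_key_unit : ∀ p q t00 t11 tb : ZMod 2, t00 * tb = 1 → t00 * t11 - p * q = 1 →
    ((t00 + t11 = 0 ∧ (p ≠ 0 ∨ q ≠ 0)) ↔ q * tb + p * tb ≠ 0) := by
  decide

theorem zmod2_key_nonunit : ∀ t00 t01 t10 t11 : ZMod 2, t00 = 0 → t00 * t11 - t01 * t10 = 1 →
    ((t00 + t11 = 0 ∧ (t01 ≠ 0 ∨ t10 ≠ 0)) ↔ ¬ ((t00 + t10) + t11 = 0 ∧ (t01 + t11 ≠ 0 ∨ t10 ≠ 0))) := by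
  decide

theorem zmod2_ne_zero_iff : ∀ t : ZMod 2, t ≠ 0 ↔ t = 1 := by decide

theorem pow_eq_ite_of_sq {A : Type*} [Monoid A] (x : A) (hx : x ^ 2 = 1) (n : ℕ) :
    x ^ n = if Even n then 1 else x := by
  rcases Nat.even_or_odd n with h | h
  · obtain ⟨k, rfl⟩ := h
    rw [if_pos (by exact ⟨k, rfl⟩), ← two_mul, pow_mul, hx, one_pow]
  · obtain ⟨k, rfl⟩ := h
    rw [if_neg (by exact Nat.not_even_iff_odd.mpr ⟨k, rfl⟩), pow_succ, pow_mul, hx, one_pow, one_mul]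

theorem det_entries (s : SL(2, ZMod (2 ^ (M + 1)))) : s 0 0 * s 1 1 - s 0 1 * s 1 0 = 1 := by
  have := s.2; rw [Matrix.det_fin_two] at this; exact this

section Char

variable {A : Type*} [CommGroup A]

/-- UNIT-PIVOT CASE. -/
theorem char_eq_of_pivot (χ : SL(2, ZMod (2 ^ (M + 1))) →* A)
    (hlu : χ (lS M) = χ (uS M)) (hd : ∀ a b hab, χ (dS (M := M) a b hab) = 1) (h2 : χ (uS M) ^ 2 = 1)
    (s : SL(2, ZMod (2 ^ (M + 1)))) (b : ZMod (2 ^ (M + 1))) (hab : s 0 0 * b = 1) :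
    χ s = if OddModTwo s then χ (uS M) else 1 := by
  haveI : NeZero (2 ^ (M + 1)) := ⟨pow_ne_zero _ two_ne_zero⟩
  have hdet := det_entries s
  have hχ : χ s = χ (uS M) ^ ((s 1 0 * b).val + (s 0 1 * b).val) := by
    have e := congrArg χ (ldu s b hab)
    rw [map_mul, map_mul, map_pow, map_pow, hlu, hd, mul_one, ← pow_add] at e
    exact e
  rw [hχ, pow_eq_ite_of_sq _ h2]
  -- parity bookkeeping
  have hπdet : π M (s 0 0) * π M (s 1 1) - π M (s 0 1) * π M (s 1 0) = 1 := by
    have := congrArg (π M) hdet; simpa using this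
  have hπab : π M (s 0 0) * π M b = 1 := by
    have := congrArg (π M) hab; simpa using this
  have hkey := zmod2_key_unit (π M (s 0 1)) (π M (s 1 0)) (π M (s 0 0)) (π M (s 1 1)) (π M b) hπab hπdet
  have hcast : (((s 1 0 * b).val + (s 0 1 * b).val : ℕ) : ZMod 2) = π M (s 1 0) * π M b + π M (s 0 1) * π M b := by
    push_cast
    rw [← π_eq_natCast_val, ← π_eq_natCast_val, map_mul, map_mul]
  have hodd : OddModTwo s ↔ ¬ Even ((s 1 0 * b).val + (s 0 1 * b).val) := by
    rw [← ZMod.natCast_eq_zero_iff_even, hcast]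
    unfold OddModTwo
    rw [map_add]
    exact hkey
  by_cases h : OddModTwo s
  · rw [if_pos h, if_neg (hodd.mp h)]
  · rw [if_neg h, if_pos (by simpa [hodd] using h)]

/-- GENERAL CASE on `SL₂(ℤ/2^(M+1))`. -/
theorem char_eq (χ : SL(2, ZMod (2 ^ (M + 1))) →* A)
    (hlu : χ (lS M) = χ (uS M)) (hd : ∀ a b hab, χ (dS (M := M) a b hab) = 1) (h2 : χ (uS M) ^ 2 = 1)
    (s : SL(2, ZMod (2 ^ (M + 1)))) :
    χ s = if OddModTwo s then χ (uS M) else 1 := by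
  haveI : NeZero (2 ^ (M + 1)) := ⟨pow_ne_zero _ two_ne_zero⟩
  by_cases hu : IsUnit (s 0 0)
  · obtain ⟨b, hab⟩ := hu.exists_right_inv
    exact char_eq_of_pivot χ hlu hd h2 s b hab
  · -- pivot on `u * s`, whose `(0,0)` entry `s₀₀ + s₁₀` is a unit
    have hdet := det_entries s
    have h00 : π M (s 0 0) = 0 := (π_eq_zero_iff_not_isUnit _).mpr hu
    have hπdet : π M (s 0 0) * π M (s 1 1) - π M (s 0 1) * π M (s 1 0) = 1 := by
      have := congrArg (π M) hdet; simpa using this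
    set s' : SL(2, ZMod (2 ^ (M + 1))) := uS M * s with hs'
    have e00 : s' 0 0 = s 0 0 + s 1 0 := by
      simp [hs', Matrix.SpecialLinearGroup.coe_mul, Matrix.mul_apply, Fin.sum_univ_two]
    have e01 : s' 0 1 = s 0 1 + s 1 1 := by
      simp [hs', Matrix.SpecialLinearGroup.coe_mul, Matrix.mul_apply, Fin.sum_univ_two]
    have e10 : s' 1 0 = s 1 0 := by
      simp [hs', Matrix.SpecialLinearGroup.coe_mul, Matrix.mul_apply, Fin.sum_univ_two]
    have e11 : s' 1 1 = s 1 1 := by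
      simp [hs', Matrix.SpecialLinearGroup.coe_mul, Matrix.mul_apply, Fin.sum_univ_two]
    have hu' : IsUnit (s' 0 0) := by
      rw [isUnit_iff_π_eq_one, e00, map_add, h00, zero_add]
      have h10 : π M (s 1 0) ≠ 0 := by
        intro h10
        rw [h00, h10] at hπdet
        simp at hπdet
      exact (zmod2_ne_zero_iff _).mp h10
    obtain ⟨b, hab⟩ := hu'.exists_right_inv
    have hs'χ := char_eq_of_pivot χ hlu hd h2 s' b hab
    have hss : χ s = χ (uS M)⁻¹ * χ s' := by rw [hs', ← map_mul, inv_mul_cancel_left]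
    have hodd : OddModTwo s ↔ ¬ OddModTwo s' := by
      unfold OddModTwo
      rw [e00, e01, e10, e11, map_add, map_add, map_add, map_add]
      exact zmod2_key_nonunit _ _ _ _ h00 hπdet
    have hinv : χ (uS M)⁻¹ = χ (uS M) := by
      rw [map_inv, inv_eq_iff_mul_eq_one, ← pow_two, h2]
    rw [hss, hs'χ]
    by_cases h : OddModTwo s
    · rw [if_pos h, if_neg (hodd.mp h), mul_one, hinv]
    · rw [if_neg h, if_pos (by simpa [hodd] using h), hinv, ← pow_two, h2]

/-- Corollary: a character as above with `χ(u) = 1` is trivial on `SL₂`. -/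
theorem char_eq_one (χ : SL(2, ZMod (2 ^ (M + 1))) →* A)
    (hlu : χ (lS M) = χ (uS M)) (hd : ∀ a b hab, χ (dS (M := M) a b hab) = 1) (hu : χ (uS M) = 1)
    (s : SL(2, ZMod (2 ^ (M + 1)))) : χ s = 1 := by
  rw [char_eq χ hlu hd (by rw [hu, one_pow]) s, hu, ite_self]

end Char

/-! ### From a character of `GL₂(ℤ/2^(M+1))`: the two hypotheses `hlu`, `hd` are automatic -/

section GLChar

variable {A : Type*} [CommGroup A]

/-- `J = [[0,1],[1,0]]` as a unit (`J² = 1`). -/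
def Jmat (M : ℕ) : Matrix (Fin 2) (Fin 2) (ZMod (2 ^ (M + 1))) := !![0, 1; 1, 0]

theorem Jmat_mul_Jmat : Jmat M * Jmat M = 1 := by
  rw [Jmat, Matrix.mul_fin_two, Matrix.one_fin_two]
  congr 1 <;> simp

def JGL (M : ℕ) : GL (Fin 2) (ZMod (2 ^ (M + 1))) :=
  ⟨Jmat M, Jmat M, Jmat_mul_Jmat, Jmat_mul_Jmat⟩

/-- `diag(a, 1)` as a unit, for `a b = 1`. -/
def diagGL (a b : ZMod (2 ^ (M + 1))) (hab : a * b = 1) : GL (Fin 2) (ZMod (2 ^ (M + 1))) :=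
  ⟨!![a, 0; 0, 1], !![b, 0; 0, 1],
    by rw [Matrix.mul_fin_two, Matrix.one_fin_two]; congr 1 <;> simp [hab],
    by rw [Matrix.mul_fin_two, Matrix.one_fin_two]; congr 1 <;> simp [mul_comm b a, hab]⟩

theorem toGL_lS_eq : Matrix.SpecialLinearGroup.toGL (lS M) = JGL M * Matrix.SpecialLinearGroup.toGL (uS M) * JGL M := by
  apply Units.ext
  change ((lS M : SL(2, ZMod (2 ^ (M + 1)))) : Matrix (Fin 2) (Fin 2) (ZMod (2 ^ (M + 1)))) =
    Jmat M * ((uS M : SL(2, ZMod (2 ^ (M + 1)))) : Matrix (Fin 2) (Fin 2) (ZMod (2 ^ (M + 1)))) * Jmat M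
  rw [coe_lS, coe_uS, Jmat, Matrix.mul_fin_two, Matrix.mul_fin_two]
  congr 1 <;> simp

theorem toGL_dS_eq (a b : ZMod (2 ^ (M + 1))) (hab : a * b = 1) :
    Matrix.SpecialLinearGroup.toGL (dS a b hab) = diagGL a b hab * JGL M * (diagGL a b hab)⁻¹ * JGL M := by
  apply Units.ext
  change ((dS a b hab : SL(2, ZMod (2 ^ (M + 1)))) : Matrix (Fin 2) (Fin 2) (ZMod (2 ^ (M + 1)))) =
    !![a, 0; 0, 1] * Jmat M * !![b, 0; 0, 1] * Jmat M
  rw [coe_dS, Jmat, Matrix.mul_fin_two, Matrix.mul_fin_two, Matrix.mul_fin_two]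
  congr 1 <;> simp

theorem JGL_mul_JGL : JGL M * JGL M = 1 := Units.ext (Jmat_mul_Jmat (M := M))

/-- **E1a (GL form).** For every homomorphism `ψ : GL₂(ℤ/2^(M+1)) → A` to a commutative group with `ψ(u)² = 1`,
and every `s ∈ SL₂(ℤ/2^(M+1))`: `ψ(s) = ψ(u)` if `s mod 2` is a transposition of `SL₂(𝔽₂) ≅ S₃`, and `ψ(s) = 1` otherwise.
In words: `ψ|_{SL₂} ∈ {1, sgn ∘ (mod 2)}`. -/
theorem charGL_eq (ψ : GL (Fin 2) (ZMod (2 ^ (M + 1))) →* A)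
    (h2 : ψ (Matrix.SpecialLinearGroup.toGL (uS M)) ^ 2 = 1) (s : SL(2, ZMod (2 ^ (M + 1)))) :
    ψ (Matrix.SpecialLinearGroup.toGL s) =
      if OddModTwo s then ψ (Matrix.SpecialLinearGroup.toGL (uS M)) else 1 := by
  have hlu : (ψ.comp Matrix.SpecialLinearGroup.toGL) (lS M) = (ψ.comp Matrix.SpecialLinearGroup.toGL) (uS M) := by
    rw [MonoidHom.comp_apply, MonoidHom.comp_apply, toGL_lS_eq, map_mul, map_mul, mul_right_comm, ← map_mul,
      JGL_mul_JGL, map_one, one_mul]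
  have hd : ∀ a b hab, (ψ.comp Matrix.SpecialLinearGroup.toGL) (dS (M := M) a b hab) = 1 := by
    intro a b hab
    rw [MonoidHom.comp_apply, toGL_dS_eq, map_mul, map_mul, map_mul, map_inv, mul_right_comm (ψ (diagGL a b hab)),
      mul_inv_cancel, one_mul, ← map_mul, JGL_mul_JGL, map_one]
  exact char_eq (ψ.comp Matrix.SpecialLinearGroup.toGL) hlu hd h2 s

/-- Corollary: `ψ(u) = 1` forces `ψ` to be trivial on `SL₂(ℤ/2^(M+1))`, i.e. `ψ` factors through `det`. -/
theorem charGL_eq_one (ψ : GL (Fin 2) (ZMod (2 ^ (M + 1))) →* A)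
    (hu : ψ (Matrix.SpecialLinearGroup.toGL (uS M)) = 1) (s : SL(2, ZMod (2 ^ (M + 1)))) :
    ψ (Matrix.SpecialLinearGroup.toGL s) = 1 := by
  rw [charGL_eq ψ (by rw [hu, one_pow]) s, hu, ite_self]

/-- Corollary: on the kernel of reduction mod `2` (inside `SL₂`), every such `ψ` is trivial. -/
theorem charGL_eq_one_of_reduction_eq_one (ψ : GL (Fin 2) (ZMod (2 ^ (M + 1))) →* A)
    (h2 : ψ (Matrix.SpecialLinearGroup.toGL (uS M)) ^ 2 = 1) (s : SL(2, ZMod (2 ^ (M + 1))))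
    (h01 : π M (s 0 1) = 0) (h10 : π M (s 1 0) = 0) :
    ψ (Matrix.SpecialLinearGroup.toGL s) = 1 := by
  rw [charGL_eq ψ h2 s, if_neg]
  unfold OddModTwo
  rw [h01, h10]
  simp


/-- Corollary: if `ψ(u) = 1` then `ψ` factors through `det`: `det g = det h ⟹ ψ g = ψ h`. -/
theorem charGL_eq_of_det_eq (ψ : GL (Fin 2) (ZMod (2 ^ (M + 1))) →* A)
    (hu : ψ (Matrix.SpecialLinearGroup.toGL (uS M)) = 1) (g h : GL (Fin 2) (ZMod (2 ^ (M + 1))))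
    (hdet : Matrix.GeneralLinearGroup.det g = Matrix.GeneralLinearGroup.det h) : ψ g = ψ h := by
  have hd1 : ((g * h⁻¹ : GL (Fin 2) (ZMod (2 ^ (M + 1)))) : Matrix (Fin 2) (Fin 2) (ZMod (2 ^ (M + 1)))).det = 1 := by
    have h1 : Matrix.GeneralLinearGroup.det (g * h⁻¹) = 1 := by rw [map_mul, map_inv, hdet, mul_inv_cancel]
    have h2 := congrArg (fun u : (ZMod (2 ^ (M + 1)))ˣ ↦ (u : ZMod (2 ^ (M + 1)))) h1
    simpa [Matrix.GeneralLinearGroup.val_det_apply] using h2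
  set s : SL(2, ZMod (2 ^ (M + 1))) := ⟨((g * h⁻¹ : GL (Fin 2) (ZMod (2 ^ (M + 1)))) : Matrix (Fin 2) (Fin 2) (ZMod (2 ^ (M + 1)))), hd1⟩ with hs
  have hsg : Matrix.SpecialLinearGroup.toGL s = g * h⁻¹ := Units.ext rfl
  calc ψ g = ψ (g * h⁻¹) * ψ h := by rw [map_mul, map_inv, inv_mul_cancel_right]
    _ = ψ (Matrix.SpecialLinearGroup.toGL s) * ψ h := by rw [hsg]
    _ = ψ h := by rw [charGL_eq_one ψ hu s, one_mul]

/-- Corollary: in general (`ψ(u)² = 1`), for `det g = det h`: `ψ g = ψ h` unless `g h⁻¹` is ODD mod `2`, in which case they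
differ by `ψ(u)`. -/
theorem charGL_mul_inv_eq (ψ : GL (Fin 2) (ZMod (2 ^ (M + 1))) →* A)
    (h2 : ψ (Matrix.SpecialLinearGroup.toGL (uS M)) ^ 2 = 1) (g h : GL (Fin 2) (ZMod (2 ^ (M + 1))))
    (hdet : Matrix.GeneralLinearGroup.det g = Matrix.GeneralLinearGroup.det h)
    (hd1 : ((g * h⁻¹ : GL (Fin 2) (ZMod (2 ^ (M + 1)))) : Matrix (Fin 2) (Fin 2) (ZMod (2 ^ (M + 1)))).det = 1) :
    ψ g = (if OddModTwo (⟨((g * h⁻¹ : GL (Fin 2) (ZMod (2 ^ (M + 1)))) : Matrix (Fin 2) (Fin 2) (ZMod (2 ^ (M + 1)))), hd1⟩ :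
              SL(2, ZMod (2 ^ (M + 1)))) then ψ (Matrix.SpecialLinearGroup.toGL (uS M)) else 1) * ψ h := by
  set s : SL(2, ZMod (2 ^ (M + 1))) := ⟨((g * h⁻¹ : GL (Fin 2) (ZMod (2 ^ (M + 1)))) : Matrix (Fin 2) (Fin 2) (ZMod (2 ^ (M + 1)))), hd1⟩ with hs
  have hsg : Matrix.SpecialLinearGroup.toGL s = g * h⁻¹ := Units.ext rfl
  have _hdet := hdet
  calc ψ g = ψ (g * h⁻¹) * ψ h := by rw [map_mul, map_inv, inv_mul_cancel_right]
    _ = ψ (Matrix.SpecialLinearGroup.toGL s) * ψ h := by rw [hsg]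
    _ = _ := by rw [charGL_eq ψ h2 s]

end GLChar

end SL

end ParityB

/-! ## §C  Goursat dichotomy for a subgroup of `G × C` surjecting onto `G` -/

section GoursatC

/-- **E1b (Goursat, index-`2` shape).** A subgroup `H ≤ G × C` projecting ONTO `G` and meeting `1 × C` trivially
is the graph of a homomorphism `ψ : G → C`. -/
theorem exists_hom_graph_of_fst_surjective {G C : Type*} [Group G] [Group C] (H : Subgroup (G × C))
    (hfst : ∀ g : G, ∃ c : C, (g, c) ∈ H) (hker : ∀ c : C, ((1 : G), c) ∈ H → c = 1) :
    ∃ ψ : G →* C, ∀ g : G, ∀ c : C, (g, c) ∈ H ↔ c = ψ g := by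
  classical
  have huniq : ∀ g : G, ∀ c c' : C, (g, c) ∈ H → (g, c') ∈ H → c = c' := by
    intro g c c' hc hc'
    have hmem : ((1 : G), c⁻¹ * c') ∈ H := by
      have := H.mul_mem (H.inv_mem hc) hc'
      simpa using this
    have := hker _ hmem
    rw [inv_mul_eq_one] at this
    exact this
  let f : G → C := fun g ↦ Classical.choose (hfst g)
  have hf : ∀ g, (g, f g) ∈ H := fun g ↦ Classical.choose_spec (hfst g)
  refine ⟨{ toFun := f, map_one' := ?_, map_mul' := ?_ }, ?_⟩
  · exact (hker _ (hf 1))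
  · intro g g'
    have hmem : (g * g', f g * f g') ∈ H := by
      have := H.mul_mem (hf g) (hf g')
      simpa using this
    exact huniq _ _ _ (hf (g * g')) hmem
  · intro g c
    constructor
    · intro hc; exact huniq _ _ _ hc (hf g)
    · rintro rfl; exact hf g

/-- **E1b′ (the dichotomy used by the regular supply).** If `H ≤ G × C` projects onto `G`, then EITHER some
`(1, c)` with `c ≠ 1` lies in `H` (and then `(g, c·x) ∈ H` whenever `(g, x) ∈ H`: every `G`-component meets every
`C`-coset it can), OR `H` is the graph of a homomorphism `ψ : G → C`. -/
theorem graph_dichotomy_of_fst_surjective {G C : Type*} [Group G] [Group C] (H : Subgroup (G × C))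
    (hfst : ∀ g : G, ∃ c : C, (g, c) ∈ H) :
    (∃ c : C, c ≠ 1 ∧ ((1 : G), c) ∈ H) ∨ (∃ ψ : G →* C, ∀ g : G, ∀ c : C, (g, c) ∈ H ↔ c = ψ g) := by
  by_cases h : ∃ c : C, c ≠ 1 ∧ ((1 : G), c) ∈ H
  · exact Or.inl h
  · push_neg at h
    exact Or.inr (exists_hom_graph_of_fst_surjective H hfst fun c hc ↦ by
      by_contra hne; exact h c hne hc)

/-- In the first branch: `(1, c) ∈ H` and `(g, x) ∈ H` give `(g, c * x) ∈ H`. -/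
theorem mem_of_one_mem {G C : Type*} [Group G] [Group C] (H : Subgroup (G × C)) {g : G} {c x : C}
    (h1 : ((1 : G), c) ∈ H) (hg : (g, x) ∈ H) : (g, c * x) ∈ H := by
  have := H.mul_mem h1 hg
  simpa using this

end GoursatC

/-! ## §D  Coset absorption (card E2: Step B with a non-involution `h₀` — the constant `c(h₀²)` cannot destroy exact order) -/

section CosetD

/-- If a subgroup `H` contains an element `h` with `k • h ≠ 0`, then EVERY coset `v + H` contains an element `v + w` with
`k • (v + w) ≠ 0` (take `w = h` if `k • v = 0`, else `w = 0`).  Used with `V = E[2^M]`, `k = 2^{M-1}`: the evaluation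
`c(σ²) = (const) + (element ranging over a subgroup containing a point of exact order 2^M)` still hits exact order `2^M`. -/
theorem exists_add_mem_smul_ne_zero {V : Type*} [AddCommGroup V] {k : ℕ} (H : AddSubgroup V)
    {h : V} (hh : h ∈ H) (hord : k • h ≠ 0) (v : V) : ∃ w ∈ H, k • (v + w) ≠ 0 := by
  by_cases hv : k • v = 0
  · exact ⟨h, hh, by rwa [smul_add, hv, zero_add]⟩
  · exact ⟨0, H.zero_mem, by rwa [add_zero]⟩

/-- The same for the image of an additive map `f : U →+ V` in place of a subgroup (the shape in which Step B produces it: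
`m' ↦ c(m')`-type terms range over an additive image). -/
theorem exists_smul_add_map_ne_zero {U V : Type*} [AddCommGroup U] [AddCommGroup V] {k : ℕ} (f : U →+ V)
    {u : U} (hord : k • f u ≠ 0) (v : V) : ∃ u' : U, k • (v + f u') ≠ 0 := by
  by_cases hv : k • v = 0
  · exact ⟨u, by rwa [smul_add, hv, zero_add]⟩
  · exact ⟨0, by rwa [map_zero, add_zero]⟩

end CosetD


/-! ## §E  The (3.3) port: complex conjugation ↦ any element inverting `μ` (PROVED; card ENGINE-PORT MAP step E0)

The tree's `FrobEqFrobInfty`-consumers use `IsComplexConjugation c₀` only through (i) `c₀` inverts roots of unity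
(`RatClosure.smul_eq_inv_of_pow_eq_one`), (ii) `c₀² = 1`, (iii) `c₀|_K = τ`.  For the line's regular element `h₀`
(`det ρ(h₀) = -1`, `ρ_{2^{M+1}}(h₀)² = 1`, `h₀|_K = τ`, but `h₀² ≠ 1` in `Γ_ℚ`) this section re-proves the (3.3)
consequences from exactly those properties:
`smul_eq_inv_of_smul_torsion_eq_of_inverts` (tree `smul_eq_inv_of_smul_torsion_pow_eq` with (i) as hypothesis),
`pow_dvd_add_one_of_frob_smul_eq_of_inverts` (`p^M ∣ ℓ + 1`), `pow_dvd_frobeniusTraceAt_of_frob_smul_eq_of_inverts`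
(`p^M ∣ a_ℓ`, with (ii) as the hypothesis `∀ P, c₀ • c₀ • P = P` on `E[p^M]` only), and the CONVERSE Weil-pairing algebra
supplying (i) from a matrix: `pairing_lin_comb` (`e(aS+cT, bS+dT)·e(S,T)^{bc} = e(S,T)^{ad}`), `pairing_eq_inv_of_det_eq_neg_one`,
`pairing_isPrimitiveRoot_of_span`, basis glue (`eq_nsmul_add_nsmul_of_basis`, `natCast_val_det_eq_of_det_eq_neg_one`,
`pow_nsmul_basis_ne_zero`, `smul_smul_eq_self_of_basis`) and the capstone `smul_eq_inv_of_det_repr_eq_neg_one`: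
**`det (b.repr (σ • b j) i) = -1` for a `ZMod p^{n+1}`-basis `b` of `E[p^{n+1}]` ⟹ `σ • ζ = ζ⁻¹` for every `ζ ∈ μ_{p^{n+1}}`.**
-/

section CyclotomicE

open scoped Classical
open WeierstrassCurve NumberField IsDedekindDomain Field
open Literature.NumberTheory.GaloisRepresentations Literature.NumberTheory.EllipticCurves

section CyclotomicE0sub

variable (W : WeierstrassCurve ℚ)

/-- **E0 (port of the tree's `smul_eq_inv_of_smul_torsion_pow_eq`, complex conjugation ↦ ANY element inverting `μ_q`).**
An automorphism `h` acting on `E(ℚ̄)[q]`, `q = p^M`, as some `c₀ ∈ Γ_ℚ` that inverts the `q`-th roots of unity, inverts them too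
(Weil pairing; the tree proof verbatim with `IsComplexConjugation c₀` replaced by the one property it was used for). -/
theorem smul_eq_inv_of_smul_torsion_eq_of_inverts [W.IsElliptic] {p : ℕ} (hp : p.Prime) {M : ℕ}
    (hM : 1 ≤ M) {q : ℕ} (hq : q = p ^ M) {h c₀ : absoluteGaloisGroup ℚ}
    (hc₀ : ∀ ζ : AlgebraicClosure ℚ, ζ ^ q = 1 → c₀ • ζ = ζ⁻¹)
    (hhP : ∀ P : geomTorsion W (q : ℤ), h • P = c₀ • P) {ζ : AlgebraicClosure ℚ}
    (hζ : ζ ^ q = 1) : h • ζ = ζ⁻¹ := by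
  haveI : Fact p.Prime := ⟨hp⟩
  subst hq
  obtain ⟨n, rfl⟩ : ∃ n, M = n + 1 := ⟨M - 1, by omega⟩
  have hq0 : p ^ (n + 1) ≠ 0 := pow_ne_zero _ hp.ne_zero
  have hq2 : 2 ≤ p ^ (n + 1) :=
    le_trans hp.two_le (by
      calc p = p ^ 1 := (pow_one p).symm
        _ ≤ p ^ (n + 1) := Nat.pow_le_pow_right hp.pos (by omega))
  obtain ⟨e, hpow, hadd₁, hadd₂, -, hnd, hgal⟩ :=
    W.exists_weilPairing_holds (p ^ (n + 1)) hq2 (by exact_mod_cast hq0)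
  -- `h` inverts every value of `e`
  have hval : ∀ S T, h • e S T = (e S T)⁻¹ := fun S T ↦ by
    rw [hgal, hhP, hhP, ← hgal, hc₀ _ (hpow S T)]
  -- `e S (m • T) = (e S T)^m`
  have hne : ∀ S T, e S T ≠ 0 := fun S T h0 ↦ by
    have := hpow S T
    rw [h0, zero_pow hq0] at this
    exact zero_ne_one this
  have hzero_right : ∀ S, e S 0 = 1 := fun S ↦ by
    have h1 := hadd₂ S 0 0
    rw [add_zero] at h1
    exact (mul_eq_left₀ (hne S 0)).mp h1.symm
  have hnsmul_right : ∀ (m : ℕ) S T, e S (m • T) = e S T ^ m := fun m S T ↦ by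
    induction m with
    | zero => rw [zero_nsmul, pow_zero, hzero_right]
    | succ m ih => rw [succ_nsmul, hadd₂, ih, pow_succ]
  -- some `S₀` with `p^n S₀ ≠ 0`
  have hqn0 : p ^ n ≠ 0 := pow_ne_zero n hp.ne_zero
  haveI : Finite (geomTorsion W ((p ^ (n + 1) : ℕ) : ℤ)) :=
    finite_torsionPoints_holds W (AlgebraicClosure ℚ) (by exact_mod_cast hq0)
  haveI : Finite (geomTorsion W ((p ^ n : ℕ) : ℤ)) :=
    finite_torsionPoints_holds W (AlgebraicClosure ℚ) (by exact_mod_cast hqn0)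
  have hc1 : Nat.card (geomTorsion W ((p ^ (n + 1) : ℕ) : ℤ)) = (p ^ (n + 1)) ^ 2 :=
    card_torsionPoints_eq_sq_holds W (AlgebraicClosure ℚ) (by exact_mod_cast hq0)
  have hc2 : Nat.card (geomTorsion W ((p ^ n : ℕ) : ℤ)) = (p ^ n) ^ 2 :=
    card_torsionPoints_eq_sq_holds W (AlgebraicClosure ℚ) (by exact_mod_cast hqn0)
  obtain ⟨S₀, hS₀⟩ : ∃ S₀ : geomTorsion W ((p ^ (n + 1) : ℕ) : ℤ), p ^ n • S₀ ≠ 0 := by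
    by_contra hall
    push Not at hall
    have hle : Nat.card (geomTorsion W ((p ^ (n + 1) : ℕ) : ℤ)) ≤
        Nat.card (geomTorsion W ((p ^ n : ℕ) : ℤ)) :=
      Nat.card_le_card_of_injective
        (fun S ↦ (⟨S.1, (mem_geomTorsion_iff W _ _).mpr (by
          have h1 := congrArg Subtype.val (hall S)
          rw [AddSubgroupClass.coe_nsmul, ZeroMemClass.coe_zero, ← natCast_zsmul,
            Nat.cast_pow] at h1
          rw [Nat.cast_pow]
          exact h1)⟩ : geomTorsion W ((p ^ n : ℕ) : ℤ)))
        (fun S S' hS ↦ Subtype.ext (by simpa using congrArg Subtype.val hS))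
    rw [hc1, hc2] at hle
    have hlt : p ^ n < p ^ (n + 1) := Nat.pow_lt_pow_right hp.one_lt (by omega)
    have := Nat.pow_lt_pow_left hlt two_ne_zero
    omega
  -- some `T₀` with `e T₀ S₀` a primitive `p^{n+1}`-th root of unity
  obtain ⟨T₀, hT₀⟩ : ∃ T₀, e T₀ S₀ ^ p ^ n ≠ 1 := by
    by_contra hall
    push Not at hall
    exact hS₀ (hnd _ fun S ↦ by rw [hnsmul_right, hall])
  have hord : orderOf (e T₀ S₀) = p ^ (n + 1) := orderOf_eq_prime_pow hT₀ (hpow T₀ S₀)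
  have hprim : IsPrimitiveRoot (e T₀ S₀) (p ^ (n + 1)) := hord ▸ IsPrimitiveRoot.orderOf _
  obtain ⟨k, -, hk⟩ := hprim.eq_pow_of_pow_eq_one hζ
  rw [← hk, smul_pow', hval, inv_pow]



/-- **E0 ⇒ (3.3): `p^M ∣ ℓ + 1`** when an arithmetic Frobenius `h` at `𝔓 ∣ ℓ` acts on `E[p^M]` as an element `c₀` inverting `μ_{p^M}`
(the tree's `pow_dvd_add_one_of_frobEqFrobInfty` with `FrobEqFrobInfty` opened up and complex conjugation replaced by that property —
the regular `h₀` of the line has `det ρ(h₀) = -1`, hence inverts `μ` by `det ρ = χ_cyc`). [cite: GrossLMS1991, §3 (3.3)] [cite: McCallumLMS1991, §4] -/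
theorem pow_dvd_add_one_of_frob_smul_eq_of_inverts [W.IsElliptic] {p : ℕ} (hp : p.Prime) {M : ℕ}
    (hM : 1 ≤ M) {ℓ : ℕ} (hℓ : ℓ.Prime) (hℓp : ℓ ≠ p) {v : HeightOneSpectrum (𝓞 ℚ)}
    {𝔓₀ : Ideal (absIntegers (𝓞 ℚ) ℚ)} {h c₀ : absoluteGaloisGroup ℚ} (hℓv : (ℓ : 𝓞 ℚ) ∈ v.asIdeal)
    (h𝔓₀ : 𝔓₀ ∈ v.primesAbove) (hh : IsArithFrobAt (𝓞 ℚ) h 𝔓₀)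
    (hc₀ : ∀ ζ : AlgebraicClosure ℚ, ζ ^ (p ^ M) = 1 → c₀ • ζ = ζ⁻¹)
    (hE : ∀ P : geomTorsion W ((p ^ M : ℕ) : ℤ), h • P = c₀ • P) :
    p ^ M ∣ ℓ + 1 := by
  haveI : Fact p.Prime := ⟨hp⟩
  -- a primitive `p^M`-th root of unity in `ℚ̄`
  have hq0 : ((p ^ M : ℕ) : AlgebraicClosure ℚ) ≠ 0 := by exact_mod_cast pow_ne_zero M hp.ne_zero
  haveI : NeZero ((p ^ M : ℕ) : AlgebraicClosure ℚ) := ⟨hq0⟩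
  obtain ⟨ζ, hζ⟩ := IsAlgClosed.exists_root (Polynomial.cyclotomic (p ^ M) (AlgebraicClosure ℚ))
    (Polynomial.degree_cyclotomic_pos (p ^ M) _ (pos_of_ne_zero (pow_ne_zero M hp.ne_zero))).ne'
  have hprim : IsPrimitiveRoot ζ (p ^ M) := Polynomial.isRoot_cyclotomic_iff.mp hζ
  -- `h ζ = ζ⁻¹` and `h ζ = ζ ^ N(ℓ) = ζ ^ ℓ`
  have h1 : h • ζ = ζ⁻¹ :=
    smul_eq_inv_of_smul_torsion_eq_of_inverts W hp hM rfl hc₀ hE hprim.pow_eq_one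
  have hpv : (p : 𝓞 ℚ) ∉ v.asIdeal := not_natCast_mem_of_prime_ne hℓ hp hℓp v hℓv
  have h2 : h • ζ = ζ ^ v.residueCard :=
    smul_eq_pow_residueCard_of_isArithFrobAt (ℓ := p) hpv h𝔓₀ hh (n := M) hprim.pow_eq_one
  rw [residueCard_eq_of_natCast_mem_rat hℓ hℓv, h1] at h2
  -- `ζ ^ (ℓ + 1) = 1`
  have hζ0 : ζ ≠ 0 := hprim.ne_zero (pow_ne_zero M hp.ne_zero)
  have hζ1 : ζ ^ (ℓ + 1) = 1 := by
    rw [pow_succ, ← h2, inv_mul_cancel₀ hζ0]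
  exact (hprim.pow_eq_one_iff_dvd (ℓ + 1)).mp hζ1

/-- **E0 ⇒ (3.3), trace half: `p^M ∣ a_ℓ`** when an arithmetic Frobenius `h` at a good place `v ∋ ℓ` acts on `E[p^M]` as an element `c₀`
that inverts `μ_{p^M}` and whose SQUARE acts trivially on `E[p^M]` (the tree's `pow_dvd_frobeniusTraceAt_of_frobEqFrobInfty` with complex
conjugation replaced by these two properties — both held by the line's regular `h₀`: `det ρ(h₀) = -1`, `ρ(h₀)² = 1` although `h₀² ≠ 1` in `Γ_ℚ`).
[cite: GrossLMS1991, §3 (3.3)] [cite: McCallumLMS1991, §4] -/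
theorem pow_dvd_frobeniusTraceAt_of_frob_smul_eq_of_inverts [W.IsElliptic] {p : ℕ} (hp : p.Prime)
    {M : ℕ} (hM : 1 ≤ M) {ℓ : ℕ} (hℓ : ℓ.Prime) (hℓp : ℓ ≠ p)
    {v : HeightOneSpectrum (𝓞 ℚ)} (hℓv : (ℓ : 𝓞 ℚ) ∈ v.asIdeal) (hgood : W.HasGoodReductionAt v)
    {𝔓₀ : Ideal (absIntegers (𝓞 ℚ) ℚ)} {h c₀ : absoluteGaloisGroup ℚ}
    (h𝔓₀ : 𝔓₀ ∈ v.primesAbove) (hh : IsArithFrobAt (𝓞 ℚ) h 𝔓₀)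
    (hc₀ : ∀ ζ : AlgebraicClosure ℚ, ζ ^ (p ^ M) = 1 → c₀ • ζ = ζ⁻¹)
    (hc₀sq : ∀ P : geomTorsion W ((p ^ M : ℕ) : ℤ), c₀ • c₀ • P = P)
    (hE : ∀ P : geomTorsion W ((p ^ M : ℕ) : ℤ), h • P = c₀ • P) :
    ((p : ℤ) ^ M) ∣ W.frobeniusTraceAt v := by
  haveI : Fact p.Prime := ⟨hp⟩
  obtain ⟨n, rfl⟩ : ∃ n, M = n + 1 := ⟨M - 1, by omega⟩
  have hpv : (p : 𝓞 ℚ) ∉ v.asIdeal := not_natCast_mem_of_prime_ne hℓ hp hℓp v hℓv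
  have hpQ : (p : ℚ) ≠ 0 := by exact_mod_cast hp.ne_zero
  -- `tr(h | T_p E) = a_ℓ`
  have htr := W.trace_galoisRepTate_frobenius_of_hasGoodReductionAt_holds p v hpv hgood h𝔓₀ hh
  -- `det(h | T_p E) ≡ -1`: `h` inverts `μ_{p^{n+1}}`
  have hinv : ∀ t : AlgebraicClosure ℚ, t ^ p ^ (n + 1) = 1 → h • t = t ^ (p ^ (n + 1) - 1) := by
    intro t ht
    rw [smul_eq_inv_of_smul_torsion_eq_of_inverts W hp hM rfl hc₀ hE ht]
    have ht0 : t ≠ 0 := fun h0 ↦ by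
      rw [h0, zero_pow (pow_ne_zero _ hp.ne_zero)] at ht; exact zero_ne_one ht
    rw [eq_comm, ← mul_left_inj' ht0, inv_mul_cancel₀ ht0, ← pow_succ,
      Nat.sub_add_cancel (Nat.one_le_pow _ _ hp.pos), ht]
  have hdet := toZModPow_det_galoisRepTate_eq W p hpQ n (W.exists_weilPairing_holds _) h
    (p ^ (n + 1) - 1) hinv
  have hcast : ((p ^ (n + 1) - 1 : ℕ) : ZMod (p ^ (n + 1))) = -1 := by
    rw [Nat.cast_sub (Nat.one_le_pow _ _ hp.pos), ZMod.natCast_self, Nat.cast_one, zero_sub]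
  rw [hcast] at hdet
  -- `h² = 1` on `E[p^{n+1}]`
  have hsq : ∀ P : W.geomPoints, P ∈ geomTorsion W ((p ^ (n + 1) : ℕ) : ℤ) → h • h • P = P := by
    intro P hP
    have h1 := congrArg Subtype.val (hE ⟨P, hP⟩)
    have h2 := congrArg Subtype.val (hE (h • ⟨P, hP⟩))
    simp only [AddSubgroup.torsionBy.coe_smul] at h1 h2
    rw [h1] at h2
    rw [h1, h2]
    have h3 := congrArg Subtype.val (hc₀sq ⟨P, hP⟩)
    simpa only [AddSubgroup.torsionBy.coe_smul] using h3
  have h0 := toZModPow_trace_galoisRepTate_eq_zero W p hpQ n h hsq hdet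
  rw [htr, map_intCast, ZMod.intCast_zmod_eq_zero_iff_dvd] at h0
  exact_mod_cast h0

end CyclotomicE0sub

/-! ### E0 (converse direction): a matrix of determinant `-1` in a basis of `E[q]` inverts `μ_q` (Weil pairing algebra) -/

section WeilDet

variable {Tq : Type*} [AddCommGroup Tq] {L : Type*} [Field L] (e : Tq → Tq → L)

omit [AddCommGroup Tq] in
/-- Values of a pairing with `e S T ^ q = 1`, `q ≠ 0`, are nonzero. -/
theorem pairing_ne_zero {q : ℕ} (hq : q ≠ 0) (hpow : ∀ S T, e S T ^ q = 1) (S T : Tq) : e S T ≠ 0 := by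
  intro h0
  have := hpow S T
  rw [h0, zero_pow hq] at this
  exact zero_ne_one this

theorem pairing_zero_left {q : ℕ} (hq : q ≠ 0) (hpow : ∀ S T, e S T ^ q = 1)
    (hadd₁ : ∀ S₁ S₂ T, e (S₁ + S₂) T = e S₁ T * e S₂ T) (T : Tq) : e 0 T = 1 := by
  have h1 := hadd₁ 0 0 T
  rw [add_zero] at h1
  exact (mul_eq_left₀ (pairing_ne_zero e hq hpow 0 T)).mp h1.symm

theorem pairing_zero_right {q : ℕ} (hq : q ≠ 0) (hpow : ∀ S T, e S T ^ q = 1)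
    (hadd₂ : ∀ S T₁ T₂, e S (T₁ + T₂) = e S T₁ * e S T₂) (S : Tq) : e S 0 = 1 := by
  have h1 := hadd₂ S 0 0
  rw [add_zero] at h1
  exact (mul_eq_left₀ (pairing_ne_zero e hq hpow S 0)).mp h1.symm

theorem pairing_nsmul_left {q : ℕ} (hq : q ≠ 0) (hpow : ∀ S T, e S T ^ q = 1)
    (hadd₁ : ∀ S₁ S₂ T, e (S₁ + S₂) T = e S₁ T * e S₂ T) (m : ℕ) (S T : Tq) :
    e (m • S) T = e S T ^ m := by
  induction m with
  | zero => rw [zero_nsmul, pow_zero, pairing_zero_left e hq hpow hadd₁]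
  | succ m ih => rw [succ_nsmul, hadd₁, ih, pow_succ]

theorem pairing_nsmul_right {q : ℕ} (hq : q ≠ 0) (hpow : ∀ S T, e S T ^ q = 1)
    (hadd₂ : ∀ S T₁ T₂, e S (T₁ + T₂) = e S T₁ * e S T₂) (m : ℕ) (S T : Tq) :
    e S (m • T) = e S T ^ m := by
  induction m with
  | zero => rw [zero_nsmul, pow_zero, pairing_zero_right e hq hpow hadd₂]
  | succ m ih => rw [succ_nsmul, hadd₂, ih, pow_succ]

/-- Skew-symmetry from alternation: `e T S * e S T = 1`. -/
theorem pairing_swap_mul (hadd₁ : ∀ S₁ S₂ T, e (S₁ + S₂) T = e S₁ T * e S₂ T)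
    (hadd₂ : ∀ S T₁ T₂, e S (T₁ + T₂) = e S T₁ * e S T₂) (halt : ∀ T, e T T = 1) (S T : Tq) :
    e T S * e S T = 1 := by
  have h := halt (S + T)
  rw [hadd₁, hadd₂, hadd₂, halt, halt, one_mul, mul_one, mul_comm] at h
  exact h

/-- **Determinant formula**: `e (aS + cT) (bS + dT) · e(S,T)^{bc} = e(S,T)^{ad}` (i.e. `e(σS, σT) = e(S,T)^{ad-bc}` for the matrix
`[[a,b],[c,d]]` of `σ` in the pair `(S, T)`). -/
theorem pairing_lin_comb {q : ℕ} (hq : q ≠ 0) (hpow : ∀ S T, e S T ^ q = 1)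
    (hadd₁ : ∀ S₁ S₂ T, e (S₁ + S₂) T = e S₁ T * e S₂ T)
    (hadd₂ : ∀ S T₁ T₂, e S (T₁ + T₂) = e S T₁ * e S T₂) (halt : ∀ T, e T T = 1)
    (S T : Tq) (a b c d : ℕ) :
    e (a • S + c • T) (b • S + d • T) * e S T ^ (b * c) = e S T ^ (a * d) := by
  have hsw := pairing_swap_mul e hadd₁ hadd₂ halt S T
  have h1 : e (a • S) (b • S) = 1 := by
    rw [pairing_nsmul_left e hq hpow hadd₁, pairing_nsmul_right e hq hpow hadd₂, halt, one_pow, one_pow]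
  have h2 : e (a • S) (d • T) = e S T ^ (a * d) := by
    rw [pairing_nsmul_left e hq hpow hadd₁, pairing_nsmul_right e hq hpow hadd₂, ← pow_mul, Nat.mul_comm d a]
  have h3 : e (c • T) (b • S) = e T S ^ (b * c) := by
    rw [pairing_nsmul_left e hq hpow hadd₁, pairing_nsmul_right e hq hpow hadd₂, ← pow_mul]
  have h4 : e (c • T) (d • T) = 1 := by
    rw [pairing_nsmul_left e hq hpow hadd₁, pairing_nsmul_right e hq hpow hadd₂, halt, one_pow, one_pow]
  rw [hadd₁, hadd₂, hadd₂, h1, h2, h3, h4, one_mul, mul_one, mul_assoc, ← mul_pow, hsw, one_pow, mul_one]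

/-- **`det ≡ -1 (mod q)` ⟹ the pairing value is inverted**: if `S' = aS + cT`, `T' = bS + dT` with `ad + 1 ≡ bc (mod q)`, then
`e S' T' = (e S T)⁻¹`.  With `S' = σ • S`, `T' = σ • T` and Galois-equivariance `σ • e S T = e (σ • S) (σ • T)` this is
«`det ρ_q(σ) = -1` in the basis `(S,T)` ⟹ `σ` inverts `e(S,T)`». -/
theorem pairing_eq_inv_of_det_eq_neg_one {q : ℕ} (hq : q ≠ 0) (hpow : ∀ S T, e S T ^ q = 1)
    (hadd₁ : ∀ S₁ S₂ T, e (S₁ + S₂) T = e S₁ T * e S₂ T)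
    (hadd₂ : ∀ S T₁ T₂, e S (T₁ + T₂) = e S T₁ * e S T₂) (halt : ∀ T, e T T = 1)
    (S T : Tq) (a b c d : ℕ) (hdet : ((a * d + 1 : ℕ) : ZMod q) = ((b * c : ℕ) : ZMod q))
    {S' T' : Tq} (hS : S' = a • S + c • T) (hT : T' = b • S + d • T) :
    e S' T' = (e S T)⁻¹ := by
  subst hS hT
  have hx0 : e S T ≠ 0 := pairing_ne_zero e hq hpow S T
  have hlin := pairing_lin_comb e hq hpow hadd₁ hadd₂ halt S T a b c d
  -- `x ^ (a*d + 1) = x ^ (b*c)` since the exponents agree mod `q` and `x ^ q = 1`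
  have hmod : (a * d + 1) % q = (b * c) % q := (ZMod.natCast_eq_natCast_iff' _ _ _).mp hdet
  have hpowmod : ∀ n : ℕ, e S T ^ n = e S T ^ (n % q) := fun n ↦ by
    conv_lhs => rw [← Nat.div_add_mod n q, pow_add, pow_mul, hpow S T, one_pow, one_mul]
  have hexp : e S T ^ (a * d) * e S T = e S T ^ (b * c) := by
    rw [← pow_succ, hpowmod (a * d + 1), hmod, ← hpowmod]
  have h3 : e (a • S + c • T) (b • S + d • T) * e S T = 1 := by
    have h2 : e (a • S + c • T) (b • S + d • T) * e S T * e S T ^ (b * c) = 1 * e S T ^ (b * c) := by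
      rw [mul_right_comm, hlin, hexp, one_mul]
    exact mul_right_cancel₀ (pow_ne_zero _ hx0) h2
  exact eq_inv_of_mul_eq_one_left h3

/-- **A pairing value on a spanning pair is a PRIMITIVE `p^{n+1}`-th root of unity** (non-degeneracy): if every point is `iS + jT` and
`p^n T ≠ 0` then `e S T` has exact order `p^{n+1}`. -/
theorem pairing_isPrimitiveRoot_of_span {p n : ℕ} [hp : Fact p.Prime]
    (hpow : ∀ S T, e S T ^ p ^ (n + 1) = 1)
    (hadd₁ : ∀ S₁ S₂ T, e (S₁ + S₂) T = e S₁ T * e S₂ T)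
    (hadd₂ : ∀ S T₁ T₂, e S (T₁ + T₂) = e S T₁ * e S T₂) (halt : ∀ T, e T T = 1)
    (hnd : ∀ T, (∀ S, e S T = 1) → T = 0) (S T : Tq) (hspan : ∀ X : Tq, ∃ i j : ℕ, X = i • S + j • T)
    (hT : p ^ n • T ≠ 0) : IsPrimitiveRoot (e S T) (p ^ (n + 1)) := by
  have hq : p ^ (n + 1) ≠ 0 := pow_ne_zero _ hp.out.ne_zero
  have hnot : ¬ e S T ^ p ^ n = 1 := by
    intro h1
    apply hT
    apply hnd
    intro X
    obtain ⟨i, j, rfl⟩ := hspan X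
    rw [hadd₁, pairing_nsmul_left e hq hpow hadd₁, pairing_nsmul_left e hq hpow hadd₁,
      pairing_nsmul_right e hq hpow hadd₂, pairing_nsmul_right e hq hpow hadd₂, h1, halt, one_pow, one_pow,
      one_pow, one_mul]
  have hord : orderOf (e S T) = p ^ (n + 1) := orderOf_eq_prime_pow hnot (hpow S T)
  exact hord ▸ IsPrimitiveRoot.orderOf _

end WeilDet


/-! ### E0 glue: from a `ZMod q`-basis of `E[q]` to the ℕ-coefficient hypotheses above -/

section BasisGlue

variable {q : ℕ} [NeZero q] {V : Type*} [AddCommGroup V] [Module (ZMod q) V]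

theorem zmod_smul_eq_val_nsmul (r : ZMod q) (v : V) : r • v = r.val • v := by
  conv_lhs => rw [← ZMod.natCast_zmod_val r]
  exact Nat.cast_smul_eq_nsmul (ZMod q) r.val v

/-- Coordinates in a basis `(b 0, b 1)` as natural-number multiples (for `pairing_lin_comb` / `hspan`). -/
theorem eq_nsmul_add_nsmul_of_basis (b : Module.Basis (Fin 2) (ZMod q) V) (X : V) :
    X = (b.repr X 0).val • b 0 + (b.repr X 1).val • b 1 := by
  conv_lhs => rw [← b.sum_repr X]
  rw [Fin.sum_univ_two, zmod_smul_eq_val_nsmul, zmod_smul_eq_val_nsmul]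

theorem exists_nsmul_add_nsmul_of_basis (b : Module.Basis (Fin 2) (ZMod q) V) (X : V) :
    ∃ i j : ℕ, X = i • b 0 + j • b 1 :=
  ⟨_, _, eq_nsmul_add_nsmul_of_basis b X⟩

/-- `det = -1` in `ZMod q` ⟹ the ℕ-exponent congruence `ad + 1 ≡ bc (mod q)` used by `pairing_eq_inv_of_det_eq_neg_one`. -/
theorem natCast_val_det_eq_of_det_eq_neg_one (A B C D : ZMod q) (h : A * D - B * C = -1) :
    ((A.val * D.val + 1 : ℕ) : ZMod q) = ((B.val * C.val : ℕ) : ZMod q) := by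
  simp only [Nat.cast_add, Nat.cast_mul, Nat.cast_one, ZMod.natCast_zmod_val]
  linear_combination h

end BasisGlue

/-- A basis vector of a free `ZMod p^{n+1}`-module has exact order `p^{n+1}`: `p^n • b i ≠ 0` (the `hT` of
`pairing_isPrimitiveRoot_of_span`). -/
theorem pow_nsmul_basis_ne_zero {p n : ℕ} [hp : Fact p.Prime] {V ι : Type*} [AddCommGroup V]
    [Module (ZMod (p ^ (n + 1))) V] (b : Module.Basis ι (ZMod (p ^ (n + 1))) V) (i : ι) : p ^ n • b i ≠ 0 := by
  haveI : NeZero (p ^ (n + 1)) := ⟨pow_ne_zero _ hp.out.ne_zero⟩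
  intro h
  have h1 := congrArg (fun v ↦ b.repr v i) h
  simp only [map_zero, Finsupp.zero_apply] at h1
  rw [← Nat.cast_smul_eq_nsmul (ZMod (p ^ (n + 1))), map_smul, b.repr_self, Finsupp.smul_apply,
    Finsupp.single_eq_same, smul_eq_mul, mul_one] at h1
  have h2 := congrArg ZMod.val h1
  rw [ZMod.val_natCast, ZMod.val_zero,
    Nat.mod_eq_of_lt (Nat.pow_lt_pow_right hp.out.one_lt (Nat.lt_succ_self n))] at h2
  exact pow_ne_zero _ hp.out.ne_zero h2

/-- **Inverting one primitive `q`-th root of unity inverts them all** (for the Galois action on `ℚ̄`). -/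
theorem smul_eq_inv_of_smul_primitiveRoot_eq_inv {q : ℕ} {x : AlgebraicClosure ℚ} (hx : IsPrimitiveRoot x q)
    (hq : q ≠ 0) {σ : absoluteGaloisGroup ℚ} (hσ : σ • x = x⁻¹) (ζ : AlgebraicClosure ℚ) (hζ : ζ ^ q = 1) :
    σ • ζ = ζ⁻¹ := by
  haveI : NeZero q := ⟨hq⟩
  obtain ⟨k, -, rfl⟩ := hx.eq_pow_of_pow_eq_one hζ
  rw [smul_pow', hσ, inv_pow]


/-- **E0 CAPSTONE — `det ρ_{p^{n+1}}(σ) = -1` in a basis of `E[p^{n+1}]` ⟹ `σ` inverts `μ_{p^{n+1}}`** (Weil pairing: `det ρ = χ_cyc`;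
the converse of the tree's `toZModPow_det_galoisRepTate_eq`).  This is the hypothesis `hc₀` of `smul_eq_inv_of_smul_torsion_eq_of_inverts`
/ `pow_dvd_add_one_of_frob_smul_eq_of_inverts` for the line's regular element `c₀ = h₀` (E1 supplies `ρ_{2^{M+1}}(h₀)` of determinant `-1`).
Any `ZMod`-module structure on `E[p^{n+1}]` (the tree uses `AddSubgroup.torsionBy.zmodModule` via `letI`) may be supplied. -/
theorem smul_eq_inv_of_det_repr_eq_neg_one (W : WeierstrassCurve ℚ) [W.IsElliptic] {p : ℕ} (hp : p.Prime) (n : ℕ)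
    [Module (ZMod (p ^ (n + 1))) (geomTorsion W ((p ^ (n + 1) : ℕ) : ℤ))]
    (b : Module.Basis (Fin 2) (ZMod (p ^ (n + 1))) (geomTorsion W ((p ^ (n + 1) : ℕ) : ℤ)))
    {σ : absoluteGaloisGroup ℚ}
    (hdet : b.repr (σ • b 0) 0 * b.repr (σ • b 1) 1 - b.repr (σ • b 1) 0 * b.repr (σ • b 0) 1 = -1)
    (ζ : AlgebraicClosure ℚ) (hζ : ζ ^ (p ^ (n + 1)) = 1) : σ • ζ = ζ⁻¹ := by
  haveI : Fact p.Prime := ⟨hp⟩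
  have hq0 : p ^ (n + 1) ≠ 0 := pow_ne_zero _ hp.ne_zero
  haveI : NeZero (p ^ (n + 1)) := ⟨hq0⟩
  have hq2 : 2 ≤ p ^ (n + 1) :=
    le_trans hp.two_le (by
      calc p = p ^ 1 := (pow_one p).symm
        _ ≤ p ^ (n + 1) := Nat.pow_le_pow_right hp.pos (by omega))
  obtain ⟨e, hpow, hadd₁, hadd₂, halt, hnd, hgal⟩ :=
    W.exists_weilPairing_holds (p ^ (n + 1)) hq2 (by exact_mod_cast hq0)
  have hS := eq_nsmul_add_nsmul_of_basis b (σ • b 0)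
  have hT := eq_nsmul_add_nsmul_of_basis b (σ • b 1)
  have hdet' := natCast_val_det_eq_of_det_eq_neg_one _ _ _ _ hdet
  have hinv : e (σ • b 0) (σ • b 1) = (e (b 0) (b 1))⁻¹ :=
    pairing_eq_inv_of_det_eq_neg_one e hq0 hpow hadd₁ hadd₂ halt (b 0) (b 1) _ _ _ _ hdet' hS hT
  have hσx : σ • e (b 0) (b 1) = (e (b 0) (b 1))⁻¹ := by rw [hgal, hinv]
  have hprim : IsPrimitiveRoot (e (b 0) (b 1)) (p ^ (n + 1)) :=
    pairing_isPrimitiveRoot_of_span e hpow hadd₁ hadd₂ halt hnd (b 0) (b 1)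
      (exists_nsmul_add_nsmul_of_basis b) (pow_nsmul_basis_ne_zero b 1)
  exact smul_eq_inv_of_smul_primitiveRoot_eq_inv hprim hq0 hσx ζ hζ


/-- `σ² = 1` on `E[q]` from its values on a basis (the `hc₀sq` of `pow_dvd_frobeniusTraceAt_of_frob_smul_eq_of_inverts` from
`ρ_q(c₀)² = 1`). -/
theorem smul_smul_eq_self_of_basis {q : ℕ} [NeZero q] {G V : Type*} [Monoid G] [AddCommGroup V] [DistribMulAction G V]
    [Module (ZMod q) V] (b : Module.Basis (Fin 2) (ZMod q) V) {σ : G} (h0 : σ • σ • b 0 = b 0)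
    (h1 : σ • σ • b 1 = b 1) (P : V) : σ • σ • P = P := by
  obtain ⟨i, j, rfl⟩ := exists_nsmul_add_nsmul_of_basis b P
  have key : ∀ x : V, σ • σ • x = (DistribSMul.toAddMonoidHom V σ) ((DistribSMul.toAddMonoidHom V σ) x) :=
    fun _ ↦ rfl
  rw [key, map_add, map_add, map_nsmul, map_nsmul, map_nsmul, map_nsmul, ← key, ← key, h0, h1]

/-- **An element fixing a basis of `E[p^{n+1}]` fixes `μ_{p^{n+1}}`** (Weil pairing; used to propagate the inverting
hypothesis `hμ` from `h₀` to `h₀ · res n`, `n ∈ Γ_{K(E[2^M])}`: `(h₀ n) • ζ = h₀ • ζ`). -/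
theorem smul_eq_self_of_smul_basis_eq_self (W : WeierstrassCurve ℚ) [W.IsElliptic] {p : ℕ} (hp : p.Prime) (n : ℕ)
    [Module (ZMod (p ^ (n + 1))) (geomTorsion W ((p ^ (n + 1) : ℕ) : ℤ))]
    (b : Module.Basis (Fin 2) (ZMod (p ^ (n + 1))) (geomTorsion W ((p ^ (n + 1) : ℕ) : ℤ)))
    {σ : absoluteGaloisGroup ℚ} (h0 : σ • b 0 = b 0) (h1 : σ • b 1 = b 1)
    (ζ : AlgebraicClosure ℚ) (hζ : ζ ^ (p ^ (n + 1)) = 1) : σ • ζ = ζ := by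
  haveI : Fact p.Prime := ⟨hp⟩
  have hq0 : p ^ (n + 1) ≠ 0 := pow_ne_zero _ hp.ne_zero
  haveI : NeZero (p ^ (n + 1)) := ⟨hq0⟩
  have hq2 : 2 ≤ p ^ (n + 1) :=
    le_trans hp.two_le (by
      calc p = p ^ 1 := (pow_one p).symm
        _ ≤ p ^ (n + 1) := Nat.pow_le_pow_right hp.pos (by omega))
  obtain ⟨e, hpow, hadd₁, hadd₂, halt, hnd, hgal⟩ :=
    W.exists_weilPairing_holds (p ^ (n + 1)) hq2 (by exact_mod_cast hq0)
  have hσx : σ • e (b 0) (b 1) = e (b 0) (b 1) := by rw [hgal, h0, h1]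
  have hprim : IsPrimitiveRoot (e (b 0) (b 1)) (p ^ (n + 1)) :=
    pairing_isPrimitiveRoot_of_span e hpow hadd₁ hadd₂ halt hnd (b 0) (b 1)
      (exists_nsmul_add_nsmul_of_basis b) (pow_nsmul_basis_ne_zero b 1)
  obtain ⟨k, -, rfl⟩ := hprim.eq_pow_of_pow_eq_one hζ
  rw [smul_pow', hσx]

end CyclotomicE


/-! ## §F  Steps C–H for a REGULAR element (card ENGINE-PORT MAP step E3, PROVED): the tree engine
`GenusExact.exists_kolyvaginPrime_gt_two_of_galoisElement` with `ρ ∈ Γ_{K(E[2^M])}` replaced by an arbitrary `ρ ∈ Γ_K`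
such that `h₀ := c₀ · res ρ` squares to `1` on `E[2^M]` and inverts `μ_{2^M}`; output: a Kolyvagin prime `ℓ` whose
Frobenius acts on `E[2^M]` as `h₀` (not as `c₀`), `2^M ∣ ℓ + 1`, `2^M ∣ a_ℓ`, exact local orders.  What remains for the
lead is E1 (produce `h₀` regular: §A–§C + Galois glue) and E2 (Step B: produce `ρ` with the exact twisted orders, §D). -/

section ChebotarevF

open scoped Classical Pointwise
open WeierstrassCurve NumberField IsDedekindDomain Field
open Literature.NumberTheory.GaloisRepresentations Literature.NumberTheory.EllipticCurves
open Literature.NumberTheory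
open Rat.HeightOneSpectrum

universe u

variable {W : WeierstrassCurve ℚ} {K : Type u} [Field K] [NumberField K]

set_option maxHeartbeats 1600000 in
/-- **Steps C–H of McCallum's Cor. 3.2 at `2` for a REGULAR element `h₀ = c₀ · res ρ`** (the tree's
`GenusExact.exists_kolyvaginPrime_gt_two_of_galoisElement` — Step B's output `ρ` taken as a hypothesis — with the
requirement `ρ ∈ Γ_{K(E[2^M])}` DROPPED: `ρ ∈ Γ_K` is arbitrary, subject to `h₀² = 1` on `E(ℚ̄)[2^M]` (`hsq`) and
`h₀` inverting `μ_{2^M}` (`hμ`, i.e. `det ρ_{2^M}(h₀) = -1`, §E `smul_eq_inv_of_det_repr_eq_neg_one`).  Conclusion: for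
every `b` a prime `ℓ > b`, `ℓ ∤ 2 N d_K`, `(ℓ)` inert in `K`, a Frobenius `h` above `ℓ` acting on `E[2^M]` AS `h₀` and on
`K` as `c₀` (the regular replacement of `FrobEqFrobInfty`), `2^M ∣ ℓ + 1`, `2^M ∣ a_ℓ`, and `ord c_{i,λ} = 2^{N_i}` exactly
at `λ ∋ ℓ`.  Proof = the tree proof verbatim (Čebotarev in `c₀ · res(ρ𝒩)`, inertness, the local criterion at `λ`),
except: `Frob_λ = τ' ∈ Γ_{K(E[2^M])}` now comes from `hsq` transported along `RatClosure.torsionEquiv` (instead of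
`ρ ∈ Γ_{K(E[2^M])}`), and (3.3) comes from §E (instead of `…_of_frobEqFrobInfty`).  This is step E3 (Steps C–H) of the
card's ENGINE-PORT MAP, PROVED; Step B (E2: producing `ρ` with `hsq`, `hμ` and the exact orders) remains the lead's.
Conditional only on the displayed `hC : Automorphic.chebotarev_artinRep` (a tree THEOREM,
`Automorphic.chebotarev_artinRep_of_galoisSide`). [cite: McCallumLMS1991, §3 Cor. 3.2 (proof, with Prop. 3.1)]
[cite: GrossLMS1991, §3 (3.1)–(3.3)] -/
theorem exists_kolyvaginPrime_gt_two_of_galoisElement_regular (hC : Automorphic.chebotarev_artinRep) {N : ℕ}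
    [NeZero N] [W.IsElliptic] [W.IsGloballyMinimal] (hK : IsImaginaryQuadratic K) {M : ℕ}
    (hM : 1 ≤ M)
    {c₀ : absoluteGaloisGroup ℚ} (hc₀ : IsComplexConjugation (Rat.castHom ℝ) c₀)
    {c : K ≃ₐ[ℚ] K} (hc : c ≠ 1) {r : ℕ}
    (cs : Fin r → galH1Torsion (W.baseChange K) ((2 ^ M : ℕ) : ℤ)) (Nv : Fin r → ℕ)
    {ρ : absoluteGaloisGroup K}
    (hsq : ∀ P : geomTorsion W ((2 ^ M : ℕ) : ℤ),
      (c₀ * absGaloisRestrict ℚ K ρ) • (c₀ * absGaloisRestrict ℚ K ρ) • P = P)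
    (hμ : ∀ ζ : AlgebraicClosure ℚ, ζ ^ (2 ^ M) = 1 → (c₀ * absGaloisRestrict ℚ K ρ) • ζ = ζ⁻¹)
    (hρ : ∀ m ∈ evalKer (W.baseChange K) ((2 ^ M : ℕ) : ℤ) cs, ∀ i,
        ((2 : ℤ) ^ Nv i) • h1Eval (W.baseChange K) ((2 ^ M : ℕ) : ℤ) (cs i)
            ((RatClosure.isLiftOfAut_absGaloisTransport_of_isImaginaryQuadratic hK hc hc₀).conjGalCMH
              (ρ * m) * (ρ * m)) = 0 ∧
          (Nv i ≠ 0 → ((2 : ℤ) ^ (Nv i - 1)) • h1Eval (W.baseChange K) ((2 ^ M : ℕ) : ℤ) (cs i)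
            ((RatClosure.isLiftOfAut_absGaloisTransport_of_isImaginaryQuadratic hK hc hc₀).conjGalCMH
              (ρ * m) * (ρ * m)) ≠ 0))
    (b : ℕ) :
    ∃ ℓ : ℕ, b < ℓ ∧ ℓ.Prime ∧ ¬ ℓ ∣ N ∧ ¬ ((ℓ : ℤ) ∣ NumberField.discr K) ∧ ℓ ≠ 2 ∧
      (Ideal.span {(ℓ : 𝓞 K)}).IsPrime ∧
      (∃ (v : HeightOneSpectrum (𝓞 ℚ)) (𝔓 : Ideal (absIntegers (𝓞 ℚ) ℚ)) (h : absoluteGaloisGroup ℚ),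
        (ℓ : 𝓞 ℚ) ∈ v.asIdeal ∧ 𝔓 ∈ v.primesAbove ∧ IsArithFrobAt (𝓞 ℚ) h 𝔓 ∧
        (∀ P : geomTorsion W ((2 ^ M : ℕ) : ℤ), h • P = (c₀ * absGaloisRestrict ℚ K ρ) • P) ∧
        ∀ (e : K →ₐ[ℚ] AlgebraicClosure ℚ) (x : K), h • e x = c₀ • e x) ∧
      2 ^ M ∣ ℓ + 1 ∧ ((2 : ℤ) ^ M) ∣ W.frobeniusTrace ℓ ∧
      ∀ i, ∀ v : HeightOneSpectrum (𝓞 K), (ℓ : 𝓞 K) ∈ v.asIdeal →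
        (((2 : ℤ) ^ Nv i) • cs i ∈
            (W.baseChange K).torsionLocalKer (v.adicCompletion K) ((2 ^ M : ℕ) : ℤ) ∧
          (Nv i ≠ 0 → ((2 : ℤ) ^ (Nv i - 1)) • cs i ∉
            (W.baseChange K).torsionLocalKer (v.adicCompletion K) ((2 ^ M : ℕ) : ℤ))) := by
  classical
  have hp : Nat.Prime 2 := Nat.prime_two
  haveI : Fact (Nat.Prime 2) := ⟨hp⟩
  haveI : Algebra.IsQuadraticExtension ℚ K := ⟨hK.1⟩
  haveI : IsTotallyComplex K := hK.2
  have hn0 : ((2 ^ M : ℕ) : ℤ) ≠ 0 := by exact_mod_cast pow_ne_zero M hp.ne_zero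
  have h2n : (2 : ℤ) ∣ ((2 ^ M : ℕ) : ℤ) := by
    rw [Nat.cast_pow]; exact dvd_pow_self _ (by omega)
  -- ### Step A: the involutive lift of complex conjugation and the free generator on `E(K̄)[2^M]`
  set t : AlgebraicClosure K ≃+* AlgebraicClosure K :=
    (absGaloisTransport (K := ℚ) (L := K) c₀).toRingEquiv with ht_def
  have ht : IsLiftOfAut c t :=
    RatClosure.isLiftOfAut_absGaloisTransport_of_isImaginaryQuadratic hK hc hc₀
  -- ### Step C: the finite exceptional set of places of `ℚ`
  have hbad : ((W.baseChange K).badPlaces (𝓞 K)).Finite :=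
    (W.baseChange K).finite_badPlaces_holds (𝓞 K)
  have hbad₀ : (W.badPlaces (𝓞 ℚ)).Finite := W.finite_badPlaces_holds (𝓞 ℚ)
  choose T hTfin hT using fun i ↦
    exists_finite_forall_mem_unramifiedKer (W.baseChange K) hn0 (cs i)
  set B : Finset ℕ := {2} ∪ N.primeFactors ∪ (NumberField.discr K).natAbs.primeFactors ∪
    Finset.range (b + 1) with hB
  set S₁ : Set (HeightOneSpectrum (𝓞 ℚ)) := {v | ∃ q ∈ B, q.Prime ∧ (q : 𝓞 ℚ) ∈ v.asIdeal}
    with hS₁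
  set S₂ : Set (HeightOneSpectrum (𝓞 ℚ)) := {v | ¬ Algebra.IsUnramifiedIn (𝓞 K) v.asIdeal}
    with hS₂
  set S₃ : Set (HeightOneSpectrum (𝓞 ℚ)) :=
    (fun w : HeightOneSpectrum (𝓞 K) ↦ w.under (𝓞 ℚ)) ''
      ((W.baseChange K).badPlaces (𝓞 K) ∪ ⋃ i, T i) with hS₃
  have hS₁fin : S₁.Finite := by
    have : S₁ ⊆ ⋃ q ∈ (B.filter Nat.Prime), {v | (q : 𝓞 ℚ) ∈ v.asIdeal} := by
      intro v ⟨q, hqB, hq, hqv⟩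
      simp only [Set.mem_iUnion, Finset.mem_filter]
      exact ⟨q, ⟨hqB, hq⟩, hqv⟩
    refine Set.Finite.subset (Set.Finite.biUnion (Finset.finite_toSet _) fun q hq ↦ ?_) this
    rw [Finset.coe_filter, Set.mem_setOf_eq] at hq
    have hsub : {v : HeightOneSpectrum (𝓞 ℚ) | (q : 𝓞 ℚ) ∈ v.asIdeal}.Subsingleton :=
      fun v hv v' hv' ↦ HeightOneSpectrum.eq_of_natCast_mem_rat hq.2 hv hv'
    exact hsub.finite
  have hS₂fin : S₂.Finite := finite_setOf_not_isUnramifiedIn ℚ K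
  have hS₃fin : S₃.Finite :=
    (hbad.union (Set.finite_iUnion fun i ↦ hTfin i)).image _
  set S := S₁ ∪ S₂ ∪ S₃ ∪ W.badPlaces (𝓞 ℚ) with hSdef
  have hSfin : S.Finite := ((hS₁fin.union hS₂fin).union hS₃fin).union hbad₀
  -- ### Step D: Čebotarev in `Γ_ℚ`: a Frobenius in the open set `c₀ · res(ρ 𝒩)`
  set 𝒩 := evalKer (W.baseChange K) ((2 ^ M : ℕ) : ℤ) cs with h𝒩
  have h𝒩open : IsOpen (𝒩 : Set (absoluteGaloisGroup K)) :=
    isOpen_evalKer (W.baseChange K) _ cs (isOpen_torsionFixing (W.baseChange K) hn0)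
  set O : Set (absoluteGaloisGroup ℚ) :=
    (fun γ ↦ c₀ * γ) '' (absGaloisRestrict ℚ K '' ((fun m ↦ ρ * m) '' (𝒩 : Set _))) with hO
  have hOopen : IsOpen O := by
    refine (Homeomorph.mulLeft c₀).isOpenMap _ (isOpenMap_absGaloisRestrict K _ ?_)
    exact (Homeomorph.mulLeft ρ).isOpenMap _ h𝒩open
  have hOne : O.Nonempty :=
    ⟨c₀ * absGaloisRestrict ℚ K (ρ * 1), _, ⟨_, ⟨1, 𝒩.one_mem, rfl⟩, rfl⟩, rfl⟩
  obtain ⟨γ, hγO, v, hvS, 𝔓₀, h𝔓₀, hγ⟩ :=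
    (absoluteGaloisGroup.frobenius_dense hC ℚ S hSfin).inter_open_nonempty O hOopen hOne
  obtain ⟨_, ⟨_, ⟨m, hm, rfl⟩, rfl⟩, rfl⟩ := hγO
  set g := ρ * m with hg
  have hmT : m ∈ torsionFixing (W.baseChange K) ((2 ^ M : ℕ) : ℤ) := hm.1
  -- `c₀ · res g` acts on `E(ℚ̄)[2^M]` as `h₀ := c₀ · res ρ` (since `m ∈ Γ_{K(E[2^M])}`)
  have key : ∀ X : geomTorsion W ((2 ^ M : ℕ) : ℤ),
      (c₀ * absGaloisRestrict ℚ K g) • X = (c₀ * absGaloisRestrict ℚ K ρ) • X := fun X ↦ by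
    rw [hg, map_mul, ← mul_assoc, mul_smul (c₀ * _), absGaloisRestrict_smul_eq_of_mem_torsionFixing W hmT]
  -- ### Step E: the rational prime `ℓ` under `v`
  obtain ⟨ℓ, hℓ, hℓv⟩ := exists_prime_natCast_mem v
  have hℓB : ℓ ∉ B := fun h ↦ hvS (Or.inl (Or.inl (Or.inl ⟨ℓ, h, hℓ, hℓv⟩)))
  simp only [hB, Finset.mem_union, Finset.mem_singleton, Nat.mem_primeFactors,
    Finset.mem_range, not_or] at hℓB
  obtain ⟨⟨⟨hℓp, hℓN⟩, hℓD⟩, hℓb⟩ := hℓB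
  have hℓN' : ¬ ℓ ∣ N := fun h ↦ hℓN ⟨hℓ, h, NeZero.ne N⟩
  have hℓD' : ¬ ((ℓ : ℤ) ∣ NumberField.discr K) := fun h ↦
    hℓD ⟨hℓ, Int.natAbs_dvd_natAbs.mpr h |>.trans (by simp), by
      simp [NumberField.discr_ne_zero]⟩
  have hbℓ : b < ℓ := by omega
  have hunr : Algebra.IsUnramifiedIn (𝓞 K) v.asIdeal := by
    by_contra h; exact hvS (Or.inl (Or.inl (Or.inr h)))
  have hvS₃ : v ∉ S₃ := fun h ↦ hvS (Or.inl (Or.inr h))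
  have hgood₀ : W.HasGoodReductionAt v := by
    by_contra h; exact hvS (Or.inr h)
  -- ### Step F: `ℓ` is inert, with a Frobenius `τ' = g^τ g` over `K`
  have hHi := index_range_absGaloisRestrict_eq_finrank ℚ K
  haveI hHn : ((absGaloisRestrict ℚ K).range).Normal :=
    Subgroup.normal_of_index_eq_two (hHi.trans hK.1)
  have hI := inertia_le_range_absGaloisRestrict_of_isUnramifiedIn (K := K) hunr h𝔓₀
  have hΦH : c₀ * absGaloisRestrict ℚ K g ∉ (absGaloisRestrict ℚ K).range := by
    intro h
    apply hc₀.not_mem_range_absGaloisRestrict (L := K) IsTotallyComplex.isComplex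
    change c₀ ∈ ((absGaloisRestrict ℚ K).range : Set (absoluteGaloisGroup ℚ))
    have h' : c₀ = c₀ * absGaloisRestrict ℚ K g * (absGaloisRestrict ℚ K g)⁻¹ := by group
    rw [SetLike.mem_coe, h']
    exact Subgroup.mul_mem _ h (Subgroup.inv_mem _ ⟨g, rfl⟩)
  obtain ⟨w, 𝔔, τ', hwv, hwuniq, -, h𝔔w, -, hτ', hresτ'⟩ :=
    exists_place_inert_of_not_mem_range (F := ℚ) (M := K) (hK.1 ▸ Nat.prime_two) hHn
      (hHi.trans rfl) hunr h𝔓₀ hI hγ hΦH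
  -- `Frob_λ = τ'` fixes `E[2^M]`: `res τ' = (c₀ res g)²` acts as `h₀² = 1` (hypothesis `hsq`), transported along `E(ℚ̄)[n] ≃ E(K̄)[n]`
  have hτ'T : τ' ∈ torsionFixing (W.baseChange K) ((2 ^ M : ℕ) : ℤ) := by
    refine (mem_torsionFixing_iff _ _).mpr fun Q ↦ ?_
    obtain ⟨P, rfl⟩ := (RatClosure.torsionEquiv (K := K) W ((2 ^ M : ℕ) : ℤ)).surjective Q
    rw [← RatClosure.torsionEquiv_smul, hresτ', hK.1, pow_two, mul_smul, key, key, hsq]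
  rw [hK.1, sq_eq_absGaloisRestrict_conjGal_mul hc₀ ht g] at hresτ'
  have hτ'eq : τ' = ht.conjGalCMH g * g := absGaloisRestrict_injective ℚ K hresτ'
  -- `ℓ ∈ w`, and `w` is the only place of `K` containing `ℓ`
  have hℓw : (ℓ : 𝓞 K) ∈ w.asIdeal := by
    have h1 : (ℓ : 𝓞 ℚ) ∈ (w.under (𝓞 ℚ)).asIdeal := by rw [hwv]; exact hℓv
    rw [HeightOneSpectrum.under_asIdeal, Ideal.under_def, Ideal.mem_comap, map_natCast] at h1
    exact h1
  have hwuniq' : ∀ w' : HeightOneSpectrum (𝓞 K), (ℓ : 𝓞 K) ∈ w'.asIdeal → w' = w := by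
    intro w' hw'
    apply hwuniq
    apply HeightOneSpectrum.eq_of_natCast_mem_rat hℓ _ hℓv
    rw [HeightOneSpectrum.under_asIdeal, Ideal.under_def, Ideal.mem_comap, map_natCast]
    exact hw'
  -- `(ℓ) = w` is prime
  have hspan : Ideal.span {(ℓ : 𝓞 K)} = w.asIdeal := by
    apply span_natCast_eq_of_unique hℓ w hwuniq'
    haveI : w.asIdeal.LiesOver v.asIdeal := ⟨by rw [← hwv]; rfl⟩
    have hmap : v.asIdeal.map (algebraMap (𝓞 ℚ) (𝓞 K)) = Ideal.span {(ℓ : 𝓞 K)} := by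
      rw [← span_natCast_rat_eq hℓ hℓv, Ideal.map_span, Set.image_singleton, map_natCast]
    have hne : v.asIdeal.map (algebraMap (𝓞 ℚ) (𝓞 K)) ≠ ⊥ := by
      rw [hmap, Ne, Ideal.span_singleton_eq_bot]; exact_mod_cast hℓ.ne_zero
    rw [← hmap, ← Ideal.IsDedekindDomain.ramificationIdx_eq_normalizedFactors_count v.asIdeal
      w.asIdeal hne]
    exact Ideal.ramificationIdx_eq_one_iff.mpr (hunr w.asIdeal w.isPrime inferInstance)
  -- ### Step G: the local criterion at `w`, for the classes `2^a c_i`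
  have hloc : ∀ i (a : ℕ), (((2 : ℤ) ^ a) • cs i ∈
      (W.baseChange K).torsionLocalKer (w.adicCompletion K) ((2 ^ M : ℕ) : ℤ) ↔
        ((2 : ℤ) ^ a) • h1Eval (W.baseChange K) ((2 ^ M : ℕ) : ℤ) (cs i)
          (ht.conjGalCMH (ρ * m) * (ρ * m)) = 0) := by
    intro i a
    haveI : CharZero (w.adicCompletion K) :=
      charZero_of_injective_algebraMap (algebraMap K (w.adicCompletion K)).injective
    obtain ⟨𝔐, h𝔐⟩ := w.localPrimesAbove_nonempty
    set 𝔓w := w.primeBelow (closureEmb (K := K) (w.adicCompletion K)) 𝔐 with h𝔓w_def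
    have h𝔓w : 𝔓w ∈ w.primesAbove := w.primeBelow_mem_primesAbove h𝔐
    obtain ⟨δ, hδ, hF⟩ :=
      HeightOneSpectrum.exists_isArithFrobAt_conj_of_mem_primesAbove_holds h𝔔w h𝔓w hτ'
    have hFT : δ * τ' * δ⁻¹ ∈ torsionFixing (W.baseChange K) ((2 ^ M : ℕ) : ℤ) :=
      (torsionFixing_normal (W.baseChange K) _).conj_mem _ hτ'T δ
    have hwbad : w ∉ (W.baseChange K).badPlaces (𝓞 K) := fun h ↦
      hvS₃ ⟨w, Or.inl h, hwv⟩
    have hwT : w ∉ T i := fun h ↦ hvS₃ ⟨w, Or.inr (Set.mem_iUnion.mpr ⟨i, h⟩), hwv⟩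
    have hpw : (((2 : ℕ) : ℤ) : 𝓞 K) ∉ w.asIdeal := by
      rw [Int.cast_natCast]
      exact not_natCast_mem_of_prime_ne hℓ hp hℓp w hℓw
    have hpMw : ((((2 ^ M : ℕ) : ℤ)) : 𝓞 K) ∉ w.asIdeal := fun h ↦ by
      apply hpw
      rw [Int.cast_natCast, Nat.cast_pow] at h
      rw [Int.cast_natCast]
      exact w.isPrime.mem_of_pow_mem M h
    have hcrit := mem_torsionLocalKer_iff_h1Eval_eq_zero (W.baseChange K) ((2 ^ M : ℕ) : ℤ) h𝔐
      hF hFT (inertia_le_torsionFixing (W.baseChange K) hwbad hpMw _ h𝔐)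
      (isOpen_torsionFixing (W.baseChange K) hn0)
      (torsionPointsMap_bijective (W.baseChange K) (w.adicCompletion K)
        (pow_ne_zero M hp.ne_zero)).2
      (AddSubgroup.zsmul_mem _ (hT i w hwT 𝔓w h𝔓w) ((2 : ℤ) ^ a))
    rw [hcrit, h1Eval_conj (W.baseChange K) _ _ δ hτ'T, smul_eq_zero_iff_eq,
      h1Eval_zsmul (W.baseChange K) _ _ _ hτ'T, hτ'eq]
  -- ### Step H: assemble; (3.2)' ⟹ (3.3) at `2^M` for the element `h₀ = c₀ · res ρ` (§E, `c₀ ↦` any `μ`-inverting element)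
  have hγK : ∀ (e : K →ₐ[ℚ] AlgebraicClosure ℚ) (x : K), (c₀ * absGaloisRestrict ℚ K g) • e x = c₀ • e x :=
    fun e x ↦ by rw [mul_smul, absGaloisRestrict_smul_apply_eq g e x]
  have hℓ2 : ℓ ≠ 2 := hℓp
  have hdvd1 : 2 ^ M ∣ ℓ + 1 :=
    pow_dvd_add_one_of_frob_smul_eq_of_inverts W hp hM hℓ hℓ2 hℓv h𝔓₀ hγ hμ key
  have hdvd2 : ((2 : ℤ) ^ M) ∣ W.frobeniusTrace ℓ := by
    have h := pow_dvd_frobeniusTraceAt_of_frob_smul_eq_of_inverts W hp hM hℓ hℓ2 hℓv hgood₀ h𝔓₀ hγ hμ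
      hsq key
    rw [W.frobeniusTraceAt_eq_frobeniusTrace v] at h
    rwa [show ((primesEquiv v : ℕ)) = ℓ from primesEquiv_eq_of_natCast_mem hℓ hℓv] at h
  refine ⟨ℓ, hbℓ, hℓ, hℓN', hℓD', hℓ2, hspan ▸ w.isPrime,
    ⟨v, 𝔓₀, c₀ * absGaloisRestrict ℚ K g, hℓv, h𝔓₀, hγ, key, hγK⟩, hdvd1, hdvd2, fun i v' hv' ↦ ?_⟩
  rw [hwuniq' v' hv']
  exact ⟨(hloc i (Nv i)).mpr (hρ m hm i).1, fun hN h ↦ (hρ m hm i).2 hN ((hloc i _).mp h)⟩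

end ChebotarevF

/-! ## §G  Regular-lift dichotomy (card E1c at GROUP level, PROVED): from `φ : G ↠ GL₂(ℤ/2^{M+1})`, `χ : G → A ≅ C₂` -/

section RegularLiftG

open Matrix
open scoped MatrixGroups Classical

variable {M : ℕ} {A : Type*} [CommGroup A]

/-- Parity of `g mod 2` for `g ∈ GL₂(ℤ/2^{M+1})`: `g mod 2` is a transposition of `GL₂(𝔽₂) ≅ S₃`. -/
def OddModTwoGL (g : GL (Fin 2) (ZMod (2 ^ (M + 1)))) : Prop :=
  π M (g.val 0 0 + g.val 1 1) = 0 ∧ (π M (g.val 0 1) ≠ 0 ∨ π M (g.val 1 0) ≠ 0)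

theorem oddModTwoGL_toGL_iff (s : SL(2, ZMod (2 ^ (M + 1)))) :
    OddModTwoGL (Matrix.SpecialLinearGroup.toGL s) ↔ OddModTwo s := Iff.rfl

/-- `x ↦ diag(x, 1)`, a homomorphism `(ℤ/2^{M+1})ˣ → GL₂(ℤ/2^{M+1})` splitting `det`. -/
def diagHom (M : ℕ) : (ZMod (2 ^ (M + 1)))ˣ →* GL (Fin 2) (ZMod (2 ^ (M + 1))) where
  toFun x := diagGL (x : ZMod (2 ^ (M + 1))) ((x⁻¹ : (ZMod (2 ^ (M + 1)))ˣ) : ZMod (2 ^ (M + 1))) x.mul_inv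
  map_one' := by
    apply Units.ext
    change (!![((1 : (ZMod (2 ^ (M + 1)))ˣ) : ZMod (2 ^ (M + 1))), 0; 0, 1] : Matrix (Fin 2) (Fin 2) (ZMod (2 ^ (M + 1)))) = 1
    rw [Matrix.one_fin_two, Units.val_one]
  map_mul' x y := by
    apply Units.ext
    change (!![((x * y : (ZMod (2 ^ (M + 1)))ˣ) : ZMod (2 ^ (M + 1))), 0; 0, 1] : Matrix (Fin 2) (Fin 2) (ZMod (2 ^ (M + 1)))) =
      !![(x : ZMod (2 ^ (M + 1))), 0; 0, 1] * !![(y : ZMod (2 ^ (M + 1))), 0; 0, 1]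
    rw [Matrix.mul_fin_two, Units.val_mul]
    congr 1 <;> simp

theorem val_diagHom (x : (ZMod (2 ^ (M + 1)))ˣ) :
    ((diagHom M x : GL (Fin 2) (ZMod (2 ^ (M + 1)))) : Matrix (Fin 2) (Fin 2) (ZMod (2 ^ (M + 1)))) =
      !![(x : ZMod (2 ^ (M + 1))), 0; 0, 1] := rfl

theorem val_diagHom_inv (x : (ZMod (2 ^ (M + 1)))ˣ) :
    (((diagHom M x)⁻¹ : GL (Fin 2) (ZMod (2 ^ (M + 1)))) : Matrix (Fin 2) (Fin 2) (ZMod (2 ^ (M + 1)))) =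
      !![((x⁻¹ : (ZMod (2 ^ (M + 1)))ˣ) : ZMod (2 ^ (M + 1))), 0; 0, 1] := rfl

theorem det_diagHom (x : (ZMod (2 ^ (M + 1)))ˣ) : Matrix.GeneralLinearGroup.det (diagHom M x) = x := by
  apply Units.ext
  rw [Matrix.GeneralLinearGroup.val_det_apply, val_diagHom, Matrix.det_fin_two_of]
  ring

/-- parity is insensitive to right multiplication by `diag(e, 1)`, `e` a unit -/
theorem oddModTwo_iff_of_coe_eq (s : SL(2, ZMod (2 ^ (M + 1)))) (g : GL (Fin 2) (ZMod (2 ^ (M + 1))))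
    (e : ZMod (2 ^ (M + 1))) (he : π M e = 1)
    (hs : (s : Matrix (Fin 2) (Fin 2) (ZMod (2 ^ (M + 1)))) = g.val * !![e, 0; 0, 1]) :
    OddModTwo s ↔ OddModTwoGL g := by
  have h00 : s 0 0 = g.val 0 0 * e := by
    have := congrFun (congrFun hs 0) 0; simpa [Matrix.mul_apply, Fin.sum_univ_two] using this
  have h01 : s 0 1 = g.val 0 1 := by
    have := congrFun (congrFun hs 0) 1; simpa [Matrix.mul_apply, Fin.sum_univ_two] using this
  have h10 : s 1 0 = g.val 1 0 * e := by
    have := congrFun (congrFun hs 1) 0; simpa [Matrix.mul_apply, Fin.sum_univ_two] using this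
  have h11 : s 1 1 = g.val 1 1 := by
    have := congrFun (congrFun hs 1) 1; simpa [Matrix.mul_apply, Fin.sum_univ_two] using this
  unfold OddModTwo OddModTwoGL
  rw [h00, h01, h10, h11, map_add, map_mul, he, mul_one, map_mul, he, mul_one, ← map_add]

/-- **E1a, GL form, general `g`.**  `ψ(g) = sgn-part(g) · ε(det g)` with `ε := ψ ∘ diag(·, 1)`:
every `ψ : GL₂(ℤ/2^{M+1}) → A` (abelian, `ψ(u)² = 1`) is `(sgn ∘ red₂)^{a} · (ε ∘ det)`, `a ∈ {0, 1}`. -/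
theorem charGL_eq_general (ψ : GL (Fin 2) (ZMod (2 ^ (M + 1))) →* A)
    (h2 : ψ (Matrix.SpecialLinearGroup.toGL (uS M)) ^ 2 = 1) (g : GL (Fin 2) (ZMod (2 ^ (M + 1)))) :
    ψ g = (if OddModTwoGL g then ψ (Matrix.SpecialLinearGroup.toGL (uS M)) else 1) *
      ψ (diagHom M (Matrix.GeneralLinearGroup.det g)) := by
  set d := Matrix.GeneralLinearGroup.det g with hd
  have hdet : Matrix.GeneralLinearGroup.det g = Matrix.GeneralLinearGroup.det (diagHom M d) := by
    rw [det_diagHom]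
  have hd1 : ((g * (diagHom M d)⁻¹ : GL (Fin 2) (ZMod (2 ^ (M + 1)))) :
      Matrix (Fin 2) (Fin 2) (ZMod (2 ^ (M + 1)))).det = 1 := by
    have h1 : Matrix.GeneralLinearGroup.det (g * (diagHom M d)⁻¹) = 1 := by
      rw [map_mul, map_inv, ← hdet, mul_inv_cancel]
    have h2' := congrArg (fun u : (ZMod (2 ^ (M + 1)))ˣ ↦ (u : ZMod (2 ^ (M + 1)))) h1
    simpa [Matrix.GeneralLinearGroup.val_det_apply] using h2'
  have hπ : π M (((d⁻¹ : (ZMod (2 ^ (M + 1)))ˣ) : ZMod (2 ^ (M + 1)))) = 1 :=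
    (isUnit_iff_π_eq_one _).mp (Units.isUnit _)
  have hpar := oddModTwo_iff_of_coe_eq
    (⟨((g * (diagHom M d)⁻¹ : GL (Fin 2) (ZMod (2 ^ (M + 1)))) : Matrix (Fin 2) (Fin 2) (ZMod (2 ^ (M + 1)))), hd1⟩ :
      SL(2, ZMod (2 ^ (M + 1)))) g _ hπ (by
        change ((g * (diagHom M d)⁻¹ : GL (Fin 2) (ZMod (2 ^ (M + 1)))) : Matrix (Fin 2) (Fin 2) (ZMod (2 ^ (M + 1)))) = _
        rw [Units.val_mul, val_diagHom_inv])
  rw [charGL_mul_inv_eq ψ h2 g (diagHom M d) hdet hd1]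
  by_cases hodd : OddModTwoGL g
  · rw [if_pos hodd, if_pos (hpar.mpr hodd)]
  · rw [if_neg hodd, if_neg (fun h ↦ hodd (hpar.mp h))]

/-- In a group in which every element is `1` or `τ`, every square is `1`. -/
theorem sq_eq_one_of_two_valued {τ : A} (hA : ∀ a : A, a = 1 ∨ a = τ) (a : A) : a ^ 2 = 1 := by
  have hτ : τ ^ 2 = 1 := by
    rcases hA (τ ^ 2) with h | h
    · exact h
    · have h1 : τ = 1 := by
        have := congrArg (· * τ⁻¹) h
        simpa [pow_two] using this
      rw [h1, one_pow]
  rcases hA a with rfl | rfl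
  · exact one_pow 2
  · exact hτ

/-- **E1c at group level (the regular-lift dichotomy), PROVED.**  Let `φ : G → GL₂(ℤ/2^{M+1})` be SURJECTIVE and
`χ : G → A` a homomorphism to a group all of whose elements are `1` or `τ` (think `G = Gal(ℚ(E[2^{M+1}])K/ℚ)`,
`φ = ρ_{E,2^{M+1}}`, `A = Gal(K/ℚ) = {1, τ}`, `χ = res_K`), and `g₀ ∈ G` with `χ g₀ = τ` (complex conjugation).  Then
EITHER every `R ∈ GL₂(ℤ/2^{M+1})` with `det R = det φ(g₀)` lifts to some `g` with `φ g = R` AND `χ g = τ` — in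
particular the regular involution `regR = [[1,1],[0,-1]]` does when `det φ(g₀) = -1`, giving the element `h₀` of E1 —
OR `τ ≠ 1` and `χ = (sgn ∘ red₂ ∘ φ) · (ε ∘ det ∘ φ)` for a character `ε` of `(ℤ/2^{M+1})ˣ` (with values in `{1, τ}`):
the exceptional branch, which the lead closes ARITHMETICALLY (`sgn ∘ red₂ ∘ ρ̄` is the quadratic character of `ℚ(√Δ)` by
`isSquare_Δ_iff_forall_smul_delta` / §A; `ε ∘ det ρ = ε ∘ χ_cyc` is one of `1, χ₋₄, χ₈, χ₋₈`; so `K ⊂ ℚ(√±Δ, √±2Δ)`,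
i.e. `K ∈ {ℚ(√-Δ), ℚ(√-2Δ)}` for `Δ > 0` — exactly the crux-side exclusions, negatives `stmt-…-24881`).
Ingredients: §C `graph_dichotomy_of_fst_surjective`, §B `charGL_eq_of_det_eq`, `charGL_eq_general`. -/
theorem regular_lift_dichotomy {G : Type*} [Group G]
    (φ : G →* GL (Fin 2) (ZMod (2 ^ (M + 1)))) (hφ : Function.Surjective φ) (χ : G →* A)
    {τ : A} (hA : ∀ a : A, a = 1 ∨ a = τ) {g₀ : G} (hg₀ : χ g₀ = τ) :
    (∀ R : GL (Fin 2) (ZMod (2 ^ (M + 1))),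
        Matrix.GeneralLinearGroup.det R = Matrix.GeneralLinearGroup.det (φ g₀) → ∃ g : G, φ g = R ∧ χ g = τ) ∨
    (τ ≠ 1 ∧ ∃ ε : (ZMod (2 ^ (M + 1)))ˣ →* A, ∀ g : G,
        χ g = (if OddModTwoGL (φ g) then τ else 1) * ε (Matrix.GeneralLinearGroup.det (φ g))) := by
  set H : Subgroup (GL (Fin 2) (ZMod (2 ^ (M + 1))) × A) := (φ.prod χ).range with hH
  have hmem : ∀ g : G, (φ g, χ g) ∈ H := fun g ↦ MonoidHom.mem_range.mpr ⟨g, rfl⟩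
  have hfst : ∀ R : GL (Fin 2) (ZMod (2 ^ (M + 1))), ∃ c : A, (R, c) ∈ H := fun R ↦ by
    obtain ⟨g, rfl⟩ := hφ R
    exact ⟨χ g, hmem g⟩
  rcases graph_dichotomy_of_fst_surjective H hfst with ⟨c, hc1, hcH⟩ | ⟨ψ, hψ⟩
  · -- branch 1: `(1, τ) ∈ H` — every matrix lifts with either value of `χ`
    left
    intro R _
    obtain ⟨g₁, rfl⟩ := hφ R
    rcases hA (χ g₁) with h1 | h1
    · obtain ⟨g₂, hg₂⟩ := MonoidHom.mem_range.mp hcH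
      have hφ₂ : φ g₂ = 1 := (Prod.ext_iff.mp hg₂).1
      have hχ₂ : χ g₂ = c := (Prod.ext_iff.mp hg₂).2
      refine ⟨g₂ * g₁, by rw [map_mul, hφ₂, one_mul], ?_⟩
      rw [map_mul, hχ₂, h1, mul_one]
      exact (hA c).resolve_left hc1
    · exact ⟨g₁, rfl, h1⟩
  · -- branch 2: `H` is the graph of `ψ`, `χ = ψ ∘ φ`
    have hχ : ∀ g : G, χ g = ψ (φ g) := fun g ↦ (hψ (φ g) (χ g)).mp (hmem g)
    have h2 : ψ (Matrix.SpecialLinearGroup.toGL (uS M)) ^ 2 = 1 := sq_eq_one_of_two_valued hA _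
    by_cases hu : ψ (Matrix.SpecialLinearGroup.toGL (uS M)) = 1
    · left
      intro R hR
      obtain ⟨g₁, rfl⟩ := hφ R
      exact ⟨g₁, rfl, by rw [hχ, charGL_eq_of_det_eq ψ hu _ _ hR, ← hχ, hg₀]⟩
    · right
      have hψu : ψ (Matrix.SpecialLinearGroup.toGL (uS M)) = τ := (hA _).resolve_left hu
      refine ⟨fun h1 ↦ hu (hψu.trans h1), ψ.comp (diagHom M), fun g ↦ ?_⟩
      rw [hχ, charGL_eq_general ψ h2 (φ g), hψu, MonoidHom.comp_apply]

/-- The REGULAR involution `R = [[1,1],[0,-1]] ∈ GL₂(ℤ/2^{M+1})`: `det R = -1`, `R² = 1`, `R mod 2 = u` is a transposition;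
`(1 + R) E ∋ (1,0)ᵀ·(…)` and `(R - 1) E` both contain vectors of exact order `2^{M+1}` (R1/LKL: LOSSLESS). -/
def regR (M : ℕ) : GL (Fin 2) (ZMod (2 ^ (M + 1))) :=
  ⟨!![1, 1; 0, -1], !![1, 1; 0, -1],
    by rw [Matrix.mul_fin_two, Matrix.one_fin_two]; congr 1 <;> simp,
    by rw [Matrix.mul_fin_two, Matrix.one_fin_two]; congr 1 <;> simp⟩

theorem val_regR : ((regR M : GL (Fin 2) (ZMod (2 ^ (M + 1)))) : Matrix (Fin 2) (Fin 2) (ZMod (2 ^ (M + 1)))) =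
    !![1, 1; 0, -1] := rfl

theorem regR_mul_regR : regR M * regR M = 1 :=
  Units.ext (by rw [Units.val_mul, val_regR, Matrix.mul_fin_two, Units.val_one, Matrix.one_fin_two]; congr 1 <;> simp)

theorem det_regR : Matrix.GeneralLinearGroup.det (regR M) = -1 := by
  apply Units.ext
  rw [Matrix.GeneralLinearGroup.val_det_apply, val_regR, Matrix.det_fin_two_of, Units.val_neg, Units.val_one]
  ring

theorem oddModTwoGL_regR : OddModTwoGL (regR M) := by
  unfold OddModTwoGL
  refine ⟨?_, Or.inl ?_⟩
  · change π M ((1 : ZMod (2 ^ (M + 1))) + -1) = 0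
    rw [add_neg_cancel, map_zero]
  · change π M (1 : ZMod (2 ^ (M + 1))) ≠ 0
    rw [map_one]; exact one_ne_zero

/-- **E1c, usable form.**  In branch 1 of `regular_lift_dichotomy` with `det φ(g₀) = -1`: a lift `h` of the regular
involution with `χ h = τ` exists. -/
theorem exists_regular_lift {G : Type*} [Group G]
    (φ : G →* GL (Fin 2) (ZMod (2 ^ (M + 1)))) (χ : G →* A) {τ : A} {g₀ : G}
    (hdet : Matrix.GeneralLinearGroup.det (φ g₀) = -1)
    (h : ∀ R : GL (Fin 2) (ZMod (2 ^ (M + 1))),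
        Matrix.GeneralLinearGroup.det R = Matrix.GeneralLinearGroup.det (φ g₀) → ∃ g : G, φ g = R ∧ χ g = τ) :
    ∃ g : G, φ g = regR M ∧ χ g = τ :=
  h (regR M) (by rw [det_regR, hdet])

/-- In branch 2, evaluating at `g₀` itself: if `φ g₀ mod 2` is NOT a transposition (e.g. `Δ > 0`: `ρ̄₂(c₀) = 1`) then
`ε(det φ g₀) = τ ≠ 1` — the character `ε` is ODD (`ε(-1) = τ`), which is what pins `K` to `ℚ(√-Δ)`/`ℚ(√-2Δ)`. -/
theorem eps_det_eq_of_not_odd {G : Type*} [Group G]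
    (φ : G →* GL (Fin 2) (ZMod (2 ^ (M + 1)))) (χ : G →* A) {τ : A} {g₀ : G} (hg₀ : χ g₀ = τ)
    (ε : (ZMod (2 ^ (M + 1)))ˣ →* A)
    (hε : ∀ g : G, χ g = (if OddModTwoGL (φ g) then τ else 1) * ε (Matrix.GeneralLinearGroup.det (φ g)))
    (heven : ¬ OddModTwoGL (φ g₀)) : ε (Matrix.GeneralLinearGroup.det (φ g₀)) = τ := by
  have := hε g₀
  rw [hg₀, if_neg heven, one_mul] at this
  exact this.symm

end RegularLiftG

/-! ## §H  Step B for a REGULAR element (card E2, PROVED): McCallum's Galois element `ρ = ρ₀ · n` with a constant and the twisted involution `ρ₀⁻¹ ∘ τ` -/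

section StepBH

open scoped Classical
open WeierstrassCurve Field Finset
open Literature.NumberTheory.EllipticCurves
open Summit.BirchSwinnertonDyer.BirchSwinnertonDyer.Theorems.GenusExact


section StepBAlgebra

variable {T : Type*} [AddCommGroup T]

/-- **Step B targets for a regular element.**  `A` an additive involution of `T` (the action of `h₀` on
`E[n]`, transported), `P` with `2^M P = 0` and `P + A P` of "order `2^M`" (LOSSLESS: R1/LKL), the kernel condition
`ker(A - 1) = im(A + 1)` on each `T[2^e]`, `e ≤ M` (regularity), an involution `π` of the index set with exponents
`N i ≤ e i ≤ M`, `N (π i) = N i`, and CONSTANTS `κ i ∈ T[2^{e i}]` with `A κ(π i) = κ i` (the values `[c_i, k₀]`,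
`k₀ = h₀²|_{Γ_K}` — card E2 / §D).  Then there is `x : ι → T`, `2^{e i} x_i = 0`, with
`κ i + A x_{π i} + x_i` of order EXACTLY `2^{N i}` for every `i`.  (The tree's `exists_orders_of_tauStable` is the case
`κ = 0`, `A = τ`.) -/
theorem exists_orders_regular (A : T →+ T) (hA2 : ∀ t, A (A t) = t) {M : ℕ} {P : T}
    (hPM : (2 : ℤ) ^ M • P = 0) (hP1 : M ≠ 0 → (2 : ℤ) ^ (M - 1) • (P + A P) ≠ 0)
    (hker : ∀ (e : ℕ) (t : T), e ≤ M → (2 : ℤ) ^ e • t = 0 → A t = t →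
      ∃ y : T, (2 : ℤ) ^ e • y = 0 ∧ t = y + A y)
    {ι : Type*} [Fintype ι] (π : ι → ι) (hπ : ∀ i, π (π i) = i)
    (e N : ι → ℕ) (hNe : ∀ i, N i ≤ e i) (heM : ∀ i, e i ≤ M) (hNπ : ∀ i, N (π i) = N i)
    (κ : ι → T) (hκe : ∀ i, (2 : ℤ) ^ e i • κ i = 0) (hκA : ∀ i, A (κ (π i)) = κ i) :
    ∃ x : ι → T, (∀ i, (2 : ℤ) ^ e i • x i = 0) ∧
      ∀ i, (2 : ℤ) ^ N i • (κ i + A (x (π i)) + x i) = 0 ∧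
        (N i ≠ 0 → (2 : ℤ) ^ (N i - 1) • (κ i + A (x (π i)) + x i) ≠ 0) := by
  have hndvd : ∀ {M : ℕ}, M ≠ 0 → ¬ (2 : ℤ) ^ M ∣ (2 : ℤ) ^ (M - 1) := fun {M} hM h ↦ by
    have h1 : (2 : ℤ) ^ (M - 1) < (2 : ℤ) ^ M := pow_lt_pow_right₀ (by norm_num) (by omega)
    exact absurd (Int.le_of_dvd (by positivity) h) (not_le.mpr h1)
  have hAinj : Function.Injective A := fun s t h ↦ by rw [← hA2 s, h, hA2]
  have hAPM : (2 : ℤ) ^ M • A P = 0 := by rw [← map_zsmul, hPM, map_zero]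
  have hsumM : (2 : ℤ) ^ M • (P + A P) = 0 := by rw [smul_add, hPM, hAPM, add_zero]
  have hP1' : M ≠ 0 → (2 : ℤ) ^ (M - 1) • P ≠ 0 := fun hM h ↦ hP1 hM (by
    rw [smul_add, h, zero_add, ← map_zsmul, h, map_zero])
  have hAP1 : M ≠ 0 → (2 : ℤ) ^ (M - 1) • A P ≠ 0 := fun hM h ↦ hP1' hM (hAinj (by
    rw [map_zsmul, h, map_zero]))
  have hNM : ∀ i, N i ≤ M := fun i ↦ (hNe i).trans (heM i)
  -- the correcting elements at fixed points: `κ i = y i + A (y i)`, `2^{e i} y i = 0`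
  have hfixA : ∀ i, π i = i → A (κ i) = κ i := fun i h ↦ by
    have := hκA i; rwa [h] at this
  have hy : ∀ i, ∃ y : T, π i = i → (2 : ℤ) ^ e i • y = 0 ∧ κ i = y + A y := fun i ↦ by
    by_cases h : π i = i
    · obtain ⟨y, hy⟩ := hker (e i) (κ i) (heM i) (hκe i) (hfixA i h)
      exact ⟨y, fun _ ↦ hy⟩
    · exact ⟨0, fun h' ↦ absurd h' h⟩
  choose y hy using hy
  -- orbit representatives
  set enc : ι → ℕ := fun i ↦ (Fintype.equivFin ι i : ℕ) with henc
  have henc_inj : Function.Injective enc := fun i j h ↦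
    (Fintype.equivFin ι).injective (Fin.ext h)
  set x : ι → T := fun i ↦
    if π i = i then (2 : ℤ) ^ (M - N i) • P - y i
    else if enc i ≤ enc (π i) then (2 : ℤ) ^ (M - N i) • P - κ i else 0 with hx
  have hPe : ∀ i, (2 : ℤ) ^ e i • ((2 : ℤ) ^ (M - N i) • P) = 0 := fun i ↦ by
    rw [smul_smul, ← pow_add, show e i + (M - N i) = M + (e i - N i) by
      have := hNe i; have := heM i; omega, pow_add, mul_comm, mul_smul, hPM, smul_zero]
  refine ⟨x, fun i ↦ ?_, fun i ↦ ?_⟩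
  · by_cases hfix : π i = i
    · simp only [hx, hfix, if_true]
      rw [smul_sub, hPe, (hy i hfix).1, sub_zero]
    · by_cases h : enc i ≤ enc (π i)
      · simp only [hx, hfix, h, if_true, if_false]
        rw [smul_sub, hPe, hκe, sub_zero]
      · simp only [hx, hfix, h, if_false, smul_zero]
  · by_cases hfix : π i = i
    · -- fixed point: value `2^{M-N}(P + A P)`
      have hxi : x i = (2 : ℤ) ^ (M - N i) • P - y i := by simp only [hx, hfix, if_true]
      have hval : κ i + A (x (π i)) + x i = (2 : ℤ) ^ (M - N i) • (P + A P) := by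
        rw [hfix, hxi, (hy i hfix).2, map_sub, map_zsmul, smul_add]
        abel
      rw [hval]
      exact zsmul_pow_sub_order (hNM i) hsumM fun hN0 ↦ hP1 (by have := hNM i; omega)
    · have hfix' : ¬ π (π i) = π i := by rw [hπ]; exact fun h ↦ hfix h.symm
      by_cases h : enc i ≤ enc (π i)
      · -- representative: `x (π i) = 0`, value `2^{M-N} P`
        have hne : ¬ enc (π i) ≤ enc (π (π i)) := by
          rw [hπ]
          intro h'
          exact hfix (henc_inj (le_antisymm h' h))
        have hxπ : x (π i) = 0 := by simp only [hx, hfix', hne, if_false]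
        have hxi : x i = (2 : ℤ) ^ (M - N i) • P - κ i := by simp only [hx, hfix, h, if_true, if_false]
        have hval : κ i + A (x (π i)) + x i = (2 : ℤ) ^ (M - N i) • P := by
          rw [hxπ, hxi, map_zero, add_zero]
          abel
        rw [hval]
        exact zsmul_pow_sub_order (hNM i) hPM fun hN0 ↦ hP1' (by have := hNM i; omega)
      · -- `π i` is the representative: `x i = 0`, value `2^{M-N} A P` (using `κ (π i) … A κ`)
        have hle : enc (π i) ≤ enc (π (π i)) := by rw [hπ]; omega
        have hκ' : A (κ i) = κ (π i) := by
          have := hκA (π i); rwa [hπ] at this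
        have hxπ : x (π i) = (2 : ℤ) ^ (M - N i) • P - κ (π i) := by
          simp only [hx, hfix', hle, if_true, if_false, hNπ]
        have hxi : x i = 0 := by simp only [hx, hfix, h, if_false]
        have hval : κ i + A (x (π i)) + x i = (2 : ℤ) ^ (M - N i) • A P := by
          rw [hxπ, hxi, add_zero, map_sub, map_zsmul, hκA i]
          abel
        rw [hval]
        exact zsmul_pow_sub_order (hNM i) hAPM fun hN0 ↦ hAP1 (by have := hNM i; omega)

end StepBAlgebra

section StepBGalois

universe u v

variable {k : Type v} {K : Type u} [Field k] [Field K] [Algebra k K] (W : WeierstrassCurve k)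
variable {σ : K ≃ₐ[k] K} {τ : AlgebraicClosure K ≃+* AlgebraicClosure K}

/-- With `ρ₀^τ ρ₀ ∈ Γ_{K(E[n])}` the two transports of `h₀` to `E(K̄)[n]` agree: `ρ₀⁻¹ ∘ τ = τ ∘ ρ₀`
(`A = A⁻¹`). [folklore] -/
theorem inv_smul_torsionMap_eq_of_conjGal_mul_mem [W.IsElliptic] (hτ : IsLiftOfAut σ τ)
    (hinv : ∀ x, τ (τ x) = x) {n : ℤ} (ρ₀ : absoluteGaloisGroup K)
    (hk₀ : hτ.conjGalCMH ρ₀ * ρ₀ ∈ torsionFixing (W.baseChange K) n)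
    (s : geomTorsion (W.baseChange K) n) :
    ρ₀⁻¹ • hτ.torsionMap W n s = hτ.torsionMap W n (ρ₀ • s) := by
  have h1 : hτ.torsionMap W n (ρ₀ • s) = hτ.conjGalCMH ρ₀ • hτ.torsionMap W n s := by
    conv_lhs => rw [← hτ.conjGalCMH_conjGalCMH hinv ρ₀]
    rw [hτ.torsionMap_smul W n]
  have hmem : ρ₀ * hτ.conjGalCMH ρ₀ ∈ torsionFixing (W.baseChange K) n := by
    have := (torsionFixing_normal (W.baseChange K) n).conj_mem _ hk₀ ρ₀
    rwa [← mul_assoc, mul_inv_cancel_right] at this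
  rw [h1, inv_smul_eq_iff, smul_smul, smul_eq_of_mem_torsionFixing _ n hmem]

/-- **McCallum's Galois element at `2` for a REGULAR element (card E2, PROVED).**  As the tree's
`exists_h1Eval_conj_mul_order_tauStable` (the case `ρ₀ = 1`, `Δ < 0`), but searching `ρ = ρ₀ · n`, `n ∈ Γ_{K(E[n])}`, for a
FIXED `ρ₀ ∈ Γ_K` such that `k₀ := ρ₀^τ ρ₀ ∈ Γ_{K(E[n])}` (`h₀² = 1` on `E[n]`, `h₀ = c₀ · res ρ₀`); the involution `τ`
on `E[n]` is replaced by `A := ρ₀⁻¹ ∘ τ` (the action of `h₀`), the free pair `(P, τP)` by the LOSSLESS hypotheses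
`hP1` (`P + A P` of order `2^M`) and `hker` (`ker(A - 1) = im(A + 1)` on `T[2^e]`), and the values are
`[c_i, (ρ m)^τ (ρ m)] = [c_i, k₀] + A [c_{π i}, n] + [c_i, n]` (`§H exists_orders_regular` absorbs the constant).
Output: `n ∈ Γ_{K(E[n])}` with `ord [c_i, (ρ₀ n m)^τ (ρ₀ n m)] = 2^{N_i}` exactly for all `m ∈ 𝒩`, all `i` —
the hypothesis `hρ` of §F `exists_kolyvaginPrime_gt_two_of_galoisElement_regular` with `ρ := ρ₀ * n`.
[cite: McCallumLMS1991, §3 (2), Prop. 3.1, Cor. 3.2] [cite: GrossLMS1991, §9 Prop. 9.3] -/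
theorem exists_h1Eval_conj_mul_order_regular [W.IsElliptic] (hτ : IsLiftOfAut σ τ)
    (hinv : ∀ x, τ (τ x) = x) {n : ℤ} (h2n : (2 : ℤ) ∣ n) {M : ℕ}
    (hS : ∀ H : AddSubgroup (geomTorsion (W.baseChange K) 2),
      (∀ g : absoluteGaloisGroup K, ∀ t ∈ H, g • t ∈ H) → H = ⊥ ∨ H = ⊤)
    (hC : ∀ f : geomTorsion (W.baseChange K) 2 →+ geomTorsion (W.baseChange K) 2,
      (∀ (g : absoluteGaloisGroup K) (t : geomTorsion (W.baseChange K) 2), f (g • t) = g • f t) →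
        ∃ c : ℤ, ∀ t, f t = c • t)
    (ρ₀ : absoluteGaloisGroup K)
    (hk₀ : hτ.conjGalCMH ρ₀ * ρ₀ ∈ torsionFixing (W.baseChange K) n)
    {P : geomTorsion (W.baseChange K) n} (hPM : (2 : ℤ) ^ M • P = 0)
    (hP1 : M ≠ 0 → (2 : ℤ) ^ (M - 1) • (P + ρ₀⁻¹ • hτ.torsionMap W n P) ≠ 0)
    (hker : ∀ (e : ℕ) (t : geomTorsion (W.baseChange K) n), e ≤ M → (2 : ℤ) ^ e • t = 0 →
      ρ₀⁻¹ • hτ.torsionMap W n t = t →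
        ∃ y : geomTorsion (W.baseChange K) n, (2 : ℤ) ^ e • y = 0 ∧ t = y + ρ₀⁻¹ • hτ.torsionMap W n y)
    {ι : Type*} [Fintype ι] {xs : ι → galH1Torsion (W.baseChange K) n} {π : ι → ι}
    (hπ : ∀ i, π (π i) = i) (hxs : ∀ i, conjAct W σ n (xs i) = xs (π i))
    (e : ι → ℕ) (he : ∀ i, ((2 : ℤ) ^ e i) • xs i = 0)
    (hind : ∀ a : ι → ℤ, ∑ i, a i • xs i = 0 → ∀ i, ((2 : ℤ) ^ e i) ∣ a i)
    (hres : ∀ a : ι → ℤ, (∀ ρ ∈ torsionFixing (W.baseChange K) n,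
      h1Eval (W.baseChange K) n (∑ i, a i • xs i) ρ = 0) → ∑ i, a i • xs i = 0)
    (Nv : ι → ℕ) (hNe : ∀ i, Nv i ≤ e i) (heM : ∀ i, e i ≤ M) (hNπ : ∀ i, Nv (π i) = Nv i) :
    ∃ nn ∈ torsionFixing (W.baseChange K) n, ∀ m ∈ evalKer (W.baseChange K) n xs, ∀ i,
      ((2 : ℤ) ^ Nv i) • h1Eval (W.baseChange K) n (xs i)
          (hτ.conjGalCMH (ρ₀ * nn * m) * (ρ₀ * nn * m)) = 0 ∧
      (Nv i ≠ 0 →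
        ((2 : ℤ) ^ (Nv i - 1)) • h1Eval (W.baseChange K) n (xs i)
          (hτ.conjGalCMH (ρ₀ * nn * m) * (ρ₀ * nn * m)) ≠ 0) := by
  set TF := torsionFixing (W.baseChange K) n with hTF
  set k₀ := hτ.conjGalCMH ρ₀ * ρ₀ with hk₀def
  -- the involution `A = ρ₀⁻¹ ∘ τ` of `E[n]`
  have hτinv : ∀ s : geomTorsion (W.baseChange K) n,
      hτ.torsionMap W n (ρ₀⁻¹ • s) = (hτ.conjGalCMH ρ₀)⁻¹ • hτ.torsionMap W n s := fun s ↦ by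
    rw [← map_inv, ← hτ.torsionMap_smul W n, hτ.conjGalCMH_conjGalCMH hinv]
  set A : geomTorsion (W.baseChange K) n →+ geomTorsion (W.baseChange K) n :=
    { toFun := fun s ↦ ρ₀⁻¹ • hτ.torsionMap W n s
      map_zero' := by rw [map_zero, smul_zero]
      map_add' := fun s t ↦ by rw [map_add, smul_add] } with hAdef
  have hA : ∀ s, A s = ρ₀⁻¹ • hτ.torsionMap W n s := fun _ ↦ rfl
  have hA2 : ∀ t, A (A t) = t := fun t ↦ by
    rw [hA, hA, hτinv, hτ.torsionMap_torsionMap W hinv, smul_smul, ← mul_inv_rev,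
      smul_eq_of_mem_torsionFixing _ n (inv_mem hk₀)]
  -- the constants `κ i = [c_i, k₀]`
  set κ : ι → geomTorsion (W.baseChange K) n := fun i ↦ h1Eval (W.baseChange K) n (xs i) k₀ with hκdef
  have hκe : ∀ i, (2 : ℤ) ^ e i • κ i = 0 := fun i ↦ by
    rw [hκdef]
    simp only
    rw [← h1Eval_zsmul _ n _ _ hk₀, he i, h1Eval_zero _ n hk₀]
  have hconjk₀ : hτ.conjGalCMH k₀ = ρ₀ * k₀ * ρ₀⁻¹ := by
    rw [hk₀def, map_mul, hτ.conjGalCMH_conjGalCMH hinv, mul_assoc, mul_inv_cancel_right]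
  have hκA : ∀ i, A (κ (π i)) = κ i := fun i ↦ by
    rw [hA, hκdef]
    simp only
    rw [← hxs i, hτ.h1Eval_conjAct W n (xs i) hk₀, hconjk₀, h1Eval_conj _ n _ ρ₀ hk₀,
      hτ.torsionMap_torsionMap W hinv, inv_smul_smul]
  -- the targets (§H algebra) and their realisation as `([c_i, nn])_i` (Gross 9.3 / McCallum (2))
  obtain ⟨x, hxe, hx⟩ := exists_orders_regular A hA2 hPM hP1 hker π hπ e Nv hNe heM hNπ κ hκe hκA
  obtain ⟨nn, hnn, hnne⟩ := exists_h1Eval_eq_of_indep_of_res (W.baseChange K) Nat.prime_two h2n hS hC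
    xs e he hind hres x hxe
  refine ⟨nn, hnn, fun m hm i ↦ ?_⟩
  have hnm : nn * m ∈ TF := mul_mem hnn hm.1
  have hconj_nm : hτ.conjGalCMH (nn * m) ∈ TF := hτ.conjGalCMH_mem_torsionFixing W hinv _ hnm
  have hY : ρ₀⁻¹ * hτ.conjGalCMH (nn * m) * ρ₀⁻¹⁻¹ ∈ TF := (torsionFixing_normal _ n).conj_mem _ hconj_nm ρ₀⁻¹
  have hdecomp : hτ.conjGalCMH (ρ₀ * nn * m) * (ρ₀ * nn * m) =
      k₀ * ((ρ₀⁻¹ * hτ.conjGalCMH (nn * m) * ρ₀⁻¹⁻¹) * (nn * m)) := by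
    rw [hk₀def, mul_assoc ρ₀ nn m, map_mul]
    group
  have hval : h1Eval (W.baseChange K) n (xs i) (hτ.conjGalCMH (ρ₀ * nn * m) * (ρ₀ * nn * m)) =
      κ i + A (x (π i)) + x i := by
    rw [hdecomp, h1Eval_mul _ _ _ hk₀, h1Eval_mul _ _ _ hY, h1Eval_conj _ n _ ρ₀⁻¹ hconj_nm,
      h1Eval_conjGalCMH_of_tauStable W hτ hinv n hxs hnm, h1Eval_mul _ _ _ hnn, h1Eval_mul _ _ _ hnn,
      hnne i, hnne (π i), hm.2 i, hm.2 (π i), add_zero, add_zero, hA, add_assoc]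
  rw [hval]
  exact hx i

end StepBGalois

section StepBRat

open scoped Pointwise
open NumberField Literature.NumberTheory.GaloisRepresentations Literature.NumberTheory

universe u

variable {W : WeierstrassCurve ℚ} {K : Type u} [Field K] [NumberField K]

/-- ℚ-side `h₀² = 1` on `E(ℚ̄)[n]` (`h₀ = c₀ · res ρ`) ⇒ K-side `ρ^τ ρ ∈ Γ_{K(E[n])}` (hypothesis `hk₀` of
`exists_h1Eval_conj_mul_order_regular`; transport along `E(ℚ̄)[n] ≃ E(K̄)[n]` and
`(c₀ res ρ)² = res (ρ^τ ρ)`). [folklore] [cite: GrossLMS1991, §3] -/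
theorem conjGal_mul_mem_torsionFixing_of_smul_smul {c₀ : absoluteGaloisGroup ℚ}
    (hc₀ : IsComplexConjugation (Rat.castHom ℝ) c₀) {c : K ≃ₐ[ℚ] K}
    (ht : IsLiftOfAut c (absGaloisTransport (K := ℚ) (L := K) c₀).toRingEquiv) {n : ℤ}
    (ρ : absoluteGaloisGroup K)
    (hsq : ∀ P : geomTorsion W n,
      (c₀ * absGaloisRestrict ℚ K ρ) • (c₀ * absGaloisRestrict ℚ K ρ) • P = P) :
    ht.conjGalCMH ρ * ρ ∈ torsionFixing (W.baseChange K) n := by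
  refine (mem_torsionFixing_iff _ _).mpr fun Q ↦ ?_
  obtain ⟨P, rfl⟩ := (RatClosure.torsionEquiv (K := K) W n).surjective Q
  rw [← RatClosure.torsionEquiv_smul, ← sq_eq_absGaloisRestrict_conjGal_mul hc₀ ht ρ, pow_two,
    mul_smul, hsq]

/-- Right-multiplying `ρ` by an element of `Γ_{K(E[n])}` does not change the action of `c₀ · res ρ` on `E(ℚ̄)[n]`.
[folklore] -/
theorem mul_absGaloisRestrict_mul_smul_eq {n : ℤ} (c₀ : absoluteGaloisGroup ℚ)
    {ρ nn : absoluteGaloisGroup K} (hnn : nn ∈ torsionFixing (W.baseChange K) n)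
    (P : geomTorsion W n) :
    (c₀ * absGaloisRestrict ℚ K (ρ * nn)) • P = (c₀ * absGaloisRestrict ℚ K ρ) • P := by
  rw [map_mul, ← mul_assoc, mul_smul (c₀ * _), absGaloisRestrict_smul_eq_of_mem_torsionFixing W hnn]

/-- **Step B for a REGULAR element, ℚ-side packaging (card E2, PROVED).**  `K` imaginary quadratic, `c₀` a
complex conjugation with transport `t = e c₀ e⁻¹` lifting `c ≠ 1`, `n = 2^M`; `ρ₀ ∈ Γ_K` with `h₀ := c₀ · res ρ₀`
satisfying, on `E(ℚ̄)[2^M]`: `h₀² = 1` (`hsq`), a point `P` with `P + h₀ P` of order `2^M` (`hP1`, LOSSLESS), and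
`ker(h₀ - 1) = im(h₀ + 1)` on each `E[2^e]`, `e ≤ M` (`hker`, regularity; both are R1/LKL of the lead's
`…RegularFilterAlgebra`).  Then for `t`-stable classes `cs` (as in the tree chain) there is `ρ ∈ Γ_K` with the SAME
action `c₀ · res ρ = h₀` on `E(ℚ̄)[2^M]` (so `hsq`, and `hμ` of §F, transfer verbatim from `ρ₀`) and exact orders
`ord [c_i, (ρ m)^t (ρ m)] = 2^{N_i}` for all `m ∈ 𝒩` — precisely the hypothesis `hρ` of §F
`exists_kolyvaginPrime_gt_two_of_galoisElement_regular`.  [cite: McCallumLMS1991, §3 (2), Prop. 3.1]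
[cite: GrossLMS1991, §9 Prop. 9.3] -/
theorem exists_galoisElement_regular_rat [W.IsElliptic] (hK : IsImaginaryQuadratic K) {M : ℕ}
    (hM : 1 ≤ M) {c₀ : absoluteGaloisGroup ℚ} (hc₀ : IsComplexConjugation (Rat.castHom ℝ) c₀)
    {c : K ≃ₐ[ℚ] K} (hc : c ≠ 1)
    (hS : ∀ H : AddSubgroup (geomTorsion (W.baseChange K) 2),
      (∀ g : absoluteGaloisGroup K, ∀ t ∈ H, g • t ∈ H) → H = ⊥ ∨ H = ⊤)
    (hC : ∀ f : geomTorsion (W.baseChange K) 2 →+ geomTorsion (W.baseChange K) 2,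
      (∀ (g : absoluteGaloisGroup K) (t : geomTorsion (W.baseChange K) 2), f (g • t) = g • f t) →
        ∃ c : ℤ, ∀ t, f t = c • t)
    (ρ₀ : absoluteGaloisGroup K)
    (hsq : ∀ X : geomTorsion W ((2 ^ M : ℕ) : ℤ),
      (c₀ * absGaloisRestrict ℚ K ρ₀) • (c₀ * absGaloisRestrict ℚ K ρ₀) • X = X)
    {P : geomTorsion W ((2 ^ M : ℕ) : ℤ)}
    (hP1 : M ≠ 0 → (2 : ℤ) ^ (M - 1) • (P + (c₀ * absGaloisRestrict ℚ K ρ₀) • P) ≠ 0)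
    (hker : ∀ (e : ℕ) (X : geomTorsion W ((2 ^ M : ℕ) : ℤ)), e ≤ M → (2 : ℤ) ^ e • X = 0 →
      (c₀ * absGaloisRestrict ℚ K ρ₀) • X = X →
        ∃ Y : geomTorsion W ((2 ^ M : ℕ) : ℤ), (2 : ℤ) ^ e • Y = 0 ∧
          X = Y + (c₀ * absGaloisRestrict ℚ K ρ₀) • Y)
    {ι : Type*} [Fintype ι] {cs : ι → galH1Torsion (W.baseChange K) ((2 ^ M : ℕ) : ℤ)} {π : ι → ι}
    (hπ : ∀ i, π (π i) = i) (hcs : ∀ i, conjAct W c ((2 ^ M : ℕ) : ℤ) (cs i) = cs (π i))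
    (e : ι → ℕ) (he : ∀ i, ((2 : ℤ) ^ e i) • cs i = 0)
    (hind : ∀ a : ι → ℤ, ∑ i, a i • cs i = 0 → ∀ i, ((2 : ℤ) ^ e i) ∣ a i)
    (hres : ∀ a : ι → ℤ, (∀ ρ ∈ torsionFixing (W.baseChange K) ((2 ^ M : ℕ) : ℤ),
      h1Eval (W.baseChange K) ((2 ^ M : ℕ) : ℤ) (∑ i, a i • cs i) ρ = 0) → ∑ i, a i • cs i = 0)
    (Nv : ι → ℕ) (hNe : ∀ i, Nv i ≤ e i) (heM : ∀ i, e i ≤ M) (hNπ : ∀ i, Nv (π i) = Nv i) :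
    ∃ ρ : absoluteGaloisGroup K,
      (∀ X : geomTorsion W ((2 ^ M : ℕ) : ℤ),
        (c₀ * absGaloisRestrict ℚ K ρ) • X = (c₀ * absGaloisRestrict ℚ K ρ₀) • X) ∧
      (∀ X : geomTorsion W ((2 ^ M : ℕ) : ℤ),
        (c₀ * absGaloisRestrict ℚ K ρ) • (c₀ * absGaloisRestrict ℚ K ρ) • X = X) ∧
      ∀ m ∈ evalKer (W.baseChange K) ((2 ^ M : ℕ) : ℤ) cs, ∀ i,
        ((2 : ℤ) ^ Nv i) • h1Eval (W.baseChange K) ((2 ^ M : ℕ) : ℤ) (cs i)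
            ((RatClosure.isLiftOfAut_absGaloisTransport_of_isImaginaryQuadratic hK hc hc₀).conjGalCMH
              (ρ * m) * (ρ * m)) = 0 ∧
          (Nv i ≠ 0 → ((2 : ℤ) ^ (Nv i - 1)) • h1Eval (W.baseChange K) ((2 ^ M : ℕ) : ℤ) (cs i)
            ((RatClosure.isLiftOfAut_absGaloisTransport_of_isImaginaryQuadratic hK hc hc₀).conjGalCMH
              (ρ * m) * (ρ * m)) ≠ 0) := by
  classical
  have h2n : (2 : ℤ) ∣ ((2 ^ M : ℕ) : ℤ) := by
    rw [Nat.cast_pow]; exact dvd_pow_self _ (by omega)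
  set t : AlgebraicClosure K ≃+* AlgebraicClosure K :=
    (absGaloisTransport (K := ℚ) (L := K) c₀).toRingEquiv with ht_def
  have ht : IsLiftOfAut c t :=
    RatClosure.isLiftOfAut_absGaloisTransport_of_isImaginaryQuadratic hK hc hc₀
  have hinv : ∀ x, t (t x) = x := fun x ↦
    RatClosure.absGaloisTransport_absGaloisTransport_of_sq_eq_one hc₀.sq_eq_one x
  have hk₀ : ht.conjGalCMH ρ₀ * ρ₀ ∈ torsionFixing (W.baseChange K) ((2 ^ M : ℕ) : ℤ) :=
    conjGal_mul_mem_torsionFixing_of_smul_smul hc₀ ht ρ₀ hsq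
  set eq := RatClosure.torsionEquiv (K := K) W ((2 ^ M : ℕ) : ℤ) with heq
  -- the transport of `h₀`: `eq (h₀ X) = τ (ρ₀ • eq X) = ρ₀⁻¹ • τ (eq X)`
  have hB : ∀ X : geomTorsion W ((2 ^ M : ℕ) : ℤ), eq ((c₀ * absGaloisRestrict ℚ K ρ₀) • X) =
      ρ₀⁻¹ • ht.torsionMap W ((2 ^ M : ℕ) : ℤ) (eq X) := fun X ↦ by
    rw [mul_smul, heq, RatClosure.torsionEquiv_smul_of_lift W ht c₀ (fun _ ↦ rfl),
      RatClosure.torsionEquiv_smul, inv_smul_torsionMap_eq_of_conjGal_mul_mem W ht hinv ρ₀ hk₀]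
  have hT : ∀ Q : geomTorsion (W.baseChange K) ((2 ^ M : ℕ) : ℤ), (2 : ℤ) ^ M • Q = 0 := fun Q ↦ by
    have h := (mem_geomTorsion_iff _ ((2 ^ M : ℕ) : ℤ) _).mp Q.2
    have hc : (2 : ℤ) ^ M = ((2 ^ M : ℕ) : ℤ) := by push_cast; rfl
    apply Subtype.ext
    rw [AddSubgroupClass.coe_zsmul, ZeroMemClass.coe_zero, hc]
    exact h
  have hPM : (2 : ℤ) ^ M • eq P = 0 := hT _
  have hP1' : M ≠ 0 →
      (2 : ℤ) ^ (M - 1) • (eq P + ρ₀⁻¹ • ht.torsionMap W ((2 ^ M : ℕ) : ℤ) (eq P)) ≠ 0 := by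
    intro hM0 h
    rw [← hB, ← map_add, ← map_zsmul, map_eq_zero_iff _ eq.injective] at h
    exact hP1 hM0 h
  have hker' : ∀ (d : ℕ) (s : geomTorsion (W.baseChange K) ((2 ^ M : ℕ) : ℤ)), d ≤ M →
      (2 : ℤ) ^ d • s = 0 → ρ₀⁻¹ • ht.torsionMap W ((2 ^ M : ℕ) : ℤ) s = s →
        ∃ y : geomTorsion (W.baseChange K) ((2 ^ M : ℕ) : ℤ), (2 : ℤ) ^ d • y = 0 ∧
          s = y + ρ₀⁻¹ • ht.torsionMap W ((2 ^ M : ℕ) : ℤ) y := by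
    intro d s hd hds hfix
    obtain ⟨X, rfl⟩ := eq.surjective s
    rw [← hB, eq.injective.eq_iff] at hfix
    rw [← map_zsmul, map_eq_zero_iff _ eq.injective] at hds
    obtain ⟨Y, hY, hXY⟩ := hker d X hd hds hfix
    refine ⟨eq Y, by rw [← map_zsmul, hY, map_zero], ?_⟩
    rw [← hB, ← map_add, ← hXY]
  obtain ⟨nn, hnn, H⟩ := exists_h1Eval_conj_mul_order_regular W ht hinv h2n hS hC ρ₀ hk₀ hPM hP1'
    hker' hπ hcs e he hind hres Nv hNe heM hNπ
  refine ⟨ρ₀ * nn, fun X ↦ mul_absGaloisRestrict_mul_smul_eq c₀ hnn X, fun X ↦ ?_, H⟩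
  rw [mul_absGaloisRestrict_mul_smul_eq c₀ hnn, mul_absGaloisRestrict_mul_smul_eq c₀ hnn, hsq]

end StepBRat

end StepBH

/-! ## §I  Regular supply by RAMIFIED INERTIA (card E1c′, PROVED): `(1, τ) ∈ G` for every Heegner field with an odd ramified prime

(`K : Type` in universe `0`, as in the skeleton's stubs `∀ (K : Type) [Field K] [NumberField K], IsImaginaryQuadratic K → Odd (NumberField.discr K) → …`
and as required by the tree's `exists_mem_inertia_not_mem_range`.) -/

section RegularSupplyI

open scoped Pointwise
open WeierstrassCurve NumberField IsDedekindDomain Field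
open Literature.NumberTheory.GaloisRepresentations Literature.NumberTheory.EllipticCurves Literature.NumberTheory

variable {W : WeierstrassCurve ℚ} {K : Type} [Field K] [NumberField K]

/-- Group lemma: if `φ : G ↠ H` kills some `g ∉ U`, every `R : H` lifts OUTSIDE `U`. [folklore] -/
theorem exists_apply_eq_and_not_mem {G H : Type*} [Group G] [Group H] (φ : G →* H)
    (hφ : Function.Surjective φ) (U : Subgroup G) {g : G} (hgU : g ∉ U) (hg : φ g = 1) (R : H) :
    ∃ h : G, φ h = R ∧ h ∉ U := by
  obtain ⟨h₁, rfl⟩ := hφ R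
  by_cases h₁U : h₁ ∈ U
  · refine ⟨h₁ * g, by rw [map_mul, hg, mul_one], fun hmem ↦ hgU ?_⟩
    have := U.mul_mem (U.inv_mem h₁U) hmem
    rwa [inv_mul_cancel_left] at this
  · exact ⟨h₁, rfl, h₁U⟩

/-- **E1c′ (inertia).**  At a place `v` of GOOD reduction of `E/ℚ` with `n ∉ v` under which `K` has a UNIQUE prime `w` of residue
degree `1` (for `[K:ℚ] = 2`: `v` ramifies in `K`), some `g ∈ Γ_ℚ` acts TRIVIALLY on `E(ℚ̄)[n]` (inertia at good `v ∤ n`,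
`smul_geomTorsion_eq_of_mem_inertia`, AEC VII.4.1) and restricts NON-trivially to `K` (`exists_mem_inertia_not_mem_range`,
Neukirch I.§9).  In the language of §C/§G: the graph group `G ≤ Aut(E[n]) × Gal(K/ℚ)` contains `(1, τ)`, so §C's dichotomy is
decided WITHOUT the character classification of §B/§G. [cite: SilvermanAEC2009, VII.4.1] [cite: NeukirchANT1999, I.§9] -/
theorem exists_smul_torsion_eq_self_and_not_mem_range [W.IsElliptic] {n : ℤ}
    {v : HeightOneSpectrum (𝓞 ℚ)} (hgood : W.HasGoodReductionAt v) (hn : (n : 𝓞 ℚ) ∉ v.asIdeal)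
    {w : HeightOneSpectrum (𝓞 K)} (hw : w.asIdeal.under (𝓞 ℚ) = v.asIdeal)
    (huniq : ∀ w' : HeightOneSpectrum (𝓞 K), w'.asIdeal.under (𝓞 ℚ) = v.asIdeal → w' = w)
    (hf : w.asIdeal.inertiaDeg (𝓞 ℚ) = 1) (hH : (absGaloisRestrict ℚ K).range ≠ ⊤) :
    ∃ g : absoluteGaloisGroup ℚ, g ∉ (absGaloisRestrict ℚ K).range ∧
      ∀ P : geomTorsion W n, g • P = P := by
  classical
  obtain ⟨𝔔, h𝔔⟩ := HeightOneSpectrum.primesAbove_nonempty w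
  have h𝔓 := comap_absIntegersMap_mem_primesAbove hw h𝔔
  obtain ⟨g, hgI, hgU⟩ := exists_mem_inertia_not_mem_range (F := ℚ) (M := K) hw huniq h𝔔 hf hH
  exact ⟨g, hgU, fun P ↦ W.smul_geomTorsion_eq_of_mem_inertia hgood hn h𝔓 hgI P⟩

/-- **E1c′ (regular supply).**  With the mod-`n` representation SURJECTIVE onto `Aut(E(ℚ̄)[n])` (the crux's full-2-adic-image
binder at `n = 2^{M+1}`) and a ramified good place as above, EVERY additive automorphism `A` of `E(ℚ̄)[n]` — in particular the
regular involution `[[1,1],[0,-1]]` of any basis — is the action of some `h₀ ∈ Γ_ℚ` restricting NON-trivially to `K`. [folklore] -/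
theorem exists_smul_eq_addAut_and_not_mem_range [W.IsElliptic] {n : ℤ} (hsurj : W.HasSurjectiveModNGaloisRep n)
    {v : HeightOneSpectrum (𝓞 ℚ)} (hgood : W.HasGoodReductionAt v) (hn : (n : 𝓞 ℚ) ∉ v.asIdeal)
    {w : HeightOneSpectrum (𝓞 K)} (hw : w.asIdeal.under (𝓞 ℚ) = v.asIdeal)
    (huniq : ∀ w' : HeightOneSpectrum (𝓞 K), w'.asIdeal.under (𝓞 ℚ) = v.asIdeal → w' = w)
    (hf : w.asIdeal.inertiaDeg (𝓞 ℚ) = 1) (hH : (absGaloisRestrict ℚ K).range ≠ ⊤)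
    (A : AddAut (geomTorsion W n)) :
    ∃ h₀ : absoluteGaloisGroup ℚ, h₀ ∉ (absGaloisRestrict ℚ K).range ∧
      ∀ P : geomTorsion W n, h₀ • P = A P := by
  obtain ⟨g, hgU, hg⟩ := exists_smul_torsion_eq_self_and_not_mem_range hgood hn hw huniq hf hH
  have hg1 : galoisRepTorsion W n g = 1 :=
    Multiplicative.toAdd.injective (AddEquiv.ext fun P ↦ by rw [galoisRepTorsion_apply]; exact hg P)
  obtain ⟨h₀, hh₀, hU⟩ :=
    exists_apply_eq_and_not_mem (galoisRepTorsion W n) hsurj _ hgU hg1 (Multiplicative.ofAdd A)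
  refine ⟨h₀, hU, fun P ↦ ?_⟩
  rw [← galoisRepTorsion_apply, hh₀]
  rfl

/-- Index two: two elements outside `Γ_K ≤ Γ_ℚ` differ by an element of `Γ_K` — `h₀ = c₀ · res ρ₀`. [folklore] -/
theorem exists_eq_mul_absGaloisRestrict (hK2 : Module.finrank ℚ K = 2) {c₀ h₀ : absoluteGaloisGroup ℚ}
    (hc₀ : c₀ ∉ (absGaloisRestrict ℚ K).range) (hh₀ : h₀ ∉ (absGaloisRestrict ℚ K).range) :
    ∃ ρ₀ : absoluteGaloisGroup K, h₀ = c₀ * absGaloisRestrict ℚ K ρ₀ := by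
  have hidx : (absGaloisRestrict ℚ K).range.index = 2 :=
    (index_range_absGaloisRestrict_eq_finrank ℚ K).trans hK2
  have hmem : c₀⁻¹ * h₀ ∈ (absGaloisRestrict ℚ K).range := by
    rw [Subgroup.mul_mem_iff_of_index_two hidx, Subgroup.inv_mem_iff]
    exact ⟨fun h ↦ absurd h hc₀, fun h ↦ absurd h hh₀⟩
  obtain ⟨ρ₀, hρ₀⟩ := hmem
  refine ⟨ρ₀, ?_⟩
  change absGaloisRestrict ℚ K ρ₀ = c₀⁻¹ * h₀ at hρ₀
  rw [hρ₀, mul_inv_cancel_left]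

/-- **E1c′ assembled for an imaginary quadratic `K`:** with complex conjugation `c₀`, surjectivity of `ρ_{E,n}` and a good place
`v ∤ n` ramified in `K`, every `A ∈ Aut(E(ℚ̄)[n])` is the action of `h₀ = c₀ · res ρ₀` for some `ρ₀ ∈ Γ_K` — the input `ρ₀` of
§H `exists_galoisElement_regular_rat` (take `n = 2^{M+1}` or `2^M` and `A` regular). [folklore] -/
theorem exists_mul_absGaloisRestrict_smul_eq_addAut [W.IsElliptic] (hK : IsImaginaryQuadratic K)
    {c₀ : absoluteGaloisGroup ℚ} (hc₀ : IsComplexConjugation (Rat.castHom ℝ) c₀)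
    {n : ℤ} (hsurj : W.HasSurjectiveModNGaloisRep n)
    {v : HeightOneSpectrum (𝓞 ℚ)} (hgood : W.HasGoodReductionAt v) (hn : (n : 𝓞 ℚ) ∉ v.asIdeal)
    {w : HeightOneSpectrum (𝓞 K)} (hw : w.asIdeal.under (𝓞 ℚ) = v.asIdeal)
    (huniq : ∀ w' : HeightOneSpectrum (𝓞 K), w'.asIdeal.under (𝓞 ℚ) = v.asIdeal → w' = w)
    (hf : w.asIdeal.inertiaDeg (𝓞 ℚ) = 1) (A : AddAut (geomTorsion W n)) :
    ∃ ρ₀ : absoluteGaloisGroup K, ∀ P : geomTorsion W n, (c₀ * absGaloisRestrict ℚ K ρ₀) • P = A P := by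
  haveI : IsTotallyComplex K := hK.2
  have hc₀U : c₀ ∉ (absGaloisRestrict ℚ K).range :=
    hc₀.not_mem_range_absGaloisRestrict (L := K) IsTotallyComplex.isComplex
  have hH : (absGaloisRestrict ℚ K).range ≠ ⊤ := fun h ↦ hc₀U (h ▸ Subgroup.mem_top c₀)
  obtain ⟨h₀, hh₀U, hh₀⟩ := exists_smul_eq_addAut_and_not_mem_range hsurj hgood hn hw huniq hf hH A
  obtain ⟨ρ₀, rfl⟩ := exists_eq_mul_absGaloisRestrict hK.1 hc₀U hh₀U
  exact ⟨ρ₀, hh₀⟩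

end RegularSupplyI

/-! ## §I′  Regular supply from a RAMIFIED prime of `K` — discriminant form, via the tree's
`ShimuraKolyvaginImageDisjoint.exists_absGaloisRestrict_smul_eq` (Gross 1991 §9: `ρ̄_{E,n}(res Γ_K) = ρ̄_{E,n}(Γ_ℚ)`). -/

section RegularSupplyI2

open WeierstrassCurve NumberField IsDedekindDomain Field
open Literature.NumberTheory.GaloisRepresentations Literature.NumberTheory.EllipticCurves Literature.NumberTheory
open Summit.BirchSwinnertonDyer.BirchSwinnertonDyer.Theorems

universe u

variable {W : WeierstrassCurve ℚ} {K : Type u} [Field K] [NumberField K]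

/-- **E1c′ (discriminant form).**  `[K:ℚ] = 2`, a prime `q ∣ d_K` with `q ∤ N_E`, `q ∤ n`, and `ρ̄_{E,n}` SURJECTIVE onto
`Aut(E(ℚ̄)[n])`: for ANY `c₀ ∈ Γ_ℚ` and ANY additive automorphism `A` of `E(ℚ̄)[n]` some `ρ₀ ∈ Γ_K` has
`c₀ · res ρ₀` acting as `A` — because `ρ̄(res Γ_K) = ρ̄(Γ_ℚ)` (tree `ShimuraKolyvaginImageDisjoint.exists_absGaloisRestrict_smul_eq`,
applied to `c₀⁻¹ γ₁` with `ρ̄(γ₁) = A`).  No hypothesis on `c₀`. [cite: GrossLMS1991, §9 (PDF p. 227, before Prop. 9.1)] -/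
theorem exists_mul_absGaloisRestrict_smul_eq_addAut_of_dvd_discr [W.IsElliptic]
    (hK2 : Module.finrank ℚ K = 2) {q : ℕ} (hq : q.Prime) (hqd : (q : ℤ) ∣ NumberField.discr K)
    (hqN : ¬ q ∣ W.conductorNorm ℤ) {n : ℤ} (hqn : ¬ (q : ℤ) ∣ n)
    (hsurj : W.HasSurjectiveModNGaloisRep n) (c₀ : absoluteGaloisGroup ℚ)
    (A : AddAut (geomTorsion W n)) :
    ∃ ρ₀ : absoluteGaloisGroup K, ∀ P : geomTorsion W n,
      (c₀ * absGaloisRestrict ℚ K ρ₀) • P = A P := by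
  obtain ⟨γ₁, hγ₁⟩ := hsurj (Multiplicative.ofAdd A)
  obtain ⟨g, hg⟩ := ShimuraKolyvaginImageDisjoint.exists_absGaloisRestrict_smul_eq W K hK2 hq hqd
    hqN hqn (c₀⁻¹ * γ₁)
  refine ⟨g, fun P ↦ ?_⟩
  rw [mul_smul, hg, ← mul_smul, mul_inv_cancel_left, ← galoisRepTorsion_apply, hγ₁]
  rfl

/-- **E1c′ in the skeleton's vocabulary.**  For `K` imaginary quadratic with `d_K` DOOR-ADMISSIBLE for `E` (so `d_K ≡ 1 (mod 8)` is
odd and `E` has good reduction at every prime `q ∣ d_K`) and `ρ̄_{E,2^k}` surjective, EVERY additive automorphism of `E(ℚ̄)[2^k]`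
is the action of `c₀ · res ρ₀` for some `ρ₀ ∈ Γ_K` — for ANY `c₀ ∈ Γ_ℚ` (in the engine: complex conjugation).  Some prime
divides `d_K` (Minkowski, tree `exists_prime_dvd_discr`); it is odd, hence prime to `2^k`, and of good reduction, hence prime
to `N_E` (`dvd_conductorNorm_iff_not_hasGoodReductionAtPrime`). [cite: GrossLMS1991, §9 (PDF p. 227, before Prop. 9.1)] -/
theorem exists_mul_absGaloisRestrict_smul_eq_addAut_of_doorAdmissible [W.IsElliptic] [W.IsGloballyMinimal]
    (hK : IsImaginaryQuadratic K) (hD : RankOneAtTwoOneDoor.DoorAdmissible W (NumberField.discr K))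
    {k : ℕ} (hsurj : W.HasSurjectiveModNGaloisRep ((2 ^ k : ℕ) : ℤ)) (c₀ : absoluteGaloisGroup ℚ)
    (A : AddAut (geomTorsion W ((2 ^ k : ℕ) : ℤ))) :
    ∃ ρ₀ : absoluteGaloisGroup K, ∀ P : geomTorsion W ((2 ^ k : ℕ) : ℤ),
      (c₀ * absGaloisRestrict ℚ K ρ₀) • P = A P := by
  have hK2 : Module.finrank ℚ K = 2 := hK.1
  obtain ⟨q, hq, hqd⟩ := ShimuraKolyvaginImageDisjoint.exists_prime_dvd_discr K (by omega)
  obtain ⟨-, -, h8, hgoodAll, -⟩ := hD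
  haveI : Fact q.Prime := ⟨hq⟩
  have hgood : W.HasGoodReductionAtPrime q := hgoodAll q hq hqd ⟨hq⟩
  have hqN : ¬ q ∣ W.conductorNorm ℤ := fun h ↦
    (W.dvd_conductorNorm_iff_not_hasGoodReductionAtPrime q).mp h hgood
  have hq2 : q ≠ 2 := by
    rintro rfl
    have h2 : (2 : ℤ) ∣ NumberField.discr K := by exact_mod_cast hqd
    omega
  have hqn : ¬ (q : ℤ) ∣ ((2 ^ k : ℕ) : ℤ) := by
    intro h
    have h' : q ∣ 2 ^ k := by exact_mod_cast h
    exact hq2 ((Nat.prime_dvd_prime_iff_eq hq Nat.prime_two).mp (hq.dvd_of_dvd_pow h'))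
  exact exists_mul_absGaloisRestrict_smul_eq_addAut_of_dvd_discr hK2 hq hqd hqN hqn hsurj c₀ A

/-- **E1c′ for the big-image stubs S3/S4/S5** (binders `IsImaginaryQuadratic K`, `Odd d_K`, `SatisfiesHeegnerHypothesis N_E K`, `ρ̄_{E,2^k}` onto):
every additive automorphism of `E(ℚ̄)[2^k]` is the action of `c₀ · res ρ₀`, `ρ₀ ∈ Γ_K`, for ANY `c₀`.  The ramified prime: some `q ∣ d_K`
(Minkowski); `q ∤ N_E` because the primes of `N_E` split (Heegner) while `q` ramifies (tree `ShimuraKolyvaginImageInputs.exists_prime_dvd_discr_not_dvd`);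
`q` odd because `d_K` is. [cite: GrossLMS1991, §9 (PDF p. 227, before Prop. 9.1)] -/
theorem exists_mul_absGaloisRestrict_smul_eq_addAut_of_heegner [W.IsElliptic]
    (hK : IsImaginaryQuadratic K) (hodd : Odd (NumberField.discr K))
    (hH : SatisfiesHeegnerHypothesis (W.conductorNorm ℤ) K)
    {k : ℕ} (hsurj : W.HasSurjectiveModNGaloisRep ((2 ^ k : ℕ) : ℤ)) (c₀ : absoluteGaloisGroup ℚ)
    (A : AddAut (geomTorsion W ((2 ^ k : ℕ) : ℤ))) :
    ∃ ρ₀ : absoluteGaloisGroup K, ∀ P : geomTorsion W ((2 ^ k : ℕ) : ℤ),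
      (c₀ * absGaloisRestrict ℚ K ρ₀) • P = A P := by
  have hK2 : Module.finrank ℚ K = 2 := hK.1
  obtain ⟨q, hq, hqd, hqN⟩ := ShimuraKolyvaginImageInputs.exists_prime_dvd_discr_not_dvd K hK2
    (N := W.conductorNorm ℤ) ∅ (by simp) (fun ℓ hℓ hℓN _ ↦ hH ℓ hℓ hℓN)
  have hq2 : q ≠ 2 := by
    rintro rfl
    have h2 : (2 : ℤ) ∣ NumberField.discr K := by exact_mod_cast hqd
    exact (Int.not_even_iff_odd.mpr hodd) (even_iff_two_dvd.mpr h2)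
  have hqn : ¬ (q : ℤ) ∣ ((2 ^ k : ℕ) : ℤ) := by
    intro h
    have h' : q ∣ 2 ^ k := by exact_mod_cast h
    exact hq2 ((Nat.prime_dvd_prime_iff_eq hq Nat.prime_two).mp (hq.dvd_of_dvd_pow h'))
  exact exists_mul_absGaloisRestrict_smul_eq_addAut_of_dvd_discr hK2 hq hqd hqN hqn hsurj c₀ A

end RegularSupplyI2

/-! ## §J  The regular involution `[[1,1],[0,-1]]`: R1 / LKL (lossless), `det = -1`, and the COMPLETE regular supply
for the skeleton (E1 + the inputs `hsq`, `hP1`, `hker` of §H and `hμ` of §F) -/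

section RegularInvolution

variable {q : ℕ} {T : Type*} [AddCommGroup T] [Module (ZMod q) T] (b : Module.Basis (Fin 2) (ZMod q) T)

/-- The REGULAR INVOLUTION of a rank-`2` free `ZMod q`-module in the basis `b` — matrix `[[1,1],[0,-1]]`:
`x•b₀ + y•b₁ ↦ (x + y)•b₀ - y•b₁` (`regR` of the one-door filter; a transvection times `diag(1,-1)`). [folklore] -/
def reg (X : T) : T := (b.repr X 0 + b.repr X 1) • b 0 - b.repr X 1 • b 1

theorem repr_reg_zero (X : T) : b.repr (reg b X) 0 = b.repr X 0 + b.repr X 1 := by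
  simp [reg]

theorem repr_reg_one (X : T) : b.repr (reg b X) 1 = - b.repr X 1 := by
  simp [reg]

/-- `reg` is an involution. [folklore] -/
theorem reg_reg (X : T) : reg b (reg b X) = X := by
  refine b.ext_elem fun i ↦ ?_
  fin_cases i
  · simp [repr_reg_zero, repr_reg_one]
  · simp [repr_reg_one]

theorem reg_add (X Y : T) : reg b (X + Y) = reg b X + reg b Y := by
  simp only [reg, map_add, Finsupp.add_apply, add_smul]
  abel

/-- `reg` as an additive automorphism (an element of `AddAut T = Aut(E[q])`, the target of `ρ̄_{E,q}`). [folklore] -/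
def regAut : AddAut T where
  toFun := reg b
  invFun := reg b
  left_inv := reg_reg b
  right_inv := reg_reg b
  map_add' := reg_add b

@[simp] theorem regAut_apply (X : T) : regAut b X = reg b X := rfl

theorem reg_basis_zero : reg b (b 0) = b 0 := by
  refine b.ext_elem fun i ↦ ?_
  fin_cases i <;> simp [repr_reg_zero, repr_reg_one]

theorem reg_basis_one : reg b (b 1) = b 0 - b 1 := by
  refine b.ext_elem fun i ↦ ?_
  fin_cases i <;> simp [repr_reg_zero, repr_reg_one]

/-- **`det [[1,1],[0,-1]] = -1`** in the form consumed by §E `smul_eq_inv_of_det_repr_eq_neg_one`. [folklore] -/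
theorem det_reg :
    b.repr (reg b (b 0)) 0 * b.repr (reg b (b 1)) 1 - b.repr (reg b (b 1)) 0 * b.repr (reg b (b 0)) 1 = -1 := by
  simp [repr_reg_zero, repr_reg_one]

/-- A `reg`-fixed vector has vanishing second coordinate (`(x + y, -y) = (x, y) ⟹ y = 0`; NB over `ZMod 2^M` the
second coordinate alone, `-y = y`, would not suffice). [folklore] -/
theorem repr_one_eq_zero_of_reg_eq {X : T} (h : reg b X = X) : b.repr X 1 = 0 := by
  have h0 := congrArg (fun Z ↦ b.repr Z 0) h
  simpa [repr_reg_zero] using h0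

theorem eq_smul_basis_zero_of_reg_eq {X : T} (h : reg b X = X) : X = b.repr X 0 • b 0 := by
  have h1 := repr_one_eq_zero_of_reg_eq b h
  refine b.ext_elem fun i ↦ ?_
  fin_cases i <;> simp [h1]

/-- **R1 / LKL — the regular involution is LOSSLESS at every level**: `ker(reg - 1) = im(reg + 1)` on the `c`-torsion
of `T` for every integer `c` (in particular `c = 2^e`, `e ≤ M`): a fixed `X = x•b₀` with `cX = 0` is `Y + reg Y` for
`Y = x•b₁`, and `cY = 0`.  This is the hypothesis `hker` of §H `exists_galoisElement_regular_rat`. [folklore] -/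
theorem exists_eq_add_reg_of_reg_eq {c : ℤ} {X : T} (hc : c • X = 0) (h : reg b X = X) :
    ∃ Y : T, c • Y = 0 ∧ X = Y + reg b Y := by
  have hX := eq_smul_basis_zero_of_reg_eq b h
  set x := b.repr X 0 with hx
  have hcx : ((c : ZMod q) * x) = 0 := by
    have h0 := congrArg (fun Z ↦ b.repr Z 0) hc
    rw [hX, ← Int.cast_smul_eq_zsmul (ZMod q), smul_smul] at h0
    simpa [Finsupp.single_apply] using h0
  refine ⟨x • b 1, ?_, ?_⟩
  · rw [← Int.cast_smul_eq_zsmul (ZMod q), smul_smul, hcx, zero_smul]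
  · rw [hX]
    refine b.ext_elem fun i ↦ ?_
    fin_cases i <;> simp [reg]

/-- A `reg`-ANTI-invariant vector: `(x + y, -y) = (-x, -y) ⟹ y = -2x`, so `X = x•b₀ - 2x•b₁`. [folklore] -/
theorem repr_one_eq_of_reg_eq_neg {X : T} (h : reg b X = -X) : b.repr X 1 = -(2 * b.repr X 0) := by
  have h0 := congrArg (fun Z ↦ b.repr Z 0) h
  simp only [repr_reg_zero, map_neg, Finsupp.coe_neg, Pi.neg_apply] at h0
  linear_combination h0

theorem eq_of_reg_eq_neg {X : T} (h : reg b X = -X) : X = b.repr X 0 • b 0 - (2 * b.repr X 0) • b 1 := by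
  have h1 := repr_one_eq_of_reg_eq_neg b h
  refine b.ext_elem fun i ↦ ?_
  fin_cases i <;> simp [h1, Finsupp.single_apply]

/-- **ANTI-LOSSLESS — `Ĥ⁻¹(⟨reg⟩, T[c]) = 0`**: `ker(reg + 1) = im(reg - 1)` on the `c`-torsion of `T` for every integer `c`:
an anti-invariant `X` with `cX = 0` is `Y - reg Y` for `Y = -x•b₁`, and `cY = 0`.  (Companion of the LOSSLESS lemma
`exists_eq_add_reg_of_reg_eq`, `Ĥ⁰ = 0`; together: the regular involution is COHOMOLOGICALLY TRIVIAL on every `T[2^e]`,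
whereas `diag(1,-1)` has `Ĥ⁰ ≅ Ĥ⁻¹ ≅ (ℤ/2)²` on `(ℤ/2^M)²` — the factor-`2` loss of Gross's argument at `p = 2`.) [folklore] -/
theorem exists_eq_sub_reg_of_reg_eq_neg {c : ℤ} {X : T} (hc : c • X = 0) (h : reg b X = -X) :
    ∃ Y : T, c • Y = 0 ∧ X = Y - reg b Y := by
  have hX := eq_of_reg_eq_neg b h
  set x := b.repr X 0 with hx
  have hcx : ((c : ZMod q) * x) = 0 := by
    have h0 := congrArg (fun Z ↦ b.repr Z 0) hc
    rw [hX, ← Int.cast_smul_eq_zsmul (ZMod q), smul_sub, smul_smul, smul_smul] at h0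
    simpa [Finsupp.single_apply] using h0
  refine ⟨-(x • b 1), ?_, ?_⟩
  · rw [smul_neg, ← Int.cast_smul_eq_zsmul (ZMod q), smul_smul, hcx, zero_smul, neg_zero]
  · rw [hX]
    refine b.ext_elem fun i ↦ ?_
    fin_cases i <;> simp [reg, Finsupp.single_apply] <;> ring

/-- `b₁ + reg b₁ = b₀`. [folklore] -/
theorem basis_one_add_reg : b 1 + reg b (b 1) = b 0 := by
  rw [reg_basis_one]; abel

/-- An integer multiple `k • b i` of a basis vector vanishes only if `k = 0` in `ZMod q`. [folklore] -/
theorem zsmul_basis_ne_zero {k : ℤ} (hk : (k : ZMod q) ≠ 0) (i : Fin 2) : k • b i ≠ 0 := by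
  intro h
  apply hk
  have h0 := congrArg (fun Z ↦ b.repr Z i) h
  rw [← Int.cast_smul_eq_zsmul (ZMod q)] at h0
  simpa [Finsupp.single_apply] using h0

/-- `2^n ≠ 0` in `ZMod 2^{n+1}`. [folklore] -/
theorem two_pow_ne_zero_zmod (n : ℕ) : (((2 : ℤ) ^ n : ℤ) : ZMod (2 ^ (n + 1))) ≠ 0 := by
  haveI : NeZero (2 ^ (n + 1)) := ⟨pow_ne_zero _ two_ne_zero⟩
  rw [Ne, ZMod.intCast_zmod_eq_zero_iff_dvd]
  intro h
  have h' : 2 ^ (n + 1) ∣ 2 ^ n := by exact_mod_cast h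
  rw [Nat.pow_dvd_pow_iff_le_right (by norm_num)] at h'
  omega

end RegularInvolution

/-! ### A `ZMod m`-basis of `E(ℚ̄)[m]` (Silverman AEC III.6.4(b), tree `nonempty_geomTorsion_addEquiv_prod`) -/

section TorsionBasis

open WeierstrassCurve
open Literature.NumberTheory.GaloisRepresentations Literature.NumberTheory.EllipticCurves Literature.NumberTheory

/-- **`E(ℚ̄)[m]` is free of rank `2` over `ℤ/m`**: a `ZMod m`-basis indexed by `Fin 2`, for the `ZMod m`-module structure
`AddSubgroup.torsionBy.zmodModule` the tree puts on `geomTorsion` (via `letI`).  From the tree's `E[m] ≃+ ℤ/m × ℤ/m`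
(`nonempty_geomTorsion_addEquiv_prod`, AEC III.6.4(b)) made `ZMod m`-linear (`AddMonoidHom.toZModLinearMap`).
[cite: SilvermanAEC2009, Cor. III.6.4(b)] -/
theorem nonempty_basis_geomTorsion (W : WeierstrassCurve ℚ) [W.IsElliptic] (m : ℕ) [NeZero m] :
    letI : Module (ZMod m) (geomTorsion W (m : ℤ)) := AddSubgroup.torsionBy.zmodModule
    Nonempty (Module.Basis (Fin 2) (ZMod m) (geomTorsion W (m : ℤ))) := by
  letI : Module (ZMod m) (geomTorsion W (m : ℤ)) := AddSubgroup.torsionBy.zmodModule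
  obtain ⟨θ⟩ := W.nonempty_geomTorsion_addEquiv_prod (m := m) (by exact_mod_cast NeZero.ne m)
  let L : geomTorsion W (m : ℤ) ≃ₗ[ZMod m] (ZMod m × ZMod m) :=
    { AddMonoidHom.toZModLinearMap m θ.toAddMonoidHom with
      invFun := θ.symm
      left_inv := θ.left_inv
      right_inv := θ.right_inv }
  exact ⟨(Module.Basis.finTwoProd (ZMod m)).map L.symm⟩

end TorsionBasis

/-! ### The complete regular supply for the skeleton -/

section RegularSupplyJ

open WeierstrassCurve NumberField IsDedekindDomain Field
open Literature.NumberTheory.GaloisRepresentations Literature.NumberTheory.EllipticCurves Literature.NumberTheory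
open Summit.BirchSwinnertonDyer.BirchSwinnertonDyer.Theorems

universe u

variable {W : WeierstrassCurve ℚ} {K : Type u} [Field K] [NumberField K]

/-- **THE REGULAR ELEMENT FOR THE SKELETON (E1 + the inputs of E2/E3, PROVED).**  For `K` imaginary quadratic with `d_K`
door-admissible for `E`, `ρ̄_{E,2^{n+1}}` surjective and ANY `c₀ ∈ Γ_ℚ` (the engine's complex conjugation), there are `ρ₀ ∈ Γ_K` and
`P ∈ E[2^{n+1}]` such that `h₀ := c₀ · res ρ₀` (i) is an involution on `E(ℚ̄)[2^{n+1}]` (`hsq`), (ii) has `2^n (P + h₀P) ≠ 0` (`hP1`,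
`M = n+1`), (iii) is LOSSLESS: `ker(h₀ - 1) = im(h₀ + 1)` on every `E[2^e]` (`hker`, R1/LKL), and (iv) every `σ ∈ Γ_ℚ` acting on
`E[2^{n+1}]` as `h₀` INVERTS `μ_{2^{n+1}}` (`hμ` for the final `c₀ · res(ρ₀ n m)` of §H, via §E: `det [[1,1],[0,-1]] = -1`).
Feeds `exists_galoisElement_regular_rat` (§H) and Steps C–H (§F) with NO further arithmetic input. [folklore] -/
theorem exists_regular_galoisElement_of_supply [W.IsElliptic] (n : ℕ) (c₀ : absoluteGaloisGroup ℚ)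
    (hsup : ∀ A : AddAut (geomTorsion W ((2 ^ (n + 1) : ℕ) : ℤ)),
      ∃ ρ₀ : absoluteGaloisGroup K, ∀ P : geomTorsion W ((2 ^ (n + 1) : ℕ) : ℤ),
        (c₀ * absGaloisRestrict ℚ K ρ₀) • P = A P) :
    ∃ ρ₀ : absoluteGaloisGroup K, ∃ P : geomTorsion W ((2 ^ (n + 1) : ℕ) : ℤ),
      (∀ X : geomTorsion W ((2 ^ (n + 1) : ℕ) : ℤ),
          (c₀ * absGaloisRestrict ℚ K ρ₀) • (c₀ * absGaloisRestrict ℚ K ρ₀) • X = X) ∧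
      ((2 : ℤ) ^ n • (P + (c₀ * absGaloisRestrict ℚ K ρ₀) • P) ≠ 0) ∧
      (∀ (e : ℕ) (X : geomTorsion W ((2 ^ (n + 1) : ℕ) : ℤ)), (2 : ℤ) ^ e • X = 0 →
          (c₀ * absGaloisRestrict ℚ K ρ₀) • X = X →
          ∃ Y : geomTorsion W ((2 ^ (n + 1) : ℕ) : ℤ),
            (2 : ℤ) ^ e • Y = 0 ∧ X = Y + (c₀ * absGaloisRestrict ℚ K ρ₀) • Y) ∧
      (∀ σ : absoluteGaloisGroup ℚ,
          (∀ X : geomTorsion W ((2 ^ (n + 1) : ℕ) : ℤ), σ • X = (c₀ * absGaloisRestrict ℚ K ρ₀) • X) →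
          ∀ ζ : AlgebraicClosure ℚ, ζ ^ (2 ^ (n + 1)) = 1 → σ • ζ = ζ⁻¹) := by
  letI : Module (ZMod (2 ^ (n + 1))) (geomTorsion W ((2 ^ (n + 1) : ℕ) : ℤ)) :=
    AddSubgroup.torsionBy.zmodModule
  haveI : NeZero (2 ^ (n + 1)) := ⟨pow_ne_zero _ two_ne_zero⟩
  obtain ⟨b⟩ := nonempty_basis_geomTorsion W (2 ^ (n + 1))
  obtain ⟨ρ₀, hρ₀⟩ := hsup (regAut b)
  simp only [regAut_apply] at hρ₀
  refine ⟨ρ₀, b 1, fun X ↦ ?_, ?_, fun e X heX hfix ↦ ?_, fun σ hσ ζ hζ ↦ ?_⟩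
  · rw [hρ₀, hρ₀, reg_reg]
  · rw [hρ₀, basis_one_add_reg]
    exact zsmul_basis_ne_zero b (two_pow_ne_zero_zmod n) 0
  · rw [hρ₀] at hfix
    obtain ⟨Y, hY, hXY⟩ := exists_eq_add_reg_of_reg_eq b heX hfix
    exact ⟨Y, hY, by rw [hρ₀]; exact hXY⟩
  · refine smul_eq_inv_of_det_repr_eq_neg_one W Nat.prime_two n b ?_ ζ hζ
    rw [hσ, hσ, hρ₀, hρ₀]
    exact det_reg b

/-- **THE REGULAR ELEMENT FOR THE DOOR-LAW STUBS** (binder `DoorAdmissible W d_K`): `exists_regular_galoisElement_of_supply` + §I′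
`exists_mul_absGaloisRestrict_smul_eq_addAut_of_doorAdmissible`. [folklore] -/
theorem exists_regular_galoisElement_of_doorAdmissible [W.IsElliptic] [W.IsGloballyMinimal]
    (hK : IsImaginaryQuadratic K) (hD : RankOneAtTwoOneDoor.DoorAdmissible W (NumberField.discr K)) (n : ℕ)
    (hsurj : W.HasSurjectiveModNGaloisRep ((2 ^ (n + 1) : ℕ) : ℤ)) (c₀ : absoluteGaloisGroup ℚ) :
    ∃ ρ₀ : absoluteGaloisGroup K, ∃ P : geomTorsion W ((2 ^ (n + 1) : ℕ) : ℤ),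
      (∀ X : geomTorsion W ((2 ^ (n + 1) : ℕ) : ℤ),
          (c₀ * absGaloisRestrict ℚ K ρ₀) • (c₀ * absGaloisRestrict ℚ K ρ₀) • X = X) ∧
      ((2 : ℤ) ^ n • (P + (c₀ * absGaloisRestrict ℚ K ρ₀) • P) ≠ 0) ∧
      (∀ (e : ℕ) (X : geomTorsion W ((2 ^ (n + 1) : ℕ) : ℤ)), (2 : ℤ) ^ e • X = 0 →
          (c₀ * absGaloisRestrict ℚ K ρ₀) • X = X →
          ∃ Y : geomTorsion W ((2 ^ (n + 1) : ℕ) : ℤ),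
            (2 : ℤ) ^ e • Y = 0 ∧ X = Y + (c₀ * absGaloisRestrict ℚ K ρ₀) • Y) ∧
      (∀ σ : absoluteGaloisGroup ℚ,
          (∀ X : geomTorsion W ((2 ^ (n + 1) : ℕ) : ℤ), σ • X = (c₀ * absGaloisRestrict ℚ K ρ₀) • X) →
          ∀ ζ : AlgebraicClosure ℚ, ζ ^ (2 ^ (n + 1)) = 1 → σ • ζ = ζ⁻¹) :=
  exists_regular_galoisElement_of_supply n c₀ fun A ↦
    exists_mul_absGaloisRestrict_smul_eq_addAut_of_doorAdmissible hK hD hsurj c₀ A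

/-- **THE REGULAR ELEMENT FOR THE BIG-IMAGE STUBS S3/S4/S5** (binders `Odd d_K`, `SatisfiesHeegnerHypothesis N_E K`):
`exists_regular_galoisElement_of_supply` + §I′ `exists_mul_absGaloisRestrict_smul_eq_addAut_of_heegner`. [folklore] -/
theorem exists_regular_galoisElement_of_heegner [W.IsElliptic]
    (hK : IsImaginaryQuadratic K) (hodd : Odd (NumberField.discr K))
    (hH : SatisfiesHeegnerHypothesis (W.conductorNorm ℤ) K) (n : ℕ)
    (hsurj : W.HasSurjectiveModNGaloisRep ((2 ^ (n + 1) : ℕ) : ℤ)) (c₀ : absoluteGaloisGroup ℚ) :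
    ∃ ρ₀ : absoluteGaloisGroup K, ∃ P : geomTorsion W ((2 ^ (n + 1) : ℕ) : ℤ),
      (∀ X : geomTorsion W ((2 ^ (n + 1) : ℕ) : ℤ),
          (c₀ * absGaloisRestrict ℚ K ρ₀) • (c₀ * absGaloisRestrict ℚ K ρ₀) • X = X) ∧
      ((2 : ℤ) ^ n • (P + (c₀ * absGaloisRestrict ℚ K ρ₀) • P) ≠ 0) ∧
      (∀ (e : ℕ) (X : geomTorsion W ((2 ^ (n + 1) : ℕ) : ℤ)), (2 : ℤ) ^ e • X = 0 →
          (c₀ * absGaloisRestrict ℚ K ρ₀) • X = X →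
          ∃ Y : geomTorsion W ((2 ^ (n + 1) : ℕ) : ℤ),
            (2 : ℤ) ^ e • Y = 0 ∧ X = Y + (c₀ * absGaloisRestrict ℚ K ρ₀) • Y) ∧
      (∀ σ : absoluteGaloisGroup ℚ,
          (∀ X : geomTorsion W ((2 ^ (n + 1) : ℕ) : ℤ), σ • X = (c₀ * absGaloisRestrict ℚ K ρ₀) • X) →
          ∀ ζ : AlgebraicClosure ℚ, ζ ^ (2 ^ (n + 1)) = 1 → σ • ζ = ζ⁻¹) :=
  exists_regular_galoisElement_of_supply n c₀ fun A ↦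
    exists_mul_absGaloisRestrict_smul_eq_addAut_of_heegner hK hodd hH hsurj c₀ A

end RegularSupplyJ


/-! ## §L  The IMAGE TOKENS at `2` over `K` (`hS`, `hC` of Steps B–H) from `ρ̄_{E,2}` onto + the ramified prime — so that
the engine port needs NO token beyond the stub binders: the commutant of `GL₂(ℤ/m)` via `[[1,1],[0,-1]]` and the swap `[[0,1],[1,0]]`
(the tree's `exists_eq_zsmul_baseChange_of_irr` excludes `p = 2`). -/

section SwapCommutant

variable {q : ℕ} {T : Type*} [AddCommGroup T] [Module (ZMod q) T] (b : Module.Basis (Fin 2) (ZMod q) T)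

/-- The coordinate SWAP `x•b₀ + y•b₁ ↦ y•b₀ + x•b₁` (matrix `[[0,1],[1,0]]`). [folklore] -/
def swp (X : T) : T := b.repr X 1 • b 0 + b.repr X 0 • b 1

theorem repr_swp_zero (X : T) : b.repr (swp b X) 0 = b.repr X 1 := by
  simp [swp]

theorem repr_swp_one (X : T) : b.repr (swp b X) 1 = b.repr X 0 := by
  simp [swp]

theorem swp_swp (X : T) : swp b (swp b X) = X := by
  refine b.ext_elem fun i ↦ ?_
  fin_cases i
  · simp [repr_swp_zero, repr_swp_one]
  · simp [repr_swp_zero, repr_swp_one]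

theorem swp_add (X Y : T) : swp b (X + Y) = swp b X + swp b Y := by
  simp only [swp, map_add, Finsupp.add_apply, add_smul]
  abel

/-- `swp` as an additive automorphism. [folklore] -/
def swpAut : AddAut T where
  toFun := swp b
  invFun := swp b
  left_inv := swp_swp b
  right_inv := swp_swp b
  map_add' := swp_add b

@[simp] theorem swpAut_apply (X : T) : swpAut b X = swp b X := rfl

theorem swp_basis_zero : swp b (b 0) = b 1 := by
  refine b.ext_elem fun i ↦ ?_
  fin_cases i <;> simp [repr_swp_zero, repr_swp_one]

/-- **The commutant of `{[[1,1],[0,-1]], [[0,1],[1,0]]}` in `End((ℤ/q)²)` is the scalars** (so a fortiori the commutant of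
`GL₂(ℤ/q)`): an additive endomorphism commuting with `reg` and `swp` is `a • id`, `a ∈ ℤ/q`. [folklore] -/
theorem exists_eq_smul_of_comm_reg_swp (f : T →+ T) (hreg : ∀ X, f (reg b X) = reg b (f X))
    (hswp : ∀ X, f (swp b X) = swp b (f X)) : ∃ a : ZMod q, ∀ X, f X = a • X := by
  have hc : b.repr (f (b 0)) 1 = 0 := by
    have h := congrArg (fun Z ↦ b.repr Z 0) (hreg (b 0))
    simpa [reg_basis_zero, repr_reg_zero] using h
  have h10 : b.repr (f (b 1)) 0 = 0 := by
    have h := congrArg (fun Z ↦ b.repr Z 0) (hswp (b 0))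
    simp only [swp_basis_zero, repr_swp_zero] at h
    rw [h, hc]
  have h11 : b.repr (f (b 1)) 1 = b.repr (f (b 0)) 0 := by
    have h := congrArg (fun Z ↦ b.repr Z 1) (hswp (b 0))
    simpa [swp_basis_zero, repr_swp_one] using h
  set a := b.repr (f (b 0)) 0 with ha
  refine ⟨a, fun X ↦ ?_⟩
  have hf0 : f (b 0) = a • b 0 := by
    refine b.ext_elem fun j ↦ ?_
    fin_cases j
    · simp [ha]
    · simpa using hc
  have hf1 : f (b 1) = a • b 1 := by
    refine b.ext_elem fun j ↦ ?_
    fin_cases j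
    · simpa using h10
    · simpa using h11
  have hX := b.sum_repr X
  rw [Fin.sum_univ_two] at hX
  calc f X = f (b.repr X 0 • b 0 + b.repr X 1 • b 1) := by rw [hX]
    _ = b.repr X 0 • f (b 0) + b.repr X 1 • f (b 1) := by rw [map_add, ZMod.map_smul, ZMod.map_smul]
    _ = a • (b.repr X 0 • b 0 + b.repr X 1 • b 1) := by
        rw [hf0, hf1, smul_add, smul_comm (b.repr X 0) a (b 0), smul_comm (b.repr X 1) a (b 1)]
    _ = a • X := by rw [hX]

end SwapCommutant

section ImageTokensL

open WeierstrassCurve NumberField IsDedekindDomain Field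
open Literature.NumberTheory.GaloisRepresentations Literature.NumberTheory.EllipticCurves Literature.NumberTheory
open Summit.BirchSwinnertonDyer.BirchSwinnertonDyer.Theorems

universe u

variable {W : WeierstrassCurve ℚ} {K : Type u} [Field K] [NumberField K]

/-- **Scalar commutant of `E(K̄)[m]` as a `Γ_K`-module, from the regular supply** (every additive automorphism of `E(ℚ̄)[m]`
is realised by `res Γ_K`): a `Γ_K`-equivariant additive endomorphism of `E(K̄)[m]` is multiplication by an integer.  At `m = 2`
this is the tree's missing case `p = 2` of `ShimuraKolyvaginImageInputs.exists_eq_zsmul_baseChange_of_irr` (whose eigenvector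
argument needs `p` odd): here the commutant of `GL₂(ℤ/m) ∋ [[1,1],[0,-1]], [[0,1],[1,0]]` is computed directly. [folklore] -/
theorem exists_eq_zsmul_of_supply [W.IsElliptic] (m : ℕ) [NeZero m]
    (hsup : ∀ A : AddAut (geomTorsion W (m : ℤ)), ∃ ρ₀ : absoluteGaloisGroup K,
      ∀ P : geomTorsion W (m : ℤ), absGaloisRestrict ℚ K ρ₀ • P = A P)
    (f : geomTorsion (W.baseChange K) (m : ℤ) →+ geomTorsion (W.baseChange K) (m : ℤ))
    (hf : ∀ (g : absoluteGaloisGroup K) (t : geomTorsion (W.baseChange K) (m : ℤ)), f (g • t) = g • f t) :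
    ∃ k : ℤ, ∀ t, f t = k • t := by
  letI : Module (ZMod m) (geomTorsion W (m : ℤ)) := AddSubgroup.torsionBy.zmodModule
  obtain ⟨b⟩ := nonempty_basis_geomTorsion W m
  set θ := RatClosure.torsionEquiv (K := K) W (m : ℤ) with hθ
  set f₀ : geomTorsion W (m : ℤ) →+ geomTorsion W (m : ℤ) :=
    θ.symm.toAddMonoidHom.comp (f.comp θ.toAddMonoidHom) with hf₀def
  have hf₀ : ∀ X, f₀ X = θ.symm (f (θ X)) := fun X ↦ rfl
  have hcomm : ∀ (A : AddAut (geomTorsion W (m : ℤ))) (X : geomTorsion W (m : ℤ)), f₀ (A X) = A (f₀ X) := by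
    intro A X
    obtain ⟨ρ₀, hρ₀⟩ := hsup A
    rw [hf₀, hf₀, ← hρ₀, ← hρ₀, RatClosure.torsionEquiv_smul, hf]
    apply θ.injective
    rw [AddEquiv.apply_symm_apply, RatClosure.torsionEquiv_smul, AddEquiv.apply_symm_apply]
  obtain ⟨a, ha⟩ := exists_eq_smul_of_comm_reg_swp b f₀ (fun X ↦ hcomm (regAut b) X)
    (fun X ↦ hcomm (swpAut b) X)
  refine ⟨((a.val : ℕ) : ℤ), fun t ↦ ?_⟩
  have h1 : f t = θ (f₀ (θ.symm t)) := by rw [hf₀, AddEquiv.apply_symm_apply, AddEquiv.apply_symm_apply]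
  have h2 : f₀ (θ.symm t) = ((a.val : ℕ) : ℤ) • θ.symm t := by
    rw [ha, natCast_zsmul, ← Nat.cast_smul_eq_nsmul (ZMod m), ZMod.natCast_zmod_val]
  rw [h1, h2, map_zsmul, AddEquiv.apply_symm_apply]

/-- **Both image tokens of the Kolyvagin machine at `2` over `K`** — `E(K̄)[2]` a SIMPLE `Γ_K`-module (`hS`) with SCALAR commutant
(`hC`) — from `ρ̄_{E,2}` onto over `ℚ` and a prime `q ∣ d_K`, `q ∤ 2N_E` (Gross §9 disjointness, tree
`ShimuraKolyvaginImageDisjoint.exists_absGaloisRestrict_smul_eq`; simplicity via the tree's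
`hasIrreducibleModPGaloisRep_of_hasSurjectiveModNGaloisRep` + `ShimuraKolyvaginImageInputs.hasIrreducibleModPGaloisRep_baseChange`). [cite: GrossLMS1991, §9] -/
theorem imageTokens_two (hK2 : Module.finrank ℚ K = 2) {q : ℕ} (hq : q.Prime)
    (hqd : (q : ℤ) ∣ NumberField.discr K) [W.IsElliptic] (hqN : ¬ q ∣ W.conductorNorm ℤ) (hq2 : ¬ (q : ℤ) ∣ 2)
    (hρ2 : W.HasSurjectiveModNGaloisRep 2) :
    (∀ H : AddSubgroup (geomTorsion (W.baseChange K) 2),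
      (∀ g : absoluteGaloisGroup K, ∀ t ∈ H, g • t ∈ H) → H = ⊥ ∨ H = ⊤) ∧
    (∀ f : geomTorsion (W.baseChange K) 2 →+ geomTorsion (W.baseChange K) 2,
      (∀ (g : absoluteGaloisGroup K) (t : geomTorsion (W.baseChange K) 2), f (g • t) = g • f t) →
        ∃ c : ℤ, ∀ t, f t = c • t) := by
  haveI : Fact (Nat.Prime 2) := ⟨Nat.prime_two⟩
  have hirr : W.HasIrreducibleModPGaloisRep 2 :=
    hasIrreducibleModPGaloisRep_of_hasSurjectiveModNGaloisRep W 2 (by exact_mod_cast hρ2)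
  refine ⟨?_, ?_⟩
  · exact ShimuraKolyvaginImageInputs.hasIrreducibleModPGaloisRep_baseChange W K hK2 hq hqd hqN
      (p := 2) (by exact_mod_cast hq2) hirr
  · intro f hf
    refine exists_eq_zsmul_of_supply (W := W) (K := K) 2 (fun A ↦ ?_) f hf
    have hρ2' : W.HasSurjectiveModNGaloisRep ((2 : ℕ) : ℤ) := by exact_mod_cast hρ2
    obtain ⟨γ₁, hγ₁⟩ := hρ2' (Multiplicative.ofAdd A)
    obtain ⟨g, hg⟩ := ShimuraKolyvaginImageDisjoint.exists_absGaloisRestrict_smul_eq W K hK2 hq hqd hqN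
      (n := ((2 : ℕ) : ℤ)) (by exact_mod_cast hq2) γ₁
    refine ⟨g, fun P ↦ ?_⟩
    rw [hg, ← galoisRepTorsion_apply, hγ₁]
    rfl

/-- The ramified prime for the DOOR-LAW stubs: `q ∣ d_K` prime with `q ∤ N_E` (good reduction at the primes of `d_K`) and `q ≠ 2`
(`d_K ≡ 1 (8)`). [folklore] -/
theorem exists_ramifiedPrime_of_doorAdmissible [W.IsElliptic] [W.IsGloballyMinimal]
    (hK : IsImaginaryQuadratic K) (hD : RankOneAtTwoOneDoor.DoorAdmissible W (NumberField.discr K)) :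
    ∃ q : ℕ, q.Prime ∧ (q : ℤ) ∣ NumberField.discr K ∧ ¬ q ∣ W.conductorNorm ℤ ∧ q ≠ 2 := by
  have hK2 : Module.finrank ℚ K = 2 := hK.1
  obtain ⟨q, hq, hqd⟩ := ShimuraKolyvaginImageDisjoint.exists_prime_dvd_discr K (by omega)
  obtain ⟨-, -, h8, hgoodAll, -⟩ := hD
  haveI : Fact q.Prime := ⟨hq⟩
  have hgood : W.HasGoodReductionAtPrime q := hgoodAll q hq hqd ⟨hq⟩
  have hqN : ¬ q ∣ W.conductorNorm ℤ := fun h ↦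
    (W.dvd_conductorNorm_iff_not_hasGoodReductionAtPrime q).mp h hgood
  have hq2 : q ≠ 2 := by
    rintro rfl
    have h2 : (2 : ℤ) ∣ NumberField.discr K := by exact_mod_cast hqd
    omega
  exact ⟨q, hq, hqd, hqN, hq2⟩

/-- The ramified prime for the BIG-IMAGE stubs: `q ∣ d_K` prime with `q ∤ N_E` (the primes of `N_E` split: Heegner) and `q ≠ 2` (`d_K` odd).
[folklore] -/
theorem exists_ramifiedPrime_of_heegner [W.IsElliptic]
    (hK : IsImaginaryQuadratic K) (hodd : Odd (NumberField.discr K))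
    (hH : SatisfiesHeegnerHypothesis (W.conductorNorm ℤ) K) :
    ∃ q : ℕ, q.Prime ∧ (q : ℤ) ∣ NumberField.discr K ∧ ¬ q ∣ W.conductorNorm ℤ ∧ q ≠ 2 := by
  have hK2 : Module.finrank ℚ K = 2 := hK.1
  obtain ⟨q, hq, hqd, hqN⟩ := ShimuraKolyvaginImageInputs.exists_prime_dvd_discr_not_dvd K hK2
    (N := W.conductorNorm ℤ) ∅ (by simp) (fun ℓ hℓ hℓN _ ↦ hH ℓ hℓ hℓN)
  have hq2 : q ≠ 2 := by
    rintro rfl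
    have h2 : (2 : ℤ) ∣ NumberField.discr K := by exact_mod_cast hqd
    exact (Int.not_even_iff_odd.mpr hodd) (even_iff_two_dvd.mpr h2)
  exact ⟨q, hq, hqd, hqN, hq2⟩

theorem not_intCast_dvd_two_of_ne_two {q : ℕ} (hq : q.Prime) (hq2 : q ≠ 2) : ¬ (q : ℤ) ∣ 2 := by
  intro h
  have h' : q ∣ 2 := by exact_mod_cast h
  exact hq2 ((Nat.prime_dvd_prime_iff_eq hq Nat.prime_two).mp h')

/-- **`hS ∧ hC` at `2` over `K` for the DOOR-LAW stubs** (binders `IsImaginaryQuadratic K`, `DoorAdmissible W d_K`, `ρ̄_{E,2}` onto). [cite: GrossLMS1991, §9] -/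
theorem imageTokens_two_of_doorAdmissible [W.IsElliptic] [W.IsGloballyMinimal]
    (hK : IsImaginaryQuadratic K) (hD : RankOneAtTwoOneDoor.DoorAdmissible W (NumberField.discr K))
    (hρ2 : W.HasSurjectiveModNGaloisRep 2) :
    (∀ H : AddSubgroup (geomTorsion (W.baseChange K) 2),
      (∀ g : absoluteGaloisGroup K, ∀ t ∈ H, g • t ∈ H) → H = ⊥ ∨ H = ⊤) ∧
    (∀ f : geomTorsion (W.baseChange K) 2 →+ geomTorsion (W.baseChange K) 2,
      (∀ (g : absoluteGaloisGroup K) (t : geomTorsion (W.baseChange K) 2), f (g • t) = g • f t) →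
        ∃ c : ℤ, ∀ t, f t = c • t) := by
  obtain ⟨q, hq, hqd, hqN, hq2⟩ := exists_ramifiedPrime_of_doorAdmissible (W := W) hK hD
  exact imageTokens_two hK.1 hq hqd hqN (not_intCast_dvd_two_of_ne_two hq hq2) hρ2

/-- **`hS ∧ hC` at `2` over `K` for the BIG-IMAGE stubs** (binders `IsImaginaryQuadratic K`, `Odd d_K`, `SatisfiesHeegnerHypothesis N_E K`,
`ρ̄_{E,2}` onto). [cite: GrossLMS1991, §9] -/
theorem imageTokens_two_of_heegner [W.IsElliptic]
    (hK : IsImaginaryQuadratic K) (hodd : Odd (NumberField.discr K))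
    (hH : SatisfiesHeegnerHypothesis (W.conductorNorm ℤ) K) (hρ2 : W.HasSurjectiveModNGaloisRep 2) :
    (∀ H : AddSubgroup (geomTorsion (W.baseChange K) 2),
      (∀ g : absoluteGaloisGroup K, ∀ t ∈ H, g • t ∈ H) → H = ⊥ ∨ H = ⊤) ∧
    (∀ f : geomTorsion (W.baseChange K) 2 →+ geomTorsion (W.baseChange K) 2,
      (∀ (g : absoluteGaloisGroup K) (t : geomTorsion (W.baseChange K) 2), f (g • t) = g • f t) →
        ∃ c : ℤ, ∀ t, f t = c • t) := by
  obtain ⟨q, hq, hqd, hqN, hq2⟩ := exists_ramifiedPrime_of_heegner (W := W) hK hodd hH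
  exact imageTokens_two hK.1 hq hqd hqN (not_intCast_dvd_two_of_ne_two hq hq2) hρ2

end ImageTokensL

/-! ## §K  THE ENGINE PORT END-TO-END (pen kernel-closable #3, PROVED modulo nothing new): skeleton binders ⟹ a regular
Kolyvagin prime with exact local orders — §J (regular element) → §H (Step B) → §F (Steps C–H). -/

section EnginePortK

open scoped Classical Pointwise
open WeierstrassCurve NumberField IsDedekindDomain Field
open Literature.NumberTheory.GaloisRepresentations Literature.NumberTheory.EllipticCurves
open Literature.NumberTheory
open Rat.HeightOneSpectrum
open Summit.BirchSwinnertonDyer.BirchSwinnertonDyer.Theorems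

universe u

variable {W : WeierstrassCurve ℚ} {K : Type u} [Field K] [NumberField K]

/-- **THE REGULAR KOLYVAGIN PRIME FROM THE SKELETON'S BINDERS (E-port = §J → §H → §F, PROVED).**  `E/ℚ` globally minimal, `K` imaginary
quadratic with `d_K` door-admissible, `ρ̄_{E,2^{M}}` surjective (`M = n+1 ≥ 1`), `c₀` complex conjugation, `c ≠ 1` in `Gal(K/ℚ)`, the tree's image
tokens `hS`/`hC` on `E(K̄)[2]`, and τ-stable Selmer-class data `cs, π, e, Nv` exactly as in the tree's Step B: then there are `ρ ∈ Γ_K` with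
`h := c₀ · res ρ` an INVOLUTION on `E(ℚ̄)[2^M]` acting there as the REGULAR involution `[[1,1],[0,-1]]` (so `Frob_ℓ ∼ h` has `tr ≡ 0`,
`det ≡ -1`, and `Ẽ(𝔽_ℓ)[2^∞]` CYCLIC — not `∼ c₀`), and for every bound `b` a Kolyvagin prime `ℓ > b`: `ℓ ∤ 2 N d_K`, `(ℓ)` inert in `K`,
a Frobenius above `ℓ` acting on `E[2^M]` as `h` and on `K` as `c₀`, `2^M ∣ ℓ + 1`, `2^M ∣ a_ℓ`, and `ord c_{i,λ} = 2^{Nv i}` exactly at `λ ∋ ℓ`.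
Conditional only on the displayed tree theorem-token `hC : Automorphic.chebotarev_artinRep`.  This is the pen's kernel-closable #3 up to
the renaming of the `FrobEqFrobInfty` token in the Euler-system files (E4). [cite: GrossLMS1991, §3 (3.1)–(3.3), §9 Prop. 9.3]
[cite: McCallumLMS1991, §3 Cor. 3.2] -/
theorem exists_regular_kolyvaginPrime_of_supply (hCheb : Automorphic.chebotarev_artinRep) {N : ℕ}
    [NeZero N] [W.IsElliptic] [W.IsGloballyMinimal] (hK : IsImaginaryQuadratic K) (n : ℕ)
    {c₀ : absoluteGaloisGroup ℚ} (hc₀ : IsComplexConjugation (Rat.castHom ℝ) c₀)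
    (hsup : ∀ A : AddAut (geomTorsion W ((2 ^ (n + 1) : ℕ) : ℤ)),
      ∃ ρ₀ : absoluteGaloisGroup K, ∀ P : geomTorsion W ((2 ^ (n + 1) : ℕ) : ℤ),
        (c₀ * absGaloisRestrict ℚ K ρ₀) • P = A P)
    {c : K ≃ₐ[ℚ] K} (hc : c ≠ 1)
    (hS : ∀ H : AddSubgroup (geomTorsion (W.baseChange K) 2),
      (∀ g : absoluteGaloisGroup K, ∀ t ∈ H, g • t ∈ H) → H = ⊥ ∨ H = ⊤)
    (hC : ∀ f : geomTorsion (W.baseChange K) 2 →+ geomTorsion (W.baseChange K) 2,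
      (∀ (g : absoluteGaloisGroup K) (t : geomTorsion (W.baseChange K) 2), f (g • t) = g • f t) →
        ∃ c : ℤ, ∀ t, f t = c • t)
    {r : ℕ} (cs : Fin r → galH1Torsion (W.baseChange K) ((2 ^ (n + 1) : ℕ) : ℤ)) {π : Fin r → Fin r}
    (hπ : ∀ i, π (π i) = i) (hcs : ∀ i, conjAct W c ((2 ^ (n + 1) : ℕ) : ℤ) (cs i) = cs (π i))
    (e : Fin r → ℕ) (he : ∀ i, ((2 : ℤ) ^ e i) • cs i = 0)
    (hind : ∀ a : Fin r → ℤ, ∑ i, a i • cs i = 0 → ∀ i, ((2 : ℤ) ^ e i) ∣ a i)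
    (hres : ∀ a : Fin r → ℤ, (∀ ρ ∈ torsionFixing (W.baseChange K) ((2 ^ (n + 1) : ℕ) : ℤ),
      h1Eval (W.baseChange K) ((2 ^ (n + 1) : ℕ) : ℤ) (∑ i, a i • cs i) ρ = 0) → ∑ i, a i • cs i = 0)
    (Nv : Fin r → ℕ) (hNe : ∀ i, Nv i ≤ e i) (heM : ∀ i, e i ≤ n + 1) (hNπ : ∀ i, Nv (π i) = Nv i) :
    ∃ ρ : absoluteGaloisGroup K,
      (∀ X : geomTorsion W ((2 ^ (n + 1) : ℕ) : ℤ),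
        (c₀ * absGaloisRestrict ℚ K ρ) • (c₀ * absGaloisRestrict ℚ K ρ) • X = X) ∧
      (∀ ζ : AlgebraicClosure ℚ, ζ ^ (2 ^ (n + 1)) = 1 → (c₀ * absGaloisRestrict ℚ K ρ) • ζ = ζ⁻¹) ∧
      (∃ P : geomTorsion W ((2 ^ (n + 1) : ℕ) : ℤ),
        (2 : ℤ) ^ n • (P + (c₀ * absGaloisRestrict ℚ K ρ) • P) ≠ 0) ∧
      (∀ (k : ℕ) (X : geomTorsion W ((2 ^ (n + 1) : ℕ) : ℤ)), (2 : ℤ) ^ k • X = 0 →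
          (c₀ * absGaloisRestrict ℚ K ρ) • X = X →
          ∃ Y : geomTorsion W ((2 ^ (n + 1) : ℕ) : ℤ),
            (2 : ℤ) ^ k • Y = 0 ∧ X = Y + (c₀ * absGaloisRestrict ℚ K ρ) • Y) ∧
      ∀ b : ℕ, ∃ ℓ : ℕ, b < ℓ ∧ ℓ.Prime ∧ ¬ ℓ ∣ N ∧ ¬ ((ℓ : ℤ) ∣ NumberField.discr K) ∧ ℓ ≠ 2 ∧
        (Ideal.span {(ℓ : 𝓞 K)}).IsPrime ∧
        (∃ (v : HeightOneSpectrum (𝓞 ℚ)) (𝔓 : Ideal (absIntegers (𝓞 ℚ) ℚ)) (h : absoluteGaloisGroup ℚ),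
          (ℓ : 𝓞 ℚ) ∈ v.asIdeal ∧ 𝔓 ∈ v.primesAbove ∧ IsArithFrobAt (𝓞 ℚ) h 𝔓 ∧
          (∀ P : geomTorsion W ((2 ^ (n + 1) : ℕ) : ℤ), h • P = (c₀ * absGaloisRestrict ℚ K ρ) • P) ∧
          ∀ (e : K →ₐ[ℚ] AlgebraicClosure ℚ) (x : K), h • e x = c₀ • e x) ∧
        2 ^ (n + 1) ∣ ℓ + 1 ∧ ((2 : ℤ) ^ (n + 1)) ∣ W.frobeniusTrace ℓ ∧
        ∀ i, ∀ v : HeightOneSpectrum (𝓞 K), (ℓ : 𝓞 K) ∈ v.asIdeal →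
          (((2 : ℤ) ^ Nv i) • cs i ∈
              (W.baseChange K).torsionLocalKer (v.adicCompletion K) ((2 ^ (n + 1) : ℕ) : ℤ) ∧
            (Nv i ≠ 0 → ((2 : ℤ) ^ (Nv i - 1)) • cs i ∉
              (W.baseChange K).torsionLocalKer (v.adicCompletion K) ((2 ^ (n + 1) : ℕ) : ℤ))) := by
  obtain ⟨ρ₀, P, hsq, hP1, hker, hμ'⟩ := exists_regular_galoisElement_of_supply (K := K) n c₀ hsup
  have hM : 1 ≤ n + 1 := by omega
  obtain ⟨ρ, hact, hsqρ, hρ⟩ := exists_galoisElement_regular_rat (W := W) hK hM hc₀ hc hS hC ρ₀ hsq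
    (P := P) (fun _ ↦ by simpa using hP1) (fun k X _ h1 h2 ↦ hker k X h1 h2) hπ hcs e he hind hres
    Nv hNe heM hNπ
  have hμ : ∀ ζ : AlgebraicClosure ℚ, ζ ^ (2 ^ (n + 1)) = 1 →
      (c₀ * absGaloisRestrict ℚ K ρ) • ζ = ζ⁻¹ := hμ' _ hact
  refine ⟨ρ, hsqρ, hμ, ⟨P, ?_⟩, fun k X h1 h2 ↦ ?_, fun b ↦
    exists_kolyvaginPrime_gt_two_of_galoisElement_regular hCheb hK hM hc₀ hc cs Nv hsqρ hμ hρ b⟩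
  · rw [hact]; exact hP1
  · rw [hact] at h2
    obtain ⟨Y, hY, hXY⟩ := hker k X h1 h2
    exact ⟨Y, hY, by rw [hact]; exact hXY⟩


/-- **THE REGULAR KOLYVAGIN PRIME FOR THE DOOR-LAW STUBS** (binder `DoorAdmissible W d_K`). [cite: GrossLMS1991, §3, §9] -/
theorem exists_regular_kolyvaginPrime_of_doorAdmissible (hCheb : Automorphic.chebotarev_artinRep) {N : ℕ}
    [NeZero N] [W.IsElliptic] [W.IsGloballyMinimal] (hK : IsImaginaryQuadratic K)
    (hD : RankOneAtTwoOneDoor.DoorAdmissible W (NumberField.discr K)) (n : ℕ)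
    (hρ2 : W.HasSurjectiveModNGaloisRep 2) (hsurj : W.HasSurjectiveModNGaloisRep ((2 ^ (n + 1) : ℕ) : ℤ))
    {c₀ : absoluteGaloisGroup ℚ} (hc₀ : IsComplexConjugation (Rat.castHom ℝ) c₀)
    {c : K ≃ₐ[ℚ] K} (hc : c ≠ 1)
    {r : ℕ} (cs : Fin r → galH1Torsion (W.baseChange K) ((2 ^ (n + 1) : ℕ) : ℤ)) {π : Fin r → Fin r}
    (hπ : ∀ i, π (π i) = i) (hcs : ∀ i, conjAct W c ((2 ^ (n + 1) : ℕ) : ℤ) (cs i) = cs (π i))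
    (e : Fin r → ℕ) (he : ∀ i, ((2 : ℤ) ^ e i) • cs i = 0)
    (hind : ∀ a : Fin r → ℤ, ∑ i, a i • cs i = 0 → ∀ i, ((2 : ℤ) ^ e i) ∣ a i)
    (hres : ∀ a : Fin r → ℤ, (∀ ρ ∈ torsionFixing (W.baseChange K) ((2 ^ (n + 1) : ℕ) : ℤ),
      h1Eval (W.baseChange K) ((2 ^ (n + 1) : ℕ) : ℤ) (∑ i, a i • cs i) ρ = 0) → ∑ i, a i • cs i = 0)
    (Nv : Fin r → ℕ) (hNe : ∀ i, Nv i ≤ e i) (heM : ∀ i, e i ≤ n + 1) (hNπ : ∀ i, Nv (π i) = Nv i) :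
    ∃ ρ : absoluteGaloisGroup K,
      (∀ X : geomTorsion W ((2 ^ (n + 1) : ℕ) : ℤ),
        (c₀ * absGaloisRestrict ℚ K ρ) • (c₀ * absGaloisRestrict ℚ K ρ) • X = X) ∧
      (∀ ζ : AlgebraicClosure ℚ, ζ ^ (2 ^ (n + 1)) = 1 → (c₀ * absGaloisRestrict ℚ K ρ) • ζ = ζ⁻¹) ∧
      (∃ P : geomTorsion W ((2 ^ (n + 1) : ℕ) : ℤ),
        (2 : ℤ) ^ n • (P + (c₀ * absGaloisRestrict ℚ K ρ) • P) ≠ 0) ∧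
      (∀ (k : ℕ) (X : geomTorsion W ((2 ^ (n + 1) : ℕ) : ℤ)), (2 : ℤ) ^ k • X = 0 →
          (c₀ * absGaloisRestrict ℚ K ρ) • X = X →
          ∃ Y : geomTorsion W ((2 ^ (n + 1) : ℕ) : ℤ),
            (2 : ℤ) ^ k • Y = 0 ∧ X = Y + (c₀ * absGaloisRestrict ℚ K ρ) • Y) ∧
      ∀ b : ℕ, ∃ ℓ : ℕ, b < ℓ ∧ ℓ.Prime ∧ ¬ ℓ ∣ N ∧ ¬ ((ℓ : ℤ) ∣ NumberField.discr K) ∧ ℓ ≠ 2 ∧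
        (Ideal.span {(ℓ : 𝓞 K)}).IsPrime ∧
        (∃ (v : HeightOneSpectrum (𝓞 ℚ)) (𝔓 : Ideal (absIntegers (𝓞 ℚ) ℚ)) (h : absoluteGaloisGroup ℚ),
          (ℓ : 𝓞 ℚ) ∈ v.asIdeal ∧ 𝔓 ∈ v.primesAbove ∧ IsArithFrobAt (𝓞 ℚ) h 𝔓 ∧
          (∀ P : geomTorsion W ((2 ^ (n + 1) : ℕ) : ℤ), h • P = (c₀ * absGaloisRestrict ℚ K ρ) • P) ∧
          ∀ (e : K →ₐ[ℚ] AlgebraicClosure ℚ) (x : K), h • e x = c₀ • e x) ∧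
        2 ^ (n + 1) ∣ ℓ + 1 ∧ ((2 : ℤ) ^ (n + 1)) ∣ W.frobeniusTrace ℓ ∧
        ∀ i, ∀ v : HeightOneSpectrum (𝓞 K), (ℓ : 𝓞 K) ∈ v.asIdeal →
          (((2 : ℤ) ^ Nv i) • cs i ∈
              (W.baseChange K).torsionLocalKer (v.adicCompletion K) ((2 ^ (n + 1) : ℕ) : ℤ) ∧
            (Nv i ≠ 0 → ((2 : ℤ) ^ (Nv i - 1)) • cs i ∉
              (W.baseChange K).torsionLocalKer (v.adicCompletion K) ((2 ^ (n + 1) : ℕ) : ℤ))) := by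
  obtain ⟨hS, hC⟩ := imageTokens_two_of_doorAdmissible (W := W) hK hD hρ2
  exact exists_regular_kolyvaginPrime_of_supply hCheb hK n hc₀ (fun A ↦
    exists_mul_absGaloisRestrict_smul_eq_addAut_of_doorAdmissible hK hD hsurj c₀ A) hc hS hC cs hπ hcs e he hind hres Nv hNe heM hNπ

/-- **THE REGULAR KOLYVAGIN PRIME FOR THE BIG-IMAGE STUBS S3/S4/S5** (binders `Odd d_K`, `SatisfiesHeegnerHypothesis N_E K` — verbatim those of
`SigmaAccumulationAtTwo` / `StringentPrimitivityAtTwo` / `ShiftedKolyvaginStructureAtTwo`). [cite: GrossLMS1991, §3, §9] -/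
theorem exists_regular_kolyvaginPrime_of_heegner (hCheb : Automorphic.chebotarev_artinRep) {N : ℕ}
    [NeZero N] [W.IsElliptic] [W.IsGloballyMinimal] (hK : IsImaginaryQuadratic K)
    (hodd : Odd (NumberField.discr K)) (hH : SatisfiesHeegnerHypothesis (W.conductorNorm ℤ) K) (n : ℕ)
    (hρ2 : W.HasSurjectiveModNGaloisRep 2) (hsurj : W.HasSurjectiveModNGaloisRep ((2 ^ (n + 1) : ℕ) : ℤ))
    {c₀ : absoluteGaloisGroup ℚ} (hc₀ : IsComplexConjugation (Rat.castHom ℝ) c₀)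
    {c : K ≃ₐ[ℚ] K} (hc : c ≠ 1)
    {r : ℕ} (cs : Fin r → galH1Torsion (W.baseChange K) ((2 ^ (n + 1) : ℕ) : ℤ)) {π : Fin r → Fin r}
    (hπ : ∀ i, π (π i) = i) (hcs : ∀ i, conjAct W c ((2 ^ (n + 1) : ℕ) : ℤ) (cs i) = cs (π i))
    (e : Fin r → ℕ) (he : ∀ i, ((2 : ℤ) ^ e i) • cs i = 0)
    (hind : ∀ a : Fin r → ℤ, ∑ i, a i • cs i = 0 → ∀ i, ((2 : ℤ) ^ e i) ∣ a i)
    (hres : ∀ a : Fin r → ℤ, (∀ ρ ∈ torsionFixing (W.baseChange K) ((2 ^ (n + 1) : ℕ) : ℤ),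
      h1Eval (W.baseChange K) ((2 ^ (n + 1) : ℕ) : ℤ) (∑ i, a i • cs i) ρ = 0) → ∑ i, a i • cs i = 0)
    (Nv : Fin r → ℕ) (hNe : ∀ i, Nv i ≤ e i) (heM : ∀ i, e i ≤ n + 1) (hNπ : ∀ i, Nv (π i) = Nv i) :
    ∃ ρ : absoluteGaloisGroup K,
      (∀ X : geomTorsion W ((2 ^ (n + 1) : ℕ) : ℤ),
        (c₀ * absGaloisRestrict ℚ K ρ) • (c₀ * absGaloisRestrict ℚ K ρ) • X = X) ∧
      (∀ ζ : AlgebraicClosure ℚ, ζ ^ (2 ^ (n + 1)) = 1 → (c₀ * absGaloisRestrict ℚ K ρ) • ζ = ζ⁻¹) ∧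
      (∃ P : geomTorsion W ((2 ^ (n + 1) : ℕ) : ℤ),
        (2 : ℤ) ^ n • (P + (c₀ * absGaloisRestrict ℚ K ρ) • P) ≠ 0) ∧
      (∀ (k : ℕ) (X : geomTorsion W ((2 ^ (n + 1) : ℕ) : ℤ)), (2 : ℤ) ^ k • X = 0 →
          (c₀ * absGaloisRestrict ℚ K ρ) • X = X →
          ∃ Y : geomTorsion W ((2 ^ (n + 1) : ℕ) : ℤ),
            (2 : ℤ) ^ k • Y = 0 ∧ X = Y + (c₀ * absGaloisRestrict ℚ K ρ) • Y) ∧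
      ∀ b : ℕ, ∃ ℓ : ℕ, b < ℓ ∧ ℓ.Prime ∧ ¬ ℓ ∣ N ∧ ¬ ((ℓ : ℤ) ∣ NumberField.discr K) ∧ ℓ ≠ 2 ∧
        (Ideal.span {(ℓ : 𝓞 K)}).IsPrime ∧
        (∃ (v : HeightOneSpectrum (𝓞 ℚ)) (𝔓 : Ideal (absIntegers (𝓞 ℚ) ℚ)) (h : absoluteGaloisGroup ℚ),
          (ℓ : 𝓞 ℚ) ∈ v.asIdeal ∧ 𝔓 ∈ v.primesAbove ∧ IsArithFrobAt (𝓞 ℚ) h 𝔓 ∧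
          (∀ P : geomTorsion W ((2 ^ (n + 1) : ℕ) : ℤ), h • P = (c₀ * absGaloisRestrict ℚ K ρ) • P) ∧
          ∀ (e : K →ₐ[ℚ] AlgebraicClosure ℚ) (x : K), h • e x = c₀ • e x) ∧
        2 ^ (n + 1) ∣ ℓ + 1 ∧ ((2 : ℤ) ^ (n + 1)) ∣ W.frobeniusTrace ℓ ∧
        ∀ i, ∀ v : HeightOneSpectrum (𝓞 K), (ℓ : 𝓞 K) ∈ v.asIdeal →
          (((2 : ℤ) ^ Nv i) • cs i ∈
              (W.baseChange K).torsionLocalKer (v.adicCompletion K) ((2 ^ (n + 1) : ℕ) : ℤ) ∧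
            (Nv i ≠ 0 → ((2 : ℤ) ^ (Nv i - 1)) • cs i ∉
              (W.baseChange K).torsionLocalKer (v.adicCompletion K) ((2 ^ (n + 1) : ℕ) : ℤ))) := by
  obtain ⟨hS, hC⟩ := imageTokens_two_of_heegner (W := W) hK hodd hH hρ2
  exact exists_regular_kolyvaginPrime_of_supply hCheb hK n hc₀ (fun A ↦
    exists_mul_absGaloisRestrict_smul_eq_addAut_of_heegner hK hodd hH hsurj c₀ A) hc hS hC cs hπ hcs e he hind hres Nv hNe heM hNπ

end EnginePortK

/-! ## §M  The regular primes in the STUB VOCABULARY: `Zhang2014.IsKolyvaginPrime N W K 2 ℓ` with `M(ℓ) ≥ n + 1`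
(`Zhang2014.levelIndex`) — Zhang's notion has no Frobenius-class condition, so §K's primes qualify verbatim. -/

section StubVocabularyM

open WeierstrassCurve NumberField IsDedekindDomain Field
open Literature.NumberTheory.GaloisRepresentations Literature.NumberTheory.EllipticCurves Literature.NumberTheory
open Summit.BirchSwinnertonDyer.BirchSwinnertonDyer.Theorems

universe u

variable {W : WeierstrassCurve ℚ} {K : Type u} [Field K] [NumberField K]

/-- **A regular Kolyvagin prime of level `2^{n+1}` is a Zhang-Kolyvagin prime at `p = 2` with `M(ℓ) ≥ n + 1`** — the vocabulary
of the big-image stubs S3/S4/S5 (`Zhang2014.IsKolyvaginPrime (W.conductorNorm ℤ) W K 2 ℓ`, `Zhang2014.levelIndex W 2 n`): Zhang's notion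
carries NO Frobenius-class condition (unlike Gross's (3.2) `FrobEqFrobInfty`), only `ℓ ∤ N d_K`, `ℓ ≠ 2`, `(ℓ)` inert and `M(ℓ) > 0`, all of which
§K delivers. [cite: WZhang2014, Notations (xii)] -/
theorem zhang_isKolyvaginPrime_two_of_regular [W.IsGloballyMinimal] {N ℓ n : ℕ} (hℓ : ℓ.Prime) (hN : ¬ ℓ ∣ N)
    (hd : ¬ ((ℓ : ℤ) ∣ NumberField.discr K)) (h2 : ℓ ≠ 2) (hP : (Ideal.span {(ℓ : 𝓞 K)}).IsPrime)
    (h1 : 2 ^ (n + 1) ∣ ℓ + 1) (ha : ((2 : ℤ) ^ (n + 1)) ∣ W.frobeniusTrace ℓ) :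
    Zhang2014.IsKolyvaginPrime N W K 2 ℓ ∧ n + 1 ≤ Zhang2014.kolyvaginIndex W 2 ℓ ∧
      ((n + 1 : ℕ) : ℕ∞) ≤ Zhang2014.levelIndex W 2 ℓ := by
  haveI : Fact (Nat.Prime 2) := ⟨Nat.prime_two⟩
  have hM : n + 1 ≤ Zhang2014.kolyvaginIndex W 2 ℓ :=
    Zhang2014.le_kolyvaginIndex_iff.mpr ⟨h1, by exact_mod_cast ha⟩
  refine ⟨⟨hℓ, hN, hd, h2, hP, by omega⟩, hM, ?_⟩
  rw [Zhang2014.natCast_le_levelIndex_iff]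
  intro q hq
  rw [hℓ.primeFactors, Finset.mem_singleton] at hq
  subst hq
  exact hM

/-- Square-free products: if every prime factor of `m` is a regular Kolyvagin prime of level `2^{n+1}` then `M(m) ≥ n + 1`
(`Zhang2014.levelIndex`). [cite: WZhang2014, Notations (xii)] -/
theorem le_levelIndex_two_of_forall [W.IsGloballyMinimal] {m n : ℕ}
    (h : ∀ ℓ ∈ m.primeFactors, 2 ^ (n + 1) ∣ ℓ + 1 ∧ ((2 : ℤ) ^ (n + 1)) ∣ W.frobeniusTrace ℓ) :
    ((n + 1 : ℕ) : ℕ∞) ≤ Zhang2014.levelIndex W 2 m := by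
  haveI : Fact (Nat.Prime 2) := ⟨Nat.prime_two⟩
  rw [Zhang2014.natCast_le_levelIndex_iff]
  intro ℓ hℓ
  obtain ⟨h1, ha⟩ := h ℓ hℓ
  exact Zhang2014.le_kolyvaginIndex_iff.mpr ⟨h1, by exact_mod_cast ha⟩

/-- **THE ENGINE PORT IN THE BIG-IMAGE STUBS' OWN WORDS** (S3/S4/S5: `Zhang2014.IsKolyvaginPrime (W.conductorNorm ℤ) W K 2 ℓ`,
`levelIndex`): under the stub binders (`IsImaginaryQuadratic K`, `Odd d_K`, `SatisfiesHeegnerHypothesis N_E K`, `ρ̄_{E,2}` and `ρ̄_{E,2^{n+1}}` onto), a complex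
conjugation `c₀`, `c ≠ 1`, τ-stable class data and Čebotarev: ONE `ρ ∈ Γ_K` with `h = c₀ · res ρ` a lossless `μ`-inverting involution on `E[2^{n+1}]`, and beyond every
bound a prime `ℓ` which is a ZHANG–KOLYVAGIN PRIME AT `2` of level index `≥ n + 1`, whose Frobenius is `h` on `E[2^{n+1}]` and `c₀` on `K`, with the prescribed EXACT
local orders of the classes at `λ ∣ ℓ`.  (Take `N := W.conductorNorm ℤ`.) [cite: WZhang2014, Notations (xii)] [cite: GrossLMS1991, §3, §9] -/
theorem exists_regular_zhangKolyvaginPrimes_of_heegner (hCheb : Automorphic.chebotarev_artinRep) {N : ℕ}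
    [NeZero N] [W.IsElliptic] [W.IsGloballyMinimal] (hK : IsImaginaryQuadratic K)
    (hodd : Odd (NumberField.discr K)) (hH : SatisfiesHeegnerHypothesis (W.conductorNorm ℤ) K) (n : ℕ)
    (hρ2 : W.HasSurjectiveModNGaloisRep 2) (hsurj : W.HasSurjectiveModNGaloisRep ((2 ^ (n + 1) : ℕ) : ℤ))
    {c₀ : absoluteGaloisGroup ℚ} (hc₀ : IsComplexConjugation (Rat.castHom ℝ) c₀)
    {c : K ≃ₐ[ℚ] K} (hc : c ≠ 1)
    {r : ℕ} (cs : Fin r → galH1Torsion (W.baseChange K) ((2 ^ (n + 1) : ℕ) : ℤ)) {π : Fin r → Fin r}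
    (hπ : ∀ i, π (π i) = i) (hcs : ∀ i, conjAct W c ((2 ^ (n + 1) : ℕ) : ℤ) (cs i) = cs (π i))
    (e : Fin r → ℕ) (he : ∀ i, ((2 : ℤ) ^ e i) • cs i = 0)
    (hind : ∀ a : Fin r → ℤ, ∑ i, a i • cs i = 0 → ∀ i, ((2 : ℤ) ^ e i) ∣ a i)
    (hres : ∀ a : Fin r → ℤ, (∀ ρ ∈ torsionFixing (W.baseChange K) ((2 ^ (n + 1) : ℕ) : ℤ),
      h1Eval (W.baseChange K) ((2 ^ (n + 1) : ℕ) : ℤ) (∑ i, a i • cs i) ρ = 0) → ∑ i, a i • cs i = 0)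
    (Nv : Fin r → ℕ) (hNe : ∀ i, Nv i ≤ e i) (heM : ∀ i, e i ≤ n + 1) (hNπ : ∀ i, Nv (π i) = Nv i) :
    ∃ ρ : absoluteGaloisGroup K,
      (∀ X : geomTorsion W ((2 ^ (n + 1) : ℕ) : ℤ),
        (c₀ * absGaloisRestrict ℚ K ρ) • (c₀ * absGaloisRestrict ℚ K ρ) • X = X) ∧
      (∀ ζ : AlgebraicClosure ℚ, ζ ^ (2 ^ (n + 1)) = 1 → (c₀ * absGaloisRestrict ℚ K ρ) • ζ = ζ⁻¹) ∧
      (∃ P : geomTorsion W ((2 ^ (n + 1) : ℕ) : ℤ),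
        (2 : ℤ) ^ n • (P + (c₀ * absGaloisRestrict ℚ K ρ) • P) ≠ 0) ∧
      (∀ (k : ℕ) (X : geomTorsion W ((2 ^ (n + 1) : ℕ) : ℤ)), (2 : ℤ) ^ k • X = 0 →
          (c₀ * absGaloisRestrict ℚ K ρ) • X = X →
          ∃ Y : geomTorsion W ((2 ^ (n + 1) : ℕ) : ℤ),
            (2 : ℤ) ^ k • Y = 0 ∧ X = Y + (c₀ * absGaloisRestrict ℚ K ρ) • Y) ∧
      ∀ b : ℕ, ∃ ℓ : ℕ, b < ℓ ∧ Zhang2014.IsKolyvaginPrime N W K 2 ℓ ∧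
        ((n + 1 : ℕ) : ℕ∞) ≤ Zhang2014.levelIndex W 2 ℓ ∧
        (∃ (v : HeightOneSpectrum (𝓞 ℚ)) (𝔓 : Ideal (absIntegers (𝓞 ℚ) ℚ)) (h : absoluteGaloisGroup ℚ),
          (ℓ : 𝓞 ℚ) ∈ v.asIdeal ∧ 𝔓 ∈ v.primesAbove ∧ IsArithFrobAt (𝓞 ℚ) h 𝔓 ∧
          (∀ P : geomTorsion W ((2 ^ (n + 1) : ℕ) : ℤ), h • P = (c₀ * absGaloisRestrict ℚ K ρ) • P) ∧
          ∀ (e : K →ₐ[ℚ] AlgebraicClosure ℚ) (x : K), h • e x = c₀ • e x) ∧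
        ∀ i, ∀ v : HeightOneSpectrum (𝓞 K), (ℓ : 𝓞 K) ∈ v.asIdeal →
          (((2 : ℤ) ^ Nv i) • cs i ∈
              (W.baseChange K).torsionLocalKer (v.adicCompletion K) ((2 ^ (n + 1) : ℕ) : ℤ) ∧
            (Nv i ≠ 0 → ((2 : ℤ) ^ (Nv i - 1)) • cs i ∉
              (W.baseChange K).torsionLocalKer (v.adicCompletion K) ((2 ^ (n + 1) : ℕ) : ℤ))) := by
  obtain ⟨ρ, h1, h2, h3, h4, hℓ⟩ := exists_regular_kolyvaginPrime_of_heegner (N := N) hCheb hK hodd hH n hρ2 hsurj hc₀ hc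
    cs hπ hcs e he hind hres Nv hNe heM hNπ
  refine ⟨ρ, h1, h2, h3, h4, fun b ↦ ?_⟩
  obtain ⟨ℓ, hb, hℓp, hℓN, hℓd, hℓ2, hℓP, hfrob, hℓ1, hℓa, hloc⟩ := hℓ b
  obtain ⟨hZ, -, hlev⟩ := zhang_isKolyvaginPrime_two_of_regular (W := W) (K := K) (N := N) hℓp hℓN hℓd hℓ2 hℓP hℓ1 hℓa
  exact ⟨ℓ, hb, hZ, hlev, hfrob, hloc⟩


/-- A nontrivial `ℚ`-automorphism of an imaginary quadratic field (its complex conjugation; `#Aut(K/ℚ) = [K:ℚ] = 2`). [folklore] -/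
theorem exists_algEquiv_ne_one_of_isImaginaryQuadratic (hK : IsImaginaryQuadratic K) : ∃ c : K ≃ₐ[ℚ] K, c ≠ 1 := by
  haveI : Algebra.IsQuadraticExtension ℚ K := ⟨hK.1⟩
  have hcard : Nat.card (K ≃ₐ[ℚ] K) = 2 := by rw [IsGalois.card_aut_eq_finrank, hK.1]
  obtain ⟨y, hy, -⟩ := (Nat.card_eq_two_iff' (1 : K ≃ₐ[ℚ] K)).mp hcard
  exact ⟨y, hy⟩

/-- **SELF-CONTAINED SUPPLY OF REGULAR ZHANG–KOLYVAGIN PRIMES FOR THE BIG-IMAGE STUBS** (no classes: `r = 0`; the complex conjugations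
`c₀ ∈ Γ_ℚ` and `c ∈ Aut(K/ℚ)` are PRODUCED, not assumed).  Hypotheses = Čebotarev + the stub binders `IsImaginaryQuadratic K`, `Odd d_K`,
`SatisfiesHeegnerHypothesis N_E K`, `ρ̄_{E,2}` onto, `ρ̄_{E,2^{n+1}}` onto.  Conclusion: a complex conjugation `c₀`, one `ρ ∈ Γ_K` with `h = c₀ · res ρ`
a LOSSLESS `μ_{2^{n+1}}`-inverting involution on `E[2^{n+1}]`, and beyond every bound a prime `ℓ` with `Zhang2014.IsKolyvaginPrime N W K 2 ℓ`,
`M(ℓ) ≥ n + 1`, whose arithmetic Frobenius is `h` on `E[2^{n+1}]` and `c₀` on `K`.  (S3's `n`-supply at any level; take `N := W.conductorNorm ℤ`.)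
[cite: WZhang2014, Notations (xii)] [cite: GrossLMS1991, §3, §9] -/
theorem exists_regular_zhangKolyvaginPrimes_of_heegner_primesOnly (hCheb : Automorphic.chebotarev_artinRep) {N : ℕ}
    [NeZero N] [W.IsElliptic] [W.IsGloballyMinimal] (hK : IsImaginaryQuadratic K)
    (hodd : Odd (NumberField.discr K)) (hH : SatisfiesHeegnerHypothesis (W.conductorNorm ℤ) K) (n : ℕ)
    (hρ2 : W.HasSurjectiveModNGaloisRep 2) (hsurj : W.HasSurjectiveModNGaloisRep ((2 ^ (n + 1) : ℕ) : ℤ)) :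
    ∃ (c₀ : absoluteGaloisGroup ℚ) (ρ : absoluteGaloisGroup K), IsComplexConjugation (Rat.castHom ℝ) c₀ ∧
      (∀ X : geomTorsion W ((2 ^ (n + 1) : ℕ) : ℤ),
        (c₀ * absGaloisRestrict ℚ K ρ) • (c₀ * absGaloisRestrict ℚ K ρ) • X = X) ∧
      (∀ ζ : AlgebraicClosure ℚ, ζ ^ (2 ^ (n + 1)) = 1 → (c₀ * absGaloisRestrict ℚ K ρ) • ζ = ζ⁻¹) ∧
      (∃ P : geomTorsion W ((2 ^ (n + 1) : ℕ) : ℤ),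
        (2 : ℤ) ^ n • (P + (c₀ * absGaloisRestrict ℚ K ρ) • P) ≠ 0) ∧
      (∀ (k : ℕ) (X : geomTorsion W ((2 ^ (n + 1) : ℕ) : ℤ)), (2 : ℤ) ^ k • X = 0 →
          (c₀ * absGaloisRestrict ℚ K ρ) • X = X →
          ∃ Y : geomTorsion W ((2 ^ (n + 1) : ℕ) : ℤ),
            (2 : ℤ) ^ k • Y = 0 ∧ X = Y + (c₀ * absGaloisRestrict ℚ K ρ) • Y) ∧
      ∀ b : ℕ, ∃ ℓ : ℕ, b < ℓ ∧ Zhang2014.IsKolyvaginPrime N W K 2 ℓ ∧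
        ((n + 1 : ℕ) : ℕ∞) ≤ Zhang2014.levelIndex W 2 ℓ ∧
        (∃ (v : HeightOneSpectrum (𝓞 ℚ)) (𝔓 : Ideal (absIntegers (𝓞 ℚ) ℚ)) (h : absoluteGaloisGroup ℚ),
          (ℓ : 𝓞 ℚ) ∈ v.asIdeal ∧ 𝔓 ∈ v.primesAbove ∧ IsArithFrobAt (𝓞 ℚ) h 𝔓 ∧
          (∀ P : geomTorsion W ((2 ^ (n + 1) : ℕ) : ℤ), h • P = (c₀ * absGaloisRestrict ℚ K ρ) • P) ∧
          ∀ (e : K →ₐ[ℚ] AlgebraicClosure ℚ) (x : K), h • e x = c₀ • e x) := by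
  obtain ⟨c₀, hc₀⟩ := exists_isComplexConjugation (Rat.castHom ℝ)
  obtain ⟨c, hc⟩ := exists_algEquiv_ne_one_of_isImaginaryQuadratic hK
  obtain ⟨ρ, h1, h2, h3, h4, hℓ⟩ := exists_regular_zhangKolyvaginPrimes_of_heegner (N := N) hCheb hK hodd hH n
    hρ2 hsurj hc₀ hc (r := 0) (fun i ↦ i.elim0) (π := fun i ↦ i) (fun i ↦ rfl) (fun i ↦ i.elim0)
    (fun i ↦ i.elim0) (fun i ↦ i.elim0) (fun _ _ i ↦ i.elim0) (fun a _ ↦ by simp) (fun i ↦ i.elim0)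
    (fun i ↦ i.elim0) (fun i ↦ i.elim0) (fun i ↦ i.elim0)
  refine ⟨c₀, ρ, hc₀, h1, h2, h3, h4, fun b ↦ ?_⟩
  obtain ⟨ℓ, hb, hZ, hlev, hfrob, -⟩ := hℓ b
  exact ⟨ℓ, hb, hZ, hlev, hfrob⟩

end StubVocabularyM

end Summit.BirchSwinnertonDyer.BirchSwinnertonDyer.Cruxes.RankOneAtTwoOffBigImageOddLocal.RefinedKolyvaginTamagawaShiftAtTwo.EngineG6

end
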